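/-
Copyright: h21 programme. Crux workfile (val-idea-28 g5, lens «degeneration – orbit-closure»).
-/
import Mathlib
import Summits.ValiantsHypothesis.ValiantsHypothesis.Cruxes.DualUnipotentThreeHalves.Lines.radical_split
import Summits.ValiantsHypothesis.ValiantsHypothesis.Theorems.GrenetZeonDualUnipotentThreeHalvesSlowCoreLedger

/-!
# Initial forms along a one-parameter torus — the topology-free closure step (MEMO-g5-closure-lever §5, Lemma 5)

Honest status: VP ≠ VNP is NOT proved; crux 24318 `DualUnipotentThreeHalves` is OPEN.  This file proves NO case of any law.
It supplies the kernel form of the one non-elementary step («1-psg / torus closure, ∉ Mathlib», idea-30 MEMO §3 N5,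
R312 (1) `H_coord`) for certificate conditions that are given by POLYNOMIAL identities (index currency `Qᵃ = 0`, power
currency `deg_s ≤ k`, and every fixed word family):

* `torusAct w τ v = (τ ^ w e · v e)_e` — the diagonal one-parameter torus with weights `w : ι → ℕ`;
* `initSub w K` — the INITIAL SUBSPACE of `K` along `λ_w` (sums over weights `c` of the weight-`c` components of elements of
  `K` supported on weights `≥ c`; the `gr` construction of `WeightShadow.L1_grSub_graded`), with the dimension count
  `finrank_initSub : finrank (initSub w K) = finrank K` (telescoping ranks, self-contained);
* `eval_eq_zero_of_mem_initSub` — **if a family `𝓕` of polynomials vanishes on `λ_w(τ) • K` for every `τ ≠ 0`, it vanishes on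
  `initSub w K`.**  Proof: for `s = Σ_c π_c(t_c)` put `q(τ) := Σ_c τ^{-c} t_c ∈ K`; then `λ_w(τ) q(τ) = s + τ·(polynomial)`, so
  `F(λ_w(τ) q(τ))` is a polynomial in `τ` vanishing on `ℂ ∖ {0}`, hence identically, hence at `τ = 0`, where it equals `F(s)`.
  No Grassmannian, no properness, no Borel fixed point: `Polynomial.eq_zero_of_infinite_isRoot` is the whole of the topology.
* `wtProj_mem_initSub` — `initSub w K` is weight-graded (a sum of its weight components; a COORDINATE subspace when the
  weights are pairwise distinct on the support);
* `exists_graded_of_torusStable` — the packaged statement: ∃ weight-graded `K₀`, `finrank K₀ = finrank K`, `𝓕` vanishes on `K₀`.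

PART II (rev 3, namespace `InitialForm.TorusClosure`, imports `Lines.radical_split`) APPLIES this to FLAG-cheap certificates and proves
`H_coord` AS A THEOREM: `flagCheap_graded_of_torusEquivariant` / `not_flagCheap_of_graded` — for an affine pencil equivariant under a
one-parameter torus up to nonzero scalars (`TorusEquivariant`; every LINEAR pencil whose coordinate matrices are weight vectors of a
diagonal cocharacter qualifies, weights of both signs, `torusEquivariant_linPencil`) a flag-cheap certificate may be taken WEIGHT-GRADED
(bounded level types + products of violating-word entries + Part I; no topology).

PART III (rev 5, section `CurveClosure`, Mathlib only) is the same step along an arbitrary POLYNOMIAL CURVE for ALGEBRAIC families of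
certificates: `CurveClosure.exists_limit_of_algebraic_family` (Smith normal form over `𝕜[X]` + `t`-adic initial vectors) — the kernel half
of crit-7's (Cl) `SlowClosedAlongCurves`; the pointwise half (curve selection / properness) is NOT here.

PART IV (rev 6, section `MonomialCount`) is crit-7 V29-1/V29-4 (δ): with singleton weight classes off an exceptional set `Z` a graded `K`
contains the basis vector of every coordinate it uses off `Z` (`exists_wild_coordinate`), so `hkill` is the COUNT
`#{e ∉ Z | e tame} + #Z ≤ (k+1)·n` — `TorusClosure.not_flagCheap_of_count`.

PART V (rev 7, namespace `InitialForm.SlowCurve`) instantiates Part III to the POWER currency: `slow_curve_zero_of_algebraic_family`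
(universal coefficients `G`, LEMMA U `eval_G`) — `Slow` passes to `t = 0` along a polynomial curve for ALGEBRAIC certificate families.

PART VI (rev 8, namespace `InitialForm.SlowTorus`, imports `Theorems…SlowCoreDefs`) is H_coord IN THE POWER CURRENCY: the `Slow` cone is
torus-stable for torus-equivariant pencils (`map_θ_eq` lifts point equivariance to the polynomial identity `N.map θ = (a•D)·N·D'` by
`MvPolynomial.funext`; `map_lineSubst_torusAct`; `slowCone_torusAct`), so `slow_graded_of_torusEquivariant` (graded certificate, same `k`,
same dimension) and the monomial count ★ `not_slow_of_count : … → ¬ SlowCore.Slow n m N` BY NAME; `slow_curve_zero_byName` restates Part V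
with the Theorems-side `Slow`; rev 9 adds the EXACT characterisation `slow_iff_coordinate_span` (distinct weights: `Slow` iff some coordinate set
`T`, `#T > (k+1)·n`, spans a subspace inside the `k`-slow cone — the cone is NOT a subspace, so per-coordinate tameness alone is only NECESSARY).

PART VII (rev 10, namespace `InitialForm.LedgerTorus`, imports `Theorems…SlowCoreLedger`) moves the same three facts to the LEDGER / `RelCert` currency of
(c) `LongMassSlowLawInv` (THE research stub of `slow_core` rev 3): `Gp`/`eval_Gp` (universal coefficients of every power), `WindowCone`,
`windowCone_torusAct`, `ledger_graded_of_torusEquivariant`, ★ `relCert_iff_coordinate_span`, ★ `not_relCert_of_count` — BY NAME against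
`SlowCore.Ledger` / `SlowCore.RelCert`; and `relCert_curve_zero_of_algebraic_family` (Part V in (c)'s currency: algebraic ledger families pass to
`t = 0` with the same price).

PART VIII (revs 12–13, namespaces `InitialForm.UnipotentClosure` (Mathlib only) and `InitialForm.LedgerUnipotent`) is the UNIPOTENT HALF of the Borel
normal form (MEMO-g5-closure-lever rev 1.7 §5 U1–U4), kernel-checked and topology-free: ★ `UnipotentClosure.exists_stable_of_expStable` — for a
NILPOTENT matrix `A` on the coordinate space and a family `𝓕` of polynomial conditions, if the orbit `exp(u·A)·K` (`u ∈ ℂ`) of a subspace `K` lies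
in the zero locus of `𝓕`, then some `K₀` of the SAME dimension lies in it and is `A`-STABLE.  Proof: the algebraic family `N = s^D·exp(A/s)·K[s]`
over `ℂ[s]` (rank = `finrank K`: `Φm_mulVec_injective`, `finrank_Nfam`); the CANONICAL curve-closure limit at `s = 0` (Part III′
`CurveClosure.exists_limit_of_algebraic_family'`: Part III plus «every polynomial vector whose values lie in the evaluated family at infinitely many
parameters has its initial vector in `K₀`»); stability because the family is carried to itself by the polynomial Möbius reparametrisation
`s ↦ s/(1−us)` composed with `exp(u·A)` (`mob`, `mob_eval`), so `exp(u·A)·K₀ ⊆ K₀` for all `u`, whence `A·K₀ ⊆ K₀` (separating functional +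
`Polynomial.funext`).  BY NAME against `SlowCore.Ledger` / `SlowCore.RelCert`: `LedgerUnipotent.σ` / `map_σ_eq` / `map_lineSubst_linAct` (point
equivariance under a linear change of coordinates lifts to the line polynomials), `windowCone_linAct`, ★★ `ledger_stable_of_unipotentEquivariant` and
★★ `relCert_stable_of_unipotentEquivariant` — a `RelCert n m N P` certificate of a pencil with a unipotent one-parameter symmetry `exp(u·A)`
(`LinEquivariant N (exp (u • A))` for all `u`) may be taken `A`-stable with the same order `k`, finrank and PRICE `P`.  Rev 13 adds the JOINT
(BOREL) NORMAL FORM, kernel: `UnipotentClosure.exists_stable_of_expStable_core` (the canonical limit is moreover stable under every linear symmetry `G` of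
`K` normalising the group, `G A = c·A G`, `c ≠ 0` — reparametrisation `s ↦ c s`), ★ `graded_of_torusStable` (a torus-STABLE subspace is weight-GRADED:
Part I applied to the subspace's own linear equations + a separating functional), ★★ `exists_graded_stable` (torus and `exp(u·A)` both preserving the zero
locus, `A` a torus weight vector up to scalars ⇒ a subspace of the SAME dimension in the zero locus that is weight-graded AND `A`-stable), and BY NAME
★★ `LedgerUnipotent.ledger_borel_of_equivariant` / ★★ `relCert_borel_of_equivariant` (`TorusEquivariant N w`, `LinEquivariant N (exp (u • A))` ∀ u,
`λ_w(τ) A = c_τ A λ_w(τ)` ⇒ a `RelCert n m N P` certificate may be taken weight-graded and `A`-stable, same `k`, finrank, price).  The unipotent symmetry is a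
HYPOTHESIS to be exhibited per candidate pencil (the gauge pencil `W(b)` has none — crit-7 00:27:11Z; memo rev 1.8.1 erratum).  Nothing here bears on the
truth of (c); 24318 OPEN; VP ≠ VNP NOT proved.  Nothing here proves R2ᵖ / IRR / RED / 24318 / VP ≠ VNP (all OPEN); these are instruments.

PART X (rev 14, namespaces `InitialForm.GradedModule` (generic `ι`, Part I only) and `InitialForm.GradedIrreducible` (by name vs `SlowCore.IrreducibleInv`)):
torus closure on the MODULE side — ★ `GradedModule.exists_graded_invariant` (an invariant subspace of a family of `h`-HOMOGENEOUS operators, degrees of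
either sign, may be replaced by its initial subspace: weight-graded, invariant, same finrank), ★ `bot_or_top_of_stronglyConnected` (simple weights + strongly
connected joint support ⇒ no common invariant subspace but `⊥`, `⊤`), ★ `GradedIrreducible.irreducibleInv_of_graded_stronglyConnected` /
`irreducibleInv_linPencil_of_graded_stronglyConnected : … → IrreducibleInv (linPencil M)` (idea-27 g8 row r10 «SCC graded pencils are IrreducibleInv», crit-7
V38 (B) «paper (kernel M)» — now kernel; no Burnside, no topology); rev 15 adds the converse `not_irreducibleInv_linPencil_of_closed` (no grading needed:
a closed vertex set spans an invariant coordinate subspace) and the EXACT TEST ★ `irreducibleInv_linPencil_iff_stronglyConnected` (simple weights, homogeneous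
coefficients: `IrreducibleInv (linPencil M)` ⟺ the joint support digraph is strongly connected — the census of irreducible graded species is a finite
combinatorial check).  Instruments; (c) / 24318 OPEN; VP ≠ VNP NOT proved.
(Part II lives in this file because crux workfiles are not importable modules on the farm.)

Use of Part I alone (by name, for the typist of `¬IndexCoreLaw`): take `ι = Fin n × Fin n`, `w` the torus
weights of the coordinate matrices of `E(n)` (idea-30 §3), `𝓕` the entries of `(linPart N v)ᵃ` (index currency) or the
`s^ℓ`-coefficients, `ℓ > k`, of the entries of `(N(x + s v))^{n-1}` over all `x` (power currency) as polynomials in `v`;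
torus-equivariance of `N` gives the hypothesis `hK` from ONE certificate `K`; the conclusion is a weight-graded certificate
`initSub w K` of the same dimension.  The FLAG currency needs, in addition, line-uniform word parameters `(r, c, Θ)` before
`𝓕` is a fixed family (MEMO-g5-closure-lever rev 1.1 §1, kernel note (iii)).
-/

set_option linter.dupNamespace false

namespace Summit.ValiantsHypothesis.ValiantsHypothesis.Cruxes.DualUnipotentThreeHalves.InitialForm

open Polynomial

variable {ι : Type*}

/-- The diagonal one-parameter torus with weights `w`: `(λ_w(τ) v)_e = τ ^ (w e) * v e`. [folklore] -/
def torusAct (w : ι → ℕ) (τ : ℂ) (v : ι → ℂ) : ι → ℂ := fun e => τ ^ (w e) * v e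

/-- Weight-`c` component of `v` (coordinates of weight `c` kept, the others zeroed). [folklore] -/
def wtProj (w : ι → ℕ) (c : ℕ) (v : ι → ℂ) : ι → ℂ := fun e => if w e = c then v e else 0

/-- `v` is supported on coordinates of weight `≥ c`. -/
def SuppGe (w : ι → ℕ) (c : ℕ) (v : ι → ℂ) : Prop := ∀ e, w e < c → v e = 0

/-- `s` is an INITIAL FORM of `K` along `λ_w`: `s_e = (t_{w e})_e` for a family `t_c ∈ K` with `t_c` supported on weights `≥ c`
(i.e. `s = Σ_c π_c(t_c)`). [this file; = the `gr` of a subspace, WeightShadow §L1] -/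
def IsInitialForm (w : ι → ℕ) (K : Submodule ℂ (ι → ℂ)) (s : ι → ℂ) : Prop :=
  ∃ t : ℕ → (ι → ℂ), (∀ c, t c ∈ K) ∧ (∀ c, SuppGe w c (t c)) ∧ ∀ e, s e = t (w e) e

/-- The INITIAL SUBSPACE `in_λ(K)` of `K` along the torus `λ_w`. [this file] -/
def initSub (w : ι → ℕ) (K : Submodule ℂ (ι → ℂ)) : Submodule ℂ (ι → ℂ) where
  carrier := {s | IsInitialForm w K s}
  zero_mem' := ⟨fun _ => 0, fun _ => K.zero_mem, fun _ _ _ => rfl, fun _ => rfl⟩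
  add_mem' := by
    rintro a b ⟨ta, hta, hsa, ha⟩ ⟨tb, htb, hsb, hb⟩
    refine ⟨fun c => ta c + tb c, fun c => K.add_mem (hta c) (htb c), fun c e he => ?_, fun e => ?_⟩
    · simp [Pi.add_apply, hsa c e he, hsb c e he]
    · simp [Pi.add_apply, ha e, hb e]
  smul_mem' := by
    rintro r a ⟨ta, hta, hsa, ha⟩
    refine ⟨fun c => r • ta c, fun c => K.smul_mem r (hta c), fun c e he => ?_, fun e => ?_⟩
    · simp [Pi.smul_apply, hsa c e he]
    · simp [Pi.smul_apply, ha e]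

theorem mem_initSub {w : ι → ℕ} {K : Submodule ℂ (ι → ℂ)} {s : ι → ℂ} :
    s ∈ initSub w K ↔ IsInitialForm w K s := Iff.rfl

/-- Elements of `K` supported on weights `≥ c` contribute their weight-`c` component. -/
theorem wtProj_mem_initSub_of_mem {w : ι → ℕ} {K : Submodule ℂ (ι → ℂ)} {v : ι → ℂ} (hv : v ∈ K) {c : ℕ}
    (hs : SuppGe w c v) : wtProj w c v ∈ initSub w K := by
  refine ⟨fun c' => if c' = c then v else 0, fun c' => ?_, fun c' e he => ?_, fun e => ?_⟩
  · by_cases h : c' = c <;> simp [h, hv]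
  · by_cases h : c' = c
    · subst h; simp [hs e he]
    · simp [h]
  · by_cases h : w e = c <;> simp [wtProj, h]

/-- A vector all of whose weight components lie in `K` is an initial form of `K` (so `initSub w K = K` for weight-graded `K`). -/
theorem self_mem_initSub_of_graded {w : ι → ℕ} {K : Submodule ℂ (ι → ℂ)} {v : ι → ℂ}
    (hgr : ∀ c, wtProj w c v ∈ K) : v ∈ initSub w K := by
  refine ⟨fun c => wtProj w c v, hgr, fun c e he => ?_, fun e => ?_⟩
  · simp [wtProj, Nat.ne_of_lt he]
  · simp [wtProj]

/-- `initSub w K` is WEIGHT-GRADED: stable under every weight projection. -/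
theorem wtProj_mem_initSub {w : ι → ℕ} {K : Submodule ℂ (ι → ℂ)} {s : ι → ℂ} (hs : s ∈ initSub w K) (c : ℕ) :
    wtProj w c s ∈ initSub w K := by
  obtain ⟨t, ht, hsupp, hse⟩ := hs
  refine ⟨fun c' => if c' = c then t c else 0, fun c' => ?_, fun c' e he => ?_, fun e => ?_⟩
  · by_cases h : c' = c <;> simp [h, ht]
  · by_cases h : c' = c
    · subst h; simp [hsupp c' e he]
    · simp [h]
  · by_cases h : w e = c
    · simp [wtProj, h, hse e]
    · simp [wtProj, h]

/-- Evaluation of an `MvPolynomial` after substituting one-variable polynomials commutes with evaluating those polynomials. -/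
theorem eval_aeval_polynomial (U : ι → Polynomial ℂ) (F : MvPolynomial ι ℂ) (τ : ℂ) :
    (MvPolynomial.aeval U F).eval τ = MvPolynomial.eval (fun e => (U e).eval τ) F := by
  induction F using MvPolynomial.induction_on with
  | C a => simp
  | add p q hp hq => simp [map_add, Polynomial.eval_add, hp, hq]
  | mul_X p e hp => simp [map_mul, Polynomial.eval_mul, hp, MvPolynomial.aeval_X, MvPolynomial.eval_X]

/-- **INITIAL-FORM LEMMA (topology-free torus closure).**  If every `F ∈ 𝓕` vanishes on `λ_w(τ) • K` for every `τ ≠ 0`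
(for a certificate condition this is the torus-EQUIVARIANCE of the pencil applied to ONE certificate `K`), then every
`F ∈ 𝓕` vanishes on the initial subspace `initSub w K`. [this file; MEMO-g5-closure-lever §5] -/
theorem eval_eq_zero_of_mem_initSub [Fintype ι] (w : ι → ℕ) (K : Submodule ℂ (ι → ℂ)) (𝓕 : Set (MvPolynomial ι ℂ))
    (hK : ∀ τ : ℂ, τ ≠ 0 → ∀ v ∈ K, ∀ F ∈ 𝓕, MvPolynomial.eval (torusAct w τ v) F = 0)
    {s : ι → ℂ} (hs : s ∈ initSub w K) {F : MvPolynomial ι ℂ} (hF : F ∈ 𝓕) :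
    MvPolynomial.eval s F = 0 := by
  obtain ⟨t, ht, hsupp, hse⟩ := hs
  -- all weights are `≤ D`
  set D : ℕ := Finset.univ.sup w with hD
  have hwD : ∀ e, w e ≤ D := fun e => Finset.le_sup (f := w) (Finset.mem_univ e)
  -- coordinates of `t c` vanish below weight `c`
  have htz : ∀ c e, w e < c → t c e = 0 := fun c e he => hsupp c e he
  -- the curve `q(τ) = Σ_{c ≤ D} τ^{-c} • t_c` inside `K`
  let q : ℂ → (ι → ℂ) := fun τ => ∑ c ∈ Finset.range (D + 1), (τ⁻¹) ^ c • t c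
  have hq : ∀ τ, q τ ∈ K := fun τ =>
    K.sum_mem fun c _ => K.smul_mem _ (ht c)
  -- the polynomial curve `U(τ) = λ_w(τ) q(τ)` (genuinely polynomial in `τ`), with `U(0) = s`
  let U : ι → Polynomial ℂ := fun e => ∑ c ∈ Finset.range (D + 1), Polynomial.C (t c e) * X ^ (w e - c)
  have hU_eval : ∀ τ e, (U e).eval τ = ∑ c ∈ Finset.range (D + 1), t c e * τ ^ (w e - c) := by
    intro τ e
    simp [U, Polynomial.eval_finsetSum]
  have h1 : ∀ τ : ℂ, τ ≠ 0 → (fun e => (U e).eval τ) = torusAct w τ (q τ) := by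
    intro τ hτ
    funext e
    rw [hU_eval]
    simp only [torusAct, q, Finset.sum_apply, Pi.smul_apply, smul_eq_mul, Finset.mul_sum]
    refine Finset.sum_congr rfl fun c _ => ?_
    by_cases hcw : c ≤ w e
    · have hsplit : τ ^ (w e) = τ ^ (w e - c) * τ ^ c := by
        rw [← pow_add, Nat.sub_add_cancel hcw]
      rw [hsplit]
      have hcc : τ ^ c * (τ⁻¹) ^ c = 1 := by
        rw [← mul_pow, mul_inv_cancel₀ hτ, one_pow]
      calc t c e * τ ^ (w e - c) = τ ^ (w e - c) * (τ ^ c * (τ⁻¹) ^ c) * t c e := by rw [hcc]; ring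
        _ = τ ^ (w e - c) * τ ^ c * ((τ⁻¹) ^ c * t c e) := by ring
    · have hz : t c e = 0 := htz c e (Nat.lt_of_not_le hcw)
      simp [hz]
  have h2 : (fun e => (U e).eval 0) = s := by
    funext e
    rw [hU_eval, hse e]
    rw [Finset.sum_eq_single (w e)]
    · simp
    · intro c _ hc
      rcases Nat.lt_or_gt_of_ne hc with hlt | hgt
      · have hpos : w e - c ≠ 0 := Nat.sub_ne_zero_of_lt hlt
        simp [zero_pow hpos]
      · simp [htz c e hgt]
    · intro hnot
      exact absurd (Finset.mem_range.mpr (Nat.lt_succ_of_le (hwD e))) hnot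
  -- `G(τ) := F(U(τ))` is a polynomial in `τ` vanishing on `ℂ ∖ {0}`
  let G : Polynomial ℂ := MvPolynomial.aeval U F
  have hG : ∀ τ, G.eval τ = MvPolynomial.eval (fun e => (U e).eval τ) F := fun τ =>
    eval_aeval_polynomial U F τ
  have hroot : ∀ τ : ℂ, τ ≠ 0 → G.IsRoot τ := by
    intro τ hτ
    rw [Polynomial.IsRoot, hG, h1 τ hτ]
    exact hK τ hτ (q τ) (hq τ) F hF
  have hG0 : G = 0 := by
    refine Polynomial.eq_zero_of_infinite_isRoot G ?_
    refine Set.Infinite.mono (s := ({0}ᶜ : Set ℂ)) (fun τ hτ => hroot τ ?_) (Set.finite_singleton (0 : ℂ)).infinite_compl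
    simpa [Set.mem_compl_iff, Set.mem_singleton_iff] using hτ
  -- hence at `τ = 0`
  have h0 : G.eval 0 = 0 := by rw [hG0, Polynomial.eval_zero]
  rw [hG, h2] at h0
  exact h0

/-- Packaging for certificate use: the initial subspace lies in the common zero locus of `𝓕`. -/
theorem initSub_le_zeroLocus [Fintype ι] (w : ι → ℕ) (K : Submodule ℂ (ι → ℂ)) (𝓕 : Set (MvPolynomial ι ℂ))
    (hK : ∀ τ : ℂ, τ ≠ 0 → ∀ v ∈ K, ∀ F ∈ 𝓕, MvPolynomial.eval (torusAct w τ v) F = 0) :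
    ∀ s ∈ initSub w K, ∀ F ∈ 𝓕, MvPolynomial.eval s F = 0 :=
  fun _ hs _ hF => eval_eq_zero_of_mem_initSub w K 𝓕 hK hs hF

/-! ## Dimension: `finrank (initSub w K) = finrank K` (telescoping ranks; self-contained, cf. `WeightShadow.finrank_gr_abstract`) -/

/-- Coordinates of weight `≥ c`, as a submodule. -/
def Fge (w : ι → ℕ) (c : ℕ) : Submodule ℂ (ι → ℂ) where
  carrier := {v | SuppGe w c v}
  zero_mem' := fun _ _ => rfl
  add_mem' := by
    intro a b ha hb e he
    simp [Pi.add_apply, ha e he, hb e he]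
  smul_mem' := by
    intro r a ha e he
    simp [Pi.smul_apply, ha e he]

theorem mem_Fge {w : ι → ℕ} {c : ℕ} {v : ι → ℂ} : v ∈ Fge w c ↔ SuppGe w c v := Iff.rfl

/-- The weight projection as a linear map. -/
def wtProjₗ (w : ι → ℕ) (c : ℕ) : (ι → ℂ) →ₗ[ℂ] (ι → ℂ) where
  toFun := wtProj w c
  map_add' := by
    intro a b; funext e; by_cases h : w e = c <;> simp [wtProj, h]
  map_smul' := by
    intro r a; funext e; by_cases h : w e = c <;> simp [wtProj, h]

@[simp] theorem wtProjₗ_apply (w : ι → ℕ) (c : ℕ) (v : ι → ℂ) : wtProjₗ w c v = wtProj w c v := rfl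

/-- `v` has weights `≥ c` and no weight-`c` component iff `v` has weights `≥ c+1`. -/
theorem mem_Fge_succ_iff {w : ι → ℕ} {c : ℕ} {v : ι → ℂ} :
    v ∈ Fge w (c + 1) ↔ v ∈ Fge w c ∧ wtProj w c v = 0 := by
  constructor
  · intro hv
    refine ⟨fun e he => hv e (Nat.lt_succ_of_lt he), ?_⟩
    funext e
    by_cases h : w e = c
    · simp [wtProj, h, hv e (by omega)]
    · simp [wtProj, h]
  · rintro ⟨hv, hz⟩ e he
    rcases Nat.lt_succ_iff_lt_or_eq.mp he with hlt | heq
    · exact hv e hlt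
    · have := congrFun hz e
      simpa [wtProj, heq] using this

/-- One telescoping step: `finrank π_c(L ∩ F_{≥c}) + finrank (L ∩ F_{≥c+1}) = finrank (L ∩ F_{≥c})` (rank–nullity). -/
theorem finrank_step [Fintype ι] (w : ι → ℕ) (L : Submodule ℂ (ι → ℂ)) (c : ℕ) :
    Module.finrank ℂ ((L ⊓ Fge w c).map (wtProjₗ w c)) + Module.finrank ℂ (L ⊓ Fge w (c + 1) : Submodule ℂ (ι → ℂ)) =
      Module.finrank ℂ (L ⊓ Fge w c : Submodule ℂ (ι → ℂ)) := by
  set p : Submodule ℂ (ι → ℂ) := L ⊓ Fge w c with hp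
  let φ : p →ₗ[ℂ] (ι → ℂ) := (wtProjₗ w c).domRestrict p
  have hrange : LinearMap.range φ = p.map (wtProjₗ w c) := by
    ext y
    simp only [LinearMap.mem_range, Submodule.mem_map]
    constructor
    · rintro ⟨⟨x, hx⟩, rfl⟩
      exact ⟨x, hx, rfl⟩
    · rintro ⟨x, hx, rfl⟩
      exact ⟨⟨x, hx⟩, rfl⟩
  have hle : L ⊓ Fge w (c + 1) ≤ p := by
    intro v hv
    exact ⟨hv.1, (mem_Fge_succ_iff.mp hv.2).1⟩
  have hker : LinearMap.ker φ = Submodule.comap p.subtype (L ⊓ Fge w (c + 1)) := by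
    ext ⟨v, hv⟩
    simp only [LinearMap.mem_ker, Submodule.mem_comap, Submodule.subtype_apply, Submodule.mem_inf]
    change wtProjₗ w c v = 0 ↔ _
    rw [wtProjₗ_apply]
    have hv' : v ∈ L ∧ v ∈ Fge w c := hv
    constructor
    · intro hz
      exact ⟨hv'.1, mem_Fge_succ_iff.mpr ⟨hv'.2, hz⟩⟩
    · rintro ⟨-, h2⟩
      exact (mem_Fge_succ_iff.mp h2).2
  have hrn := LinearMap.finrank_range_add_finrank_ker φ
  rw [hrange, hker, (Submodule.comapSubtypeEquivOfLe hle).finrank_eq] at hrn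
  exact hrn

/-- The graded pieces of `K` and of its initial subspace agree: `π_c(K ∩ F_{≥c}) = π_c(in_λ K ∩ F_{≥c})`. -/
theorem map_inf_Fge_eq [Fintype ι] (w : ι → ℕ) (K : Submodule ℂ (ι → ℂ)) (c : ℕ) :
    (K ⊓ Fge w c).map (wtProjₗ w c) = (initSub w K ⊓ Fge w c).map (wtProjₗ w c) := by
  apply le_antisymm
  · rintro y ⟨t, ht, rfl⟩
    have ht' : t ∈ K ∧ t ∈ Fge w c := ht
    refine ⟨wtProj w c t, ⟨wtProj_mem_initSub_of_mem ht'.1 ht'.2, ?_⟩, ?_⟩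
    · intro e he
      simp [wtProj, Nat.ne_of_lt he]
    · change wtProj w c (wtProj w c t) = wtProj w c t
      funext e; by_cases h : w e = c <;> simp [wtProj, h]
  · rintro y ⟨s, hs, rfl⟩
    have hs' : s ∈ initSub w K ∧ s ∈ Fge w c := hs
    obtain ⟨t, ht, hsupp, hse⟩ := hs'.1
    refine ⟨t c, ⟨ht c, hsupp c⟩, ?_⟩
    change wtProj w c (t c) = wtProj w c s
    funext e
    by_cases h : w e = c
    · simp [wtProj, h, hse e]
    · simp [wtProj, h]

/-- Above the top weight the filtration is trivial. -/
theorem inf_Fge_eq_bot_of_lt [Fintype ι] (w : ι → ℕ) (L : Submodule ℂ (ι → ℂ)) {c : ℕ} (hc : ∀ e, w e < c) :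
    L ⊓ Fge w c = ⊥ := by
  rw [eq_bot_iff]
  intro v hv
  have hv' : v ∈ L ∧ v ∈ Fge w c := hv
  rw [Submodule.mem_bot]
  funext e
  exact hv'.2 e (hc e)

/-- At weight `0` the filtration is everything. -/
theorem inf_Fge_zero (w : ι → ℕ) (L : Submodule ℂ (ι → ℂ)) : L ⊓ Fge w 0 = L := by
  apply le_antisymm inf_le_left
  intro v hv
  exact ⟨hv, fun e he => absurd he (Nat.not_lt_zero _)⟩

/-- **DIMENSION OF THE INITIAL SUBSPACE**: `finrank (in_λ K) = finrank K`. [this file; telescoping over weights] -/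
theorem finrank_initSub [Fintype ι] (w : ι → ℕ) (K : Submodule ℂ (ι → ℂ)) :
    Module.finrank ℂ (initSub w K) = Module.finrank ℂ K := by
  set D : ℕ := Finset.univ.sup w with hD
  have hwD : ∀ e, w e ≤ D := fun e => Finset.le_sup (f := w) (Finset.mem_univ e)
  -- downward induction on the weight threshold
  have key : ∀ d, d ≤ D + 1 →
      Module.finrank ℂ (K ⊓ Fge w (D + 1 - d) : Submodule ℂ (ι → ℂ)) =
        Module.finrank ℂ (initSub w K ⊓ Fge w (D + 1 - d) : Submodule ℂ (ι → ℂ)) := by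
    intro d
    induction d with
    | zero =>
      intro _
      have hlt : ∀ e, w e < D + 1 - 0 := fun e => by
        rw [Nat.sub_zero]; exact Nat.lt_succ_of_le (hwD e)
      have h1 := inf_Fge_eq_bot_of_lt w K (c := D + 1 - 0) hlt
      have h2 := inf_Fge_eq_bot_of_lt w (initSub w K) (c := D + 1 - 0) hlt
      rw [h1, h2]
    | succ d ih =>
      intro hd
      have ih' := ih (Nat.le_of_succ_le hd)
      have hc : D + 1 - d = (D - d) + 1 := by omega
      have hc' : D + 1 - (d + 1) = D - d := by omega
      rw [hc] at ih'
      rw [hc']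
      have sK := finrank_step w K (D - d)
      have sH := finrank_step w (initSub w K) (D - d)
      rw [map_inf_Fge_eq w K (D - d)] at sK
      omega
  have h := key (D + 1) le_rfl
  rw [Nat.sub_self, inf_Fge_zero, inf_Fge_zero] at h
  exact h.symm

/-- **INITIAL-SUBSPACE THEOREM (H_coord for polynomial certificate families, topology-free).**  From ONE subspace `K` on which a
torus-stable polynomial family vanishes (`hK`), a WEIGHT-GRADED subspace of the SAME dimension on which it vanishes. -/
theorem exists_graded_of_torusStable [Fintype ι] (w : ι → ℕ) (K : Submodule ℂ (ι → ℂ)) (𝓕 : Set (MvPolynomial ι ℂ))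
    (hK : ∀ τ : ℂ, τ ≠ 0 → ∀ v ∈ K, ∀ F ∈ 𝓕, MvPolynomial.eval (torusAct w τ v) F = 0) :
    ∃ K₀ : Submodule ℂ (ι → ℂ), Module.finrank ℂ K₀ = Module.finrank ℂ K ∧
      (∀ s ∈ K₀, ∀ c, wtProj w c s ∈ K₀) ∧ (∀ s ∈ K₀, ∀ F ∈ 𝓕, MvPolynomial.eval s F = 0) :=
  ⟨initSub w K, finrank_initSub w K, fun _ hs c => wtProj_mem_initSub hs c,
    initSub_le_zeroLocus w K 𝓕 hK⟩

/-- Sanity: at `τ = 1` the hypothesis says `K` itself lies in the zero locus (`λ_w(1) = id`). -/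
theorem torusAct_one (w : ι → ℕ) (v : ι → ℂ) : torusAct w 1 v = v := by
  funext e; simp [torusAct]

end Summit.ValiantsHypothesis.ValiantsHypothesis.Cruxes.DualUnipotentThreeHalves.InitialForm

/-! # PART II — Torus closure of FLAG-cheap certificates — `H_coord` as a theorem (MEMO-g5-closure-lever §1 (iii), §5)

Honest status: VP ≠ VNP is NOT proved; crux 24318 `DualUnipotentThreeHalves` is OPEN; this file proves NO case of any law and
refutes nothing by itself.  It discharges, in kernel, the hypothesis `H_coord` («1-psg / torus closure of FlagCheap certificates,
∉ Mathlib») of the booked artefact `heavyTopLaw_false_of_coordClosure` (R312 (1), crit-7 V24, idea-30 MEMO §3 N5):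

  `wordCheap_graded_of_torusEquivariant` / `flagCheap_graded_of_torusEquivariant` — if an affine pencil `N` is EQUIVARIANT under a
  one-parameter torus (`N(λ_w(τ) x) = D_τ · N(x) · D_τ⁻¹` for all `τ ≠ 0`, `x`, with `λ_w(τ) x = (τ^{w e} x_e)_e`), then a word-cheap
  (= flag-cheap) certificate `K` of budget `k` can be replaced by a WEIGHT-GRADED certificate `K₀` of the same dimension and budget.

No topology is used.  The three ingredients: (1) BOUNDED TYPES (`flagAdaptedUpTo_iff_types`): for fixed `(m, n, k)` the disjunction
`WordTame = ∃ (r, c, Θ) …` may be restricted to the FINITE set of profiles of realisable level types, so «flag-adapted along the line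
`x + s v`» is, for each `x`, a finite union of polynomial conditions in `v` (word entries); (2) PRODUCTS (`mem_S_iff_family`): a finite
union of zero loci is the zero locus of the products, so the certificate cone `S = {v | ∀ x, FlagAdaptedUpTo (N|x+sv)}` is the zero
locus of an explicit polynomial family `𝓕`; (3) the INITIAL-SUBSPACE theorem `InitialForm.exists_graded_of_torusStable` (τ-polynomial
argument + telescoping ranks).  Torus-stability of `S` is conjugation-invariance of words.
-/

noncomputable section

namespace Summit.ValiantsHypothesis.ValiantsHypothesis.Cruxes.DualUnipotentThreeHalves.InitialForm.TorusClosure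

open MvPolynomial Matrix
open scoped BigOperators
open Summit.ValiantsHypothesis.ValiantsHypothesis.Cruxes.TwoDimCoefficients.DimTwoCases (AffMat IsAffine)
open Summit.ValiantsHypothesis.ValiantsHypothesis.Cruxes.DualUnipotentThreeHalves.RadicalSplit
open Summit.ValiantsHypothesis.ValiantsHypothesis.Theorems.DualUnipotentThreeHalvesNegative.FlagCost
  (level_bound_word word_conj coeff_conj_apply)

variable {m : ℕ}

/-! ## §1 Pinned word clauses and level types -/

/-- The word clause with a PINNED profile `(r, c, Θ)`: every nonzero word has `c·#T₁ ≤ Θ + r·#T₀`. -/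
def WordClause (r c Θ : ℕ) (T₀ T₁ : Matrix (Fin m) (Fin m) ℂ) : Prop :=
  ∀ w : List Bool, word T₀ T₁ w ≠ 0 → c * w.count true ≤ Θ + r * w.count false

/-- The support TYPE of a level datum `(lvl, r, a)`: the entries the constant part / the `s`-part may occupy. -/
def typeOf (lvl : Fin m → ℕ) (r a : ℕ) : Finset (Fin m × Fin m) × Finset (Fin m × Fin m) :=
  (Finset.univ.filter fun ij => lvl ij.2 ≤ lvl ij.1 + r,
   Finset.univ.filter fun ij => a + 1 + lvl ij.2 ≤ lvl ij.1 + r)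

/-- A type is REALISABLE with budget `k` (on words of length `n − 1`). -/
def Realisable (n k : ℕ) (σ : Finset (Fin m × Fin m) × Finset (Fin m × Fin m)) : Prop :=
  ∃ q : (Fin m → ℕ) × ℕ × ℕ × ℕ, (∀ i, q.1 i < q.2.1) ∧ flagDeg q.2.1 q.2.2.1 q.2.2.2 n ≤ k ∧
    typeOf q.1 q.2.2.1 q.2.2.2 = σ

open Classical in
/-- The FINITE set of realisable types. -/
def types (m n k : ℕ) : Finset (Finset (Fin m × Fin m) × Finset (Fin m × Fin m)) :=
  Finset.univ.filter (Realisable n k)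

theorem mem_types {n k : ℕ} {σ : Finset (Fin m × Fin m) × Finset (Fin m × Fin m)} :
    σ ∈ types m n k ↔ Realisable n k σ := by
  classical
  simp [types]

open Classical in
/-- A chosen realiser of a type (junk if not realisable). -/
def realiser (n k : ℕ) (σ : Finset (Fin m × Fin m) × Finset (Fin m × Fin m)) : (Fin m → ℕ) × ℕ × ℕ × ℕ :=
  if h : Realisable n k σ then h.choose else (fun _ => 0, 1, 0, 0)

theorem realiser_spec {n k : ℕ} {σ : Finset (Fin m × Fin m) × Finset (Fin m × Fin m)} (h : Realisable n k σ) :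
    (∀ i, (realiser n k σ).1 i < (realiser n k σ).2.1) ∧
      flagDeg (realiser n k σ).2.1 (realiser n k σ).2.2.1 (realiser n k σ).2.2.2 n ≤ k ∧
      typeOf (realiser n k σ).1 (realiser n k σ).2.2.1 (realiser n k σ).2.2.2 = σ := by
  classical
  have : realiser n k σ = h.choose := by simp [realiser, h]
  rw [this]
  exact h.choose_spec

/-- The pinned PROFILE `(r, c, Θ) = (r, a + 1 − r, p − 1)` of (the chosen realiser of) a type. -/
def profile (n k : ℕ) (σ : Finset (Fin m × Fin m) × Finset (Fin m × Fin m)) : ℕ × ℕ × ℕ :=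
  ((realiser n k σ).2.2.1, (realiser n k σ).2.2.2 + 1 - (realiser n k σ).2.2.1, (realiser n k σ).2.1 - 1)

/-- Budget `≤ n − 2` forces drop `≤` weight: `r ≤ a`. [tree: inside `wordTame_of_flagAdaptedUpTo`] -/
theorem drop_le_weight {n k p r a : ℕ} (hkn : k + 2 ≤ n) (hk : flagDeg p r a n ≤ k) : r ≤ a := by
  unfold flagDeg at hk
  by_contra hlt
  push Not at hlt
  have h3 : n - 1 ≤ (p - 1 + r * (n - 1)) / (a + 1) := by
    rw [Nat.le_div_iff_mul_le (by omega : 0 < a + 1)]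
    have : (n - 1) * (a + 1) ≤ r * (n - 1) := by
      rw [Nat.mul_comm]
      exact Nat.mul_le_mul_right _ hlt
    omega
  omega

/-- The profile of a realisable type satisfies the numeric side conditions of `WordTame`. -/
theorem profile_budget {n k : ℕ} (hkn : k + 2 ≤ n) {σ : Finset (Fin m × Fin m) × Finset (Fin m × Fin m)}
    (h : Realisable n k σ) :
    1 ≤ (profile n k σ).2.1 ∧
      ((profile n k σ).2.2 + (profile n k σ).1 * (n - 1)) / ((profile n k σ).2.1 + (profile n k σ).1) ≤ k := by
  obtain ⟨-, hk, -⟩ := realiser_spec h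
  have hra := drop_le_weight hkn hk
  simp only [profile]
  refine ⟨by omega, ?_⟩
  have hk' := hk
  unfold flagDeg at hk'
  have hden : (realiser n k σ).2.2.2 + 1 - (realiser n k σ).2.2.1 + (realiser n k σ).2.2.1 =
      (realiser n k σ).2.2.2 + 1 := by omega
  rw [hden]
  exact hk'

/-- A pinned word clause with the profile of a realisable type is word-tame. -/
theorem wordTame_of_wordClause {n k : ℕ} (hkn : k + 2 ≤ n) {σ : Finset (Fin m × Fin m) × Finset (Fin m × Fin m)}
    (h : Realisable n k σ) (T₀ T₁ : Matrix (Fin m) (Fin m) ℂ)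
    (hW : WordClause (profile n k σ).1 (profile n k σ).2.1 (profile n k σ).2.2 T₀ T₁) : WordTame n k T₀ T₁ := by
  obtain ⟨hc, hb⟩ := profile_budget hkn h
  exact ⟨_, _, _, hc, hb, hW⟩

/-- **Pinned flag ⇒ word** (the tree's `wordTame_of_flagAdaptedUpTo` with the profile kept explicit): levels `< p`, drop `r`,
weight `a + 1`, read on the conjugated pair, give the clause `(a + 1 − r)·#T₁ ≤ (p − 1) + r·#T₀` on nonzero words. -/
theorem wordClause_of_levels (G G' T₀ T₁ : Matrix (Fin m) (Fin m) ℂ) (hGG' : G * G' = 1) (hG'G : G' * G = 1)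
    (lvl : Fin m → ℕ) (p r a : ℕ) (hl : ∀ i, lvl i < p)
    (h0 : ∀ i j, (G * T₀ * G') i j ≠ 0 → lvl j ≤ lvl i + r)
    (h1 : ∀ i j, (G * T₁ * G') i j ≠ 0 → (a + 1) + lvl j ≤ lvl i + r) :
    WordClause r (a + 1 - r) (p - 1) T₀ T₁ := by
  intro w hw
  have hne : (w.map fun b => if b then G * T₁ * G' else G * T₀ * G').prod ≠ 0 := by
    rw [word_conj G G' T₁ T₀ hGG' hG'G w]
    intro hzero
    apply hw
    have hw' : word T₀ T₁ w = G' * (G * (w.map fun b => if b then T₁ else T₀).prod * G') * G := by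
      unfold word
      calc (w.map fun b => if b then T₁ else T₀).prod
          = (G' * G) * (w.map fun b => if b then T₁ else T₀).prod * (G' * G) := by
            rw [hG'G, Matrix.one_mul, Matrix.mul_one]
        _ = G' * (G * (w.map fun b => if b then T₁ else T₀).prod * G') * G := by
            simp only [Matrix.mul_assoc]
    rw [hw', hzero, Matrix.mul_zero, Matrix.zero_mul]
  obtain ⟨i, j, hij⟩ : ∃ i j, (w.map fun b => if b then G * T₁ * G' else G * T₀ * G').prod i j ≠ 0 := by
    by_contra hall
    push Not at hall
    exact hne (Matrix.ext fun i j => by rw [hall i j, Matrix.zero_apply])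
  have hb := level_bound_word (G * T₀ * G') (G * T₁ * G') lvl (a + 1) r h0 h1 w i j hij
  have hi := hl i
  have hlen : w.count false + w.count true = w.length := by
    simp
  have hsplit : r * w.length = r * w.count false + r * w.count true := by
    rw [← hlen, Nat.mul_add]
  rw [hsplit] at hb
  rw [Nat.sub_mul]
  generalize (a + 1) * List.count true w = A at hb ⊢
  generalize r * List.count true w = Rc at hb ⊢
  generalize r * List.count false w = Rf at hb ⊢
  omega

/-- TYPE TRANSFER: adaptedness depends on `(lvl, r, a)` only through the type (for matrices without `s²`). -/
theorem flagAdapted_of_typeOf_eq (M : Matrix (Fin m) (Fin m) (MvPolynomial (Fin 1) ℂ))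
    (h2 : ∀ d : Fin 1 →₀ ℕ, 2 ≤ d 0 → ∀ i j, coeff d (M i j) = 0)
    {lvl lvl' : Fin m → ℕ} {r a r' a' : ℕ} (hA : FlagAdapted lvl r a M) (ht : typeOf lvl r a = typeOf lvl' r' a') :
    FlagAdapted lvl' r' a' M := by
  intro i j d hd
  have hbound := hA i j d hd
  have hlt2 : d 0 < 2 := by
    by_contra hge
    push Not at hge
    exact hd (h2 d hge i j)
  have h01 : d 0 = 0 ∨ d 0 = 1 := by omega
  rcases h01 with h0 | h1
  · rw [h0, Nat.mul_zero, Nat.zero_add] at hbound ⊢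
    have hmem : (i, j) ∈ (typeOf lvl r a).1 := by
      simp [typeOf, hbound]
    rw [ht] at hmem
    simpa [typeOf] using hmem
  · rw [h1, Nat.mul_one] at hbound ⊢
    have hmem : (i, j) ∈ (typeOf lvl r a).2 := by
      simp [typeOf, hbound]
    rw [ht] at hmem
    simpa [typeOf] using hmem

/-- Conjugation by constants preserves «no `s²`». -/
theorem h2_conj (M : Matrix (Fin m) (Fin m) (MvPolynomial (Fin 1) ℂ))
    (h2 : ∀ d : Fin 1 →₀ ℕ, 2 ≤ d 0 → ∀ i j, coeff d (M i j) = 0) (G G' : Matrix (Fin m) (Fin m) ℂ) :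
    ∀ d : Fin 1 →₀ ℕ, 2 ≤ d 0 → ∀ i j,
      coeff d ((G.map C * M * G'.map C : Matrix (Fin m) (Fin m) (MvPolynomial (Fin 1) ℂ)) i j) = 0 := by
  intro d hd i j
  rw [coeff_conj_apply]
  have hz : M.map (coeff d) = 0 := by
    ext a b
    simp [h2 d hd a b]
  rw [hz, Matrix.mul_zero, Matrix.zero_mul, Matrix.zero_apply]

/-- **BOUNDED TYPES.**  For `M = T₀ + s·T₁` (no `s²`) and `k + 2 ≤ n`: `M` is flag-adapted with budget `k` iff the pair `(T₀, T₁)`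
satisfies the pinned word clause of SOME REALISABLE TYPE — a finite disjunction of polynomial conditions. [this file] -/
theorem flagAdaptedUpTo_iff_types (M : Matrix (Fin m) (Fin m) (MvPolynomial (Fin 1) ℂ))
    (h2 : ∀ d : Fin 1 →₀ ℕ, 2 ≤ d 0 → ∀ i j, coeff d (M i j) = 0) {n k : ℕ} (hkn : k + 2 ≤ n) :
    FlagAdaptedUpTo m k n M ↔ ∃ σ ∈ types m n k,
      WordClause (profile n k σ).1 (profile n k σ).2.1 (profile n k σ).2.2
        (M.map (coeff 0)) (M.map (coeff (Finsupp.single 0 1))) := by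
  constructor
  · rintro ⟨g, lvl, p, r, a, hl, hk, hA⟩
    set σ := typeOf lvl r a with hσ
    have hreal : Realisable n k σ := ⟨(lvl, p, r, a), hl, hk, rfl⟩
    refine ⟨σ, mem_types.mpr hreal, ?_⟩
    obtain ⟨hl', hk', ht'⟩ := realiser_spec hreal
    set G : Matrix (Fin m) (Fin m) ℂ := (g : Matrix (Fin m) (Fin m) ℂ) with hG
    set G' : Matrix (Fin m) (Fin m) ℂ := (↑g⁻¹ : Matrix (Fin m) (Fin m) ℂ) with hG'
    have hGG' : G * G' = 1 := by rw [hG, hG']; exact Units.mul_inv g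
    have hG'G : G' * G = 1 := by rw [hG, hG']; exact Units.inv_mul g
    -- the chosen realiser of the same type is adapted too
    have hA' : FlagAdapted (realiser n k σ).1 (realiser n k σ).2.2.1 (realiser n k σ).2.2.2
        (G.map C * M * G'.map C) :=
      flagAdapted_of_typeOf_eq _ (h2_conj M h2 G G') hA (by rw [ht'])
    have h0 : ∀ i j, (G * M.map (coeff 0) * G') i j ≠ 0 →
        (realiser n k σ).1 j ≤ (realiser n k σ).1 i + (realiser n k σ).2.2.1 := by
      intro i j hij
      rw [← coeff_conj_apply] at hij
      have := hA' i j 0 hij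
      simpa using this
    have h1 : ∀ i j, (G * M.map (coeff (Finsupp.single 0 1)) * G') i j ≠ 0 →
        ((realiser n k σ).2.2.2 + 1) + (realiser n k σ).1 j ≤ (realiser n k σ).1 i + (realiser n k σ).2.2.1 := by
      intro i j hij
      rw [← coeff_conj_apply] at hij
      have := hA' i j (Finsupp.single 0 1) hij
      simpa using this
    exact wordClause_of_levels G G' _ _ hGG' hG'G _ _ _ _ hl' h0 h1
  · rintro ⟨σ, hσ, hW⟩
    exact flagAdaptedUpTo_of_wordTame M h2 (wordTame_of_wordClause hkn (mem_types.mp hσ) _ _ hW)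

/-! ## §2 Word entries are polynomial in the direction `v` -/

variable {n : ℕ}

/-- The linear part of the pencil as a polynomial matrix: `N − N(0)`. -/
def linPoly (N : AffMat n m) : AffMat n m := N - (N.map (MvPolynomial.eval 0)).map C

/-- The constant part at `x` as a (constant) polynomial matrix. -/
def constPoly (N : AffMat n m) (x : Fin n × Fin n → ℂ) : AffMat n m := (N.map (MvPolynomial.eval x)).map C

theorem map_eval_map_C (A : Matrix (Fin m) (Fin m) ℂ) (v : Fin n × Fin n → ℂ) :
    (A.map (C : ℂ → MvPolynomial (Fin n × Fin n) ℂ)).map (MvPolynomial.eval v) = A := by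
  ext i j; simp

theorem linPoly_eval (N : AffMat n m) (v : Fin n × Fin n → ℂ) :
    (linPoly N).map (MvPolynomial.eval v) = linPart N v := by
  unfold linPoly linPart
  rw [Matrix.map_sub _ (map_sub (MvPolynomial.eval v)), map_eval_map_C]

theorem constPoly_eval (N : AffMat n m) (x v : Fin n × Fin n → ℂ) :
    (constPoly N x).map (MvPolynomial.eval v) = N.map (MvPolynomial.eval x) := by
  unfold constPoly
  rw [map_eval_map_C]

/-- Words in polynomial matrices. -/
def wordP (A L : AffMat n m) (w : List Bool) : AffMat n m := (w.map fun b => if b then L else A).prod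

theorem wordP_eval (A L : AffMat n m) (v : Fin n × Fin n → ℂ) (w : List Bool) :
    (wordP A L w).map (MvPolynomial.eval v) = word (A.map (MvPolynomial.eval v)) (L.map (MvPolynomial.eval v)) w := by
  induction w with
  | nil =>
    simp only [wordP, word, List.map_nil, List.prod_nil]
    exact Matrix.map_one (MvPolynomial.eval v) (map_zero _) (map_one _)
  | cons b w ih =>
    have hc : wordP A L (b :: w) = (if b then L else A) * wordP A L w := by
      simp [wordP]
    rw [hc, word_cons, Matrix.map_mul, ih]
    cases b <;> simp

/-- The `(i, j)` entry of the word `w` in `(N(x), N_lin(v))`, as a polynomial in `v`. -/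
def wordPoly (N : AffMat n m) (x : Fin n × Fin n → ℂ) (w : List Bool) (i j : Fin m) :
    MvPolynomial (Fin n × Fin n) ℂ :=
  wordP (constPoly N x) (linPoly N) w i j

theorem eval_wordPoly (N : AffMat n m) (x v : Fin n × Fin n → ℂ) (w : List Bool) (i j : Fin m) :
    MvPolynomial.eval v (wordPoly N x w i j) = word (N.map (MvPolynomial.eval x)) (linPart N v) w i j := by
  unfold wordPoly
  have h := wordP_eval (constPoly N x) (linPoly N) v w
  rw [constPoly_eval, linPoly_eval] at h
  have := congrFun (congrFun h i) j
  simpa [Matrix.map_apply] using this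

/-! ## §3 The certificate cone and its polynomial description -/

/-- The CERTIFICATE CONE of budget `k`: directions `v` along which EVERY line `x + s v` is flag-adapted, in the bounded-type form. -/
def S (N : AffMat n m) (k : ℕ) : Set (Fin n × Fin n → ℂ) :=
  {v | ∀ x, ∃ σ ∈ types m n k, WordClause (profile n k σ).1 (profile n k σ).2.1 (profile n k σ).2.2
    (N.map (MvPolynomial.eval x)) (linPart N v)}

theorem mem_S_iff_flag (N : AffMat n m) (hN : IsAffine N) {k : ℕ} (hkn : k + 2 ≤ n) (v : Fin n × Fin n → ℂ) :
    v ∈ S N k ↔ ∀ x, FlagAdaptedUpTo m k n (N.map (lineSubst x v)) := by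
  unfold S
  simp only [Set.mem_setOf_eq]
  refine forall_congr' fun x => ?_
  obtain ⟨h0, h1, h2⟩ := coeffs_map_lineSubst N hN x v
  rw [flagAdaptedUpTo_iff_types _ h2 hkn, h0, h1]

theorem mem_S_iff_wordTame (N : AffMat n m) (hN : IsAffine N) {k : ℕ} (hkn : k + 2 ≤ n) (v : Fin n × Fin n → ℂ) :
    v ∈ S N k ↔ ∀ x, WordTame n k (N.map (MvPolynomial.eval x)) (linPart N v) := by
  rw [mem_S_iff_flag N hN hkn]
  refine forall_congr' fun x => ?_
  obtain ⟨h0, h1, h2⟩ := coeffs_map_lineSubst N hN x v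
  rw [flagAdaptedUpTo_iff_wordTame _ h2 hkn, h0, h1]

/-- A word VIOLATES the profile of `σ`. -/
def Violates (n k : ℕ) (σ : Finset (Fin m × Fin m) × Finset (Fin m × Fin m)) (w : List Bool) : Prop :=
  ¬ ((profile n k σ).2.1 * w.count true ≤ (profile n k σ).2.2 + (profile n k σ).1 * w.count false)

/-- The polynomial FAMILY cutting out the certificate cone: products over the realisable types of entries of violating words. -/
def family (N : AffMat n m) (k : ℕ) : Set (MvPolynomial (Fin n × Fin n) ℂ) :=
  {F | ∃ (x : Fin n × Fin n → ℂ) (wd : types m n k → List Bool) (ij : types m n k → Fin m × Fin m),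
    (∀ σ, Violates n k σ.1 (wd σ)) ∧ F = ∏ σ ∈ (types m n k).attach, wordPoly N x (wd σ) (ij σ).1 (ij σ).2}

/-- The cone lies in the zero locus of the family. -/
theorem eval_family_of_mem_S (N : AffMat n m) {k : ℕ} {v : Fin n × Fin n → ℂ} (hv : v ∈ S N k) :
    ∀ F ∈ family N k, MvPolynomial.eval v F = 0 := by
  rintro F ⟨x, wd, ij, hviol, rfl⟩
  obtain ⟨σ, hσ, hW⟩ := hv x
  rw [map_prod]
  apply Finset.prod_eq_zero (Finset.mem_attach _ ⟨σ, hσ⟩)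
  rw [eval_wordPoly]
  -- the chosen word violates the profile of `σ`, so it vanishes on the pair
  have hz : word (N.map (MvPolynomial.eval x)) (linPart N v) (wd ⟨σ, hσ⟩) = 0 := by
    by_contra hne
    exact hviol ⟨σ, hσ⟩ (hW _ hne)
  rw [hz, Matrix.zero_apply]

/-- The zero locus of the family lies in the cone. -/
theorem mem_S_of_eval_family (N : AffMat n m) {k : ℕ} {v : Fin n × Fin n → ℂ}
    (hv : ∀ F ∈ family N k, MvPolynomial.eval v F = 0) : v ∈ S N k := by
  classical
  intro x
  by_contra hnone
  push Not at hnone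
  -- for every realisable type pick a violating NONZERO word and a nonzero entry of it
  have hpick : ∀ σ : types m n k, ∃ (w : List Bool) (ij : Fin m × Fin m), Violates n k σ.1 w ∧
      word (N.map (MvPolynomial.eval x)) (linPart N v) w ij.1 ij.2 ≠ 0 := by
    rintro ⟨σ, hσ⟩
    have hσ' := hnone σ hσ
    unfold WordClause at hσ'
    push Not at hσ'
    obtain ⟨w, hw, hlt⟩ := hσ'
    obtain ⟨i, j, hij⟩ : ∃ i j, word (N.map (MvPolynomial.eval x)) (linPart N v) w i j ≠ 0 := by
      by_contra hall
      push Not at hall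
      exact hw (Matrix.ext fun i j => by rw [hall i j, Matrix.zero_apply])
    exact ⟨w, (i, j), not_le.mpr hlt, hij⟩
  choose wd ij hviol hne using hpick
  have hF : (∏ σ ∈ (types m n k).attach, wordPoly N x (wd σ) (ij σ).1 (ij σ).2) ∈ family N k :=
    ⟨x, wd, ij, hviol, rfl⟩
  have h0 := hv _ hF
  rw [map_prod] at h0
  obtain ⟨σ, -, hσ0⟩ := Finset.prod_eq_zero_iff.mp h0
  rw [eval_wordPoly] at hσ0
  exact hne σ hσ0

theorem mem_S_iff_family (N : AffMat n m) {k : ℕ} (v : Fin n × Fin n → ℂ) :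
    v ∈ S N k ↔ ∀ F ∈ family N k, MvPolynomial.eval v F = 0 :=
  ⟨eval_family_of_mem_S N, mem_S_of_eval_family N⟩

/-! ## §4 Torus equivariance ⇒ the cone is torus-stable -/

/-- TORUS EQUIVARIANCE of the pencil under `λ_w`, UP TO A NONZERO SCALAR: `N(λ_w(τ) x) = a_τ · D_τ · N(x) · D_τ'` with `D D' = D' D = 1`,
`a_τ ≠ 0`, for every `τ ≠ 0`.  (The scalar lets a LINEAR pencil absorb a uniform shift of the weights, so that a generic cocharacter of
ANY torus normalising the pencil — weights of both signs — is covered after shifting to `ℕ`-weights: `torusEquivariant_linPencil`.) -/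
def TorusEquivariant (N : AffMat n m) (w : Fin n × Fin n → ℕ) : Prop :=
  ∀ τ : ℂ, τ ≠ 0 → ∃ (a : ℂ) (D D' : Matrix (Fin m) (Fin m) ℂ), a ≠ 0 ∧ D * D' = 1 ∧ D' * D = 1 ∧
    ∀ x, N.map (MvPolynomial.eval (torusAct w τ x)) = a • (D * N.map (MvPolynomial.eval x) * D')

theorem torusAct_zero (w : Fin n × Fin n → ℕ) (τ : ℂ) : torusAct w τ (0 : Fin n × Fin n → ℂ) = 0 := by
  funext e; simp [torusAct]

theorem torusAct_inv_cancel (w : Fin n × Fin n → ℕ) {τ : ℂ} (hτ : τ ≠ 0) (x : Fin n × Fin n → ℂ) :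
    torusAct w τ (torusAct w τ⁻¹ x) = x := by
  funext e
  simp only [torusAct]
  rw [← mul_assoc, ← mul_pow, mul_inv_cancel₀ hτ, one_pow, one_mul]

/-- Scaling both letters scales the word. -/
theorem word_smul (a : ℂ) (T₀ T₁ : Matrix (Fin m) (Fin m) ℂ) (u : List Bool) :
    word (a • T₀) (a • T₁) u = a ^ u.length • word T₀ T₁ u := by
  induction u with
  | nil => simp [word]
  | cons b u ih =>
    rw [word_cons, word_cons, ih, List.length_cons, pow_succ', ← smul_smul]
    cases b <;> simp <;> rw [smul_smul, smul_smul, mul_comm]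

/-- A conjugation-and-scaling-invariant reading of the word clause. -/
theorem wordClause_conj {r c Θ : ℕ} (a : ℂ) (D D' T₀ T₁ : Matrix (Fin m) (Fin m) ℂ) (hDD' : D * D' = 1)
    (hD'D : D' * D = 1) (h : WordClause r c Θ T₀ T₁) :
    WordClause r c Θ (a • (D * T₀ * D')) (a • (D * T₁ * D')) := by
  intro u hu
  apply h u
  intro hz
  apply hu
  rw [word_smul]
  have hconj : word (D * T₀ * D') (D * T₁ * D') u = 0 := by
    unfold word at hz ⊢
    rw [word_conj D D' T₁ T₀ hDD' hD'D u, hz, Matrix.mul_zero, Matrix.zero_mul]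
  rw [hconj, smul_zero]

/-- **The certificate cone is torus-stable.** -/
theorem torusAct_mem_S (N : AffMat n m) {w : Fin n × Fin n → ℕ} (hT : TorusEquivariant N w) {k : ℕ}
    {v : Fin n × Fin n → ℂ} (hv : v ∈ S N k) {τ : ℂ} (hτ : τ ≠ 0) : torusAct w τ v ∈ S N k := by
  intro x
  obtain ⟨a, D, D', -, hDD', hD'D, hconj⟩ := hT τ hτ
  obtain ⟨σ, hσ, hW⟩ := hv (torusAct w τ⁻¹ x)
  refine ⟨σ, hσ, ?_⟩
  have hx : N.map (MvPolynomial.eval x) = a • (D * N.map (MvPolynomial.eval (torusAct w τ⁻¹ x)) * D') := by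
    rw [← hconj, torusAct_inv_cancel w hτ]
  have hlin : linPart N (torusAct w τ v) = a • (D * linPart N v * D') := by
    have h0 := hconj 0
    rw [torusAct_zero] at h0
    unfold linPart
    rw [Matrix.mul_sub, Matrix.sub_mul, smul_sub, ← h0, hconj v]
  rw [hx, hlin]
  exact wordClause_conj a D D' _ _ hDD' hD'D hW

/-- **Linear pencils with weight-vector coordinates are torus-equivariant.**  If every coordinate matrix `B e` is supported on
entries `(i, j)` with `μ i + c₀ = w e + μ j` (i.e. `B e` is a weight vector of weight `w e − c₀` for the cocharacter `diag(τ^μ)`;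
the shift `c₀` makes negative weights admissible), then `linPencil B` is torus-equivariant for `λ_w` with scalar `τ^{c₀}`. -/
theorem torusEquivariant_linPencil (B : Fin n × Fin n → Matrix (Fin m) (Fin m) ℂ) (μ : Fin m → ℕ) (c₀ : ℕ)
    (w : Fin n × Fin n → ℕ) (hB : ∀ e i j, B e i j ≠ 0 → μ i + c₀ = w e + μ j) :
    TorusEquivariant (linPencil B) w := by
  intro τ hτ
  refine ⟨τ ^ c₀, Matrix.diagonal fun i => τ ^ μ i, Matrix.diagonal fun i => (τ⁻¹) ^ μ i, pow_ne_zero _ hτ, ?_, ?_,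
    fun x => ?_⟩
  · rw [Matrix.diagonal_mul_diagonal, ← Matrix.diagonal_one]
    congr 1; funext i
    rw [← mul_pow, mul_inv_cancel₀ hτ, one_pow]
  · rw [Matrix.diagonal_mul_diagonal, ← Matrix.diagonal_one]
    congr 1; funext i
    rw [← mul_pow, inv_mul_cancel₀ hτ, one_pow]
  · set D : Matrix (Fin m) (Fin m) ℂ := Matrix.diagonal fun i => τ ^ μ i with hD
    set D' : Matrix (Fin m) (Fin m) ℂ := Matrix.diagonal fun i => (τ⁻¹) ^ μ i with hD'
    -- each coordinate matrix is a weight vector (after the shift `c₀`)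
    have hcoord : ∀ e, τ ^ w e • B e = τ ^ c₀ • (D * B e * D') := by
      intro e
      ext i j
      rw [Matrix.smul_apply, Matrix.smul_apply, hD, hD', Matrix.mul_diagonal, Matrix.diagonal_mul, smul_eq_mul,
        smul_eq_mul]
      by_cases hz : B e i j = 0
      · simp [hz]
      · have hrel := hB e i j hz
        have hpow : τ ^ (w e) * τ ^ μ j = τ ^ c₀ * τ ^ μ i := by
          rw [← pow_add, ← pow_add, ← hrel, add_comm (μ i) c₀]
        have hj : τ ^ μ j * (τ⁻¹) ^ μ j = 1 := by rw [← mul_pow, mul_inv_cancel₀ hτ, one_pow]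
        calc τ ^ w e * B e i j = τ ^ w e * (τ ^ μ j * (τ⁻¹) ^ μ j) * B e i j := by rw [hj, mul_one]
          _ = (τ ^ w e * τ ^ μ j) * (τ⁻¹) ^ μ j * B e i j := by ring
          _ = (τ ^ c₀ * τ ^ μ i) * (τ⁻¹) ^ μ j * B e i j := by rw [hpow]
          _ = τ ^ c₀ * (τ ^ μ i * B e i j * (τ⁻¹) ^ μ j) := by ring
    rw [linPencil_map_eval, linPencil_map_eval, Finset.mul_sum, Finset.sum_mul, Finset.smul_sum]
    refine Finset.sum_congr rfl fun e _ => ?_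
    show (τ ^ w e * x e) • B e = τ ^ c₀ • (D * (x e • B e) * D')
    rw [Matrix.mul_smul, Matrix.smul_mul, mul_comm, ← smul_smul, hcoord e]
    exact smul_comm _ _ _

/-! ## §5 H_coord as a theorem -/

theorem budget_le {k : ℕ} (K : Submodule ℂ (Fin n × Fin n → ℂ)) (hdim : (k + 1) * n < Module.finrank ℂ K) :
    k + 2 ≤ n := by
  have hKn : Module.finrank ℂ K ≤ n * n := by
    have h1 := Submodule.finrank_le K
    rw [Module.finrank_fintype_fun_eq_card, Fintype.card_prod, Fintype.card_fin] at h1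
    exact h1
  have h2 : (k + 1) * n < n * n := lt_of_lt_of_le hdim hKn
  have h3 : k + 1 < n := Nat.lt_of_mul_lt_mul_right h2
  omega

/-- **H_coord (word currency).**  A torus-equivariant affine pencil that is word-cheap has a WEIGHT-GRADED word-cheap certificate of the
same budget. [this file; no topology] -/
theorem wordCheap_graded_of_torusEquivariant (N : AffMat n m) (hN : IsAffine N) (w : Fin n × Fin n → ℕ)
    (hT : TorusEquivariant N w) (h : WordCheap n m N) :
    ∃ (K : Submodule ℂ (Fin n × Fin n → ℂ)) (k : ℕ), (k + 1) * n < Module.finrank ℂ K ∧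
      (∀ s ∈ K, ∀ c, wtProj w c s ∈ K) ∧
      ∀ x v : Fin n × Fin n → ℂ, v ∈ K → WordTame n k (N.map (MvPolynomial.eval x)) (linPart N v) := by
  obtain ⟨K, k, hdim, hW⟩ := h
  have hkn := budget_le K hdim
  have hKS : ∀ v ∈ K, v ∈ S N k := fun v hv =>
    (mem_S_iff_wordTame N hN hkn v).mpr fun x => hW x v hv
  have hstable : ∀ τ : ℂ, τ ≠ 0 → ∀ v ∈ K, ∀ F ∈ family N k,
      MvPolynomial.eval (torusAct w τ v) F = 0 := fun τ hτ v hv =>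
    eval_family_of_mem_S N (torusAct_mem_S N hT (hKS v hv) hτ)
  obtain ⟨K₀, hfin, hgr, hzero⟩ := exists_graded_of_torusStable w K (family N k) hstable
  refine ⟨K₀, k, by rw [hfin]; exact hdim, hgr, fun x v hv => ?_⟩
  exact (mem_S_iff_wordTame N hN hkn v).mp (mem_S_of_eval_family N (hzero v hv)) x

/-- **H_coord (flag currency).**  A torus-equivariant affine pencil that is flag-cheap has a WEIGHT-GRADED flag-cheap certificate. -/
theorem flagCheap_graded_of_torusEquivariant (N : AffMat n m) (hN : IsAffine N) (w : Fin n × Fin n → ℕ)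
    (hT : TorusEquivariant N w) (h : FlagCheap n m N) :
    ∃ (K : Submodule ℂ (Fin n × Fin n → ℂ)) (k : ℕ),
      (∀ x v : Fin n × Fin n → ℂ, v ∈ K → FlagAdaptedUpTo m k n (N.map (lineSubst x v))) ∧
      (k + 1) * n < Module.finrank ℂ K ∧ (∀ s ∈ K, ∀ c, wtProj w c s ∈ K) := by
  obtain ⟨K, k, hdim, hgr, hW⟩ :=
    wordCheap_graded_of_torusEquivariant N hN w hT ((flagCheap_iff_wordCheap N hN).mp h)
  refine ⟨K, k, fun x v hv => ?_, hdim, hgr⟩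
  obtain ⟨h0, h1, h2⟩ := coeffs_map_lineSubst N hN x v
  refine flagAdaptedUpTo_of_wordTame _ h2 ?_
  rw [h0, h1]
  exact hW x v hv

/-- **Contrapositive for refuters** (the shape of `heavyTopLaw_false_of_coordClosure` without its hypothesis): to show a torus-equivariant
affine pencil is NOT flag-cheap it suffices to kill every WEIGHT-GRADED candidate certificate. -/
theorem not_flagCheap_of_graded (N : AffMat n m) (hN : IsAffine N) (w : Fin n × Fin n → ℕ) (hT : TorusEquivariant N w)
    (hkill : ∀ (K : Submodule ℂ (Fin n × Fin n → ℂ)) (k : ℕ), (k + 1) * n < Module.finrank ℂ K →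
      (∀ s ∈ K, ∀ c, wtProj w c s ∈ K) →
      ∃ x v, v ∈ K ∧ ¬ WordTame n k (N.map (MvPolynomial.eval x)) (linPart N v)) :
    ¬ FlagCheap n m N := by
  intro h
  obtain ⟨K, k, hdim, hgr, hW⟩ :=
    wordCheap_graded_of_torusEquivariant N hN w hT ((flagCheap_iff_wordCheap N hN).mp h)
  obtain ⟨x, v, hv, hnot⟩ := hkill K k hdim hgr
  exact hnot (hW x v hv)

end Summit.ValiantsHypothesis.ValiantsHypothesis.Cruxes.DualUnipotentThreeHalves.InitialForm.TorusClosure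

end

/-! # PART III — CURVE CLOSURE: the `t`-adic initial subspace of an ALGEBRAIC family of certificates (Mathlib only)

The torus orbit `λ_w(τ) • K` of Part I is the simplest algebraic one-parameter family of subspaces.  For the DEFORMATION CUT
(crit-7 V28 §3; idea-26 `MassCut.lean` §6 `SlowClosedAlongCurves`, `DeformationCut`) one needs the same step along an arbitrary
POLYNOMIAL CURVE: `exists_limit_of_algebraic_family` — if a `𝕜[X]`-submodule `N ≤ (ι → 𝕜[X])` (an algebraic family of certificate
vectors, `K_t ⊇ ev t N`) evaluates into the zero locus of a family `𝓕 ⊆ MvPolynomial ι 𝕜[X]` (coefficients polynomial in the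
parameter) for every `t` in an infinite set `T ∌ 0`, then a `𝕜`-subspace `K₀` with `finrank 𝕜 K₀ = finrank 𝕜[X] N` (= the generic
dimension), made of initial vectors `u(0)` (`X^C u ∈ N`), lies in the zero locus of `𝓕` at `t = 0`.  Tools: Smith normal form over the
PID `𝕜[X]` (`Submodule.smithNormalForm`), `a i = X^{c i} g i` with `g i (0) ≠ 0`, invertibility of the evaluated basis matrix, and
`Polynomial.eq_zero_of_infinite_isRoot`.  WHAT THIS DOES NOT DO (honest): the POINTWISE `SlowClosedAlongCurves` (certificates `K_t`
chosen independently for each `t`) needs CURVE SELECTION (Chevalley / a finite base change) or properness of the Grassmannian BEFORE this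
step — tier L, not here; for CANONICALLY certified laws (`K_t = ker Φ(N_t)` with `Φ` polynomial in the pencil) the kernel over `𝕜[X]`
is such an `N` on the cofinite set of maximal rank, and this theorem then gives (Cl) outright. -/

section CurveClosure

open scoped Polynomial

namespace Summit.ValiantsHypothesis.ValiantsHypothesis.Cruxes.DualUnipotentThreeHalves.InitialForm.CurveClosure

variable {𝕜 : Type*} [Field 𝕜] {ι : Type*}

/-- Evaluation of a polynomial vector at the parameter `t`. -/
def ev (t : 𝕜) (p : ι → 𝕜[X]) : ι → 𝕜 := fun e => (p e).eval t

@[simp] theorem ev_apply (t : 𝕜) (p : ι → 𝕜[X]) (e : ι) : ev t p e = (p e).eval t := rfl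

theorem ev_add (t : 𝕜) (p q : ι → 𝕜[X]) : ev t (p + q) = ev t p + ev t q := by
  funext e; simp [ev]

theorem ev_smul (t : 𝕜) (μ : 𝕜) (p : ι → 𝕜[X]) : ev t (μ • p) = μ • ev t p := by
  funext e; simp [ev, Polynomial.eval_smul]

theorem ev_smul_poly (t : 𝕜) (g : 𝕜[X]) (p : ι → 𝕜[X]) : ev t (g • p) = g.eval t • ev t p := by
  funext e; simp [ev, Polynomial.eval_mul]

theorem ev_sum {α : Type*} (t : 𝕜) (s : Finset α) (p : α → ι → 𝕜[X]) :
    ev t (∑ a ∈ s, p a) = ∑ a ∈ s, ev t (p a) := by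
  funext e; simp [ev, Finset.sum_apply, Polynomial.eval_finsetSum]

/-- Compatibility of `MvPolynomial.eval` at a polynomial vector with evaluation of the parameter. -/
theorem eval_ev (t : 𝕜) (u : ι → 𝕜[X]) (F : MvPolynomial ι 𝕜[X]) :
    (MvPolynomial.eval u F).eval t = MvPolynomial.eval (ev t u) (MvPolynomial.map (Polynomial.evalRingHom t) F) := by
  induction F using MvPolynomial.induction_on with
  | C a => simp
  | add p q hp hq => simp [hp, hq]
  | mul_X p e hp => simp [hp, ev]

/-- The evaluations at any parameter of a `𝕜[X]`-basis of `ι → 𝕜[X]` are linearly independent over `𝕜`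
(the coordinate matrix is invertible over `𝕜[X]`, hence so is its evaluation). -/
theorem linearIndependent_ev_basis [Fintype ι] [DecidableEq ι] (b : Module.Basis ι 𝕜[X] (ι → 𝕜[X])) (t : 𝕜) :
    LinearIndependent 𝕜 (fun j => ev t (b j)) := by
  set A : Matrix ι ι 𝕜[X] := (Pi.basisFun 𝕜[X] ι).toMatrix b with hA
  set B : Matrix ι ι 𝕜[X] := b.toMatrix (Pi.basisFun 𝕜[X] ι) with hB
  have hBA : B * A = 1 := Module.Basis.toMatrix_mul_toMatrix_flip _ _
  have hA' : ∀ i j, A i j = b j i := by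
    intro i j; simp [hA, Module.Basis.toMatrix_apply, Pi.basisFun_repr]
  have h1 : B.map (Polynomial.evalRingHom t) * A.map (Polynomial.evalRingHom t) = 1 := by
    rw [← Matrix.map_mul, hBA, Matrix.map_one _ (map_zero _) (map_one _)]
  rw [Fintype.linearIndependent_iff]
  intro g hg j
  have hmv : (A.map (Polynomial.evalRingHom t)).mulVec g = 0 := by
    funext i
    have := congrFun hg i
    simp only [Finset.sum_apply, Pi.smul_apply, smul_eq_mul, Pi.zero_apply, ev_apply] at this
    simp only [Matrix.mulVec, dotProduct, Matrix.map_apply, Polynomial.coe_evalRingHom, hA', Pi.zero_apply]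
    rw [← this]
    exact Finset.sum_congr rfl fun j _ => mul_comm _ _
  have hg' : g = (B.map (Polynomial.evalRingHom t) * A.map (Polynomial.evalRingHom t)).mulVec g := by
    rw [h1, Matrix.one_mulVec]
  rw [hg', ← Matrix.mulVec_mulVec, hmv, Matrix.mulVec_zero, Pi.zero_apply]

/-- INITIAL VECTORS LIE IN THE LIMIT ZERO LOCUS.  If `X^C • u ∈ N` and every evaluation `ev t p` (`p ∈ N`, `t ∈ T`,
`T` infinite and missing `0`) is a zero of the evaluated family, then `ev 0 u` is a zero of the family evaluated at `0`. -/
theorem eval_ev_zero_of_initial (N : Submodule 𝕜[X] (ι → 𝕜[X])) (𝓕 : Set (MvPolynomial ι 𝕜[X]))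
    (T : Set 𝕜) (hT : T.Infinite) (hT0 : (0 : 𝕜) ∉ T)
    (hS : ∀ t ∈ T, ∀ p ∈ N, ∀ F ∈ 𝓕, MvPolynomial.eval (ev t p) (MvPolynomial.map (Polynomial.evalRingHom t) F) = 0)
    {u : ι → 𝕜[X]} {C : ℕ} (hu : ((Polynomial.X : 𝕜[X]) ^ C) • u ∈ N) {F : MvPolynomial ι 𝕜[X]} (hF : F ∈ 𝓕) :
    MvPolynomial.eval (ev 0 u) (MvPolynomial.map (Polynomial.evalRingHom 0) F) = 0 := by
  -- the polynomial `t ↦ F_t(u(t))` vanishes on `T`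
  set Φ : 𝕜[X] := MvPolynomial.eval u F with hΦ
  have hroot : ∀ t ∈ T, Φ.IsRoot t := by
    intro t ht
    have ht0 : t ≠ 0 := fun h => hT0 (h ▸ ht)
    have hmem : (t⁻¹) ^ C • (((Polynomial.X : 𝕜[X]) ^ C) • u) ∈ N := N.smul_of_tower_mem _ hu
    have hev : ev t ((t⁻¹) ^ C • (((Polynomial.X : 𝕜[X]) ^ C) • u)) = ev t u := by
      rw [ev_smul, ev_smul_poly, Polynomial.eval_pow, Polynomial.eval_X, smul_smul, ← mul_pow,
        inv_mul_cancel₀ ht0, one_pow, one_smul]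
    have := hS t ht _ hmem F hF
    rw [hev, ← eval_ev] at this
    exact this
  have hΦ0 : Φ = 0 := Polynomial.eq_zero_of_infinite_isRoot Φ (hT.mono fun t ht => hroot t ht)
  have := congrArg (Polynomial.eval (0 : 𝕜)) hΦ0
  rw [Polynomial.eval_zero, hΦ, eval_ev] at this
  exact this

/-- **CURVE CLOSURE (algebraic families).**  Let `N ≤ (ι → 𝕜[X])` be a `𝕜[X]`-submodule — an ALGEBRAIC one-parameter
family of certificate vectors — such that for every parameter `t` in an infinite set `T ∌ 0` all evaluations `ev t p`,
`p ∈ N`, lie in the zero locus of the family `𝓕` evaluated at `t`.  Then there is a `𝕜`-subspace `K₀` of the SAME dimension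
(`finrank 𝕜 K₀ = finrank 𝕜[X] N`, the generic dimension of the family) consisting of INITIAL VECTORS of `N`
(`v = u(0)` with `X^C u ∈ N`) and contained in the zero locus of `𝓕` evaluated at `t = 0`.
Proof: Smith normal form of `N` over the PID `𝕜[X]` (aligned bases `bN i = a i • bM (f i)`), `a i = X^{c i} g i` with
`g i (0) ≠ 0`, `K₀ := span (ev 0 (bM (f i)))` (independent: `linearIndependent_ev_basis`), and `eval_ev_zero_of_initial`. -/
theorem exists_limit_of_algebraic_family [Fintype ι] [DecidableEq ι] (N : Submodule 𝕜[X] (ι → 𝕜[X]))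
    (𝓕 : Set (MvPolynomial ι 𝕜[X])) (T : Set 𝕜) (hT : T.Infinite) (hT0 : (0 : 𝕜) ∉ T)
    (hS : ∀ t ∈ T, ∀ p ∈ N, ∀ F ∈ 𝓕, MvPolynomial.eval (ev t p) (MvPolynomial.map (Polynomial.evalRingHom t) F) = 0) :
    ∃ K₀ : Submodule 𝕜 (ι → 𝕜), Module.finrank 𝕜 K₀ = Module.finrank 𝕜[X] N ∧
      (∀ v ∈ K₀, ∃ u : ι → 𝕜[X], ev 0 u = v ∧ ∃ C : ℕ, ((Polynomial.X : 𝕜[X]) ^ C) • u ∈ N) ∧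
      ∀ v ∈ K₀, ∀ F ∈ 𝓕, MvPolynomial.eval v (MvPolynomial.map (Polynomial.evalRingHom 0) F) = 0 := by
  obtain ⟨n, bM, bN, f, a, hsnf⟩ := Submodule.smithNormalForm (Pi.basisFun 𝕜[X] ι) N
  -- the diagonal entries are nonzero
  have ha : ∀ i, a i ≠ 0 := by
    intro i h
    have h1 : (bN i : ι → 𝕜[X]) = 0 := by rw [hsnf i, h, zero_smul]
    exact bN.ne_zero i (Subtype.coe_injective.eq_iff.mp (h1.trans (Submodule.coe_zero).symm))
  -- `a i = X^{c i} * g i` with `g i (0) ≠ 0`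
  have hdec : ∀ i, ∃ q : 𝕜[X], a i = (Polynomial.X) ^ (a i).rootMultiplicity 0 * q ∧ q.eval 0 ≠ 0 := by
    intro i
    obtain ⟨q, hq, hndvd⟩ := Polynomial.exists_eq_pow_rootMultiplicity_mul_and_not_dvd (a i) (ha i) 0
    rw [map_zero, sub_zero] at hq hndvd
    refine ⟨q, hq, fun h0 => hndvd ?_⟩
    rw [Polynomial.X_dvd_iff, Polynomial.coeff_zero_eq_eval_zero]
    exact h0
  choose g hg using hdec
  set c : Fin n → ℕ := fun i => (a i).rootMultiplicity 0 with hc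
  -- the limit subspace
  set e : Fin n → ι → 𝕜 := fun i => ev 0 (bM (f i)) with he
  have hind : LinearIndependent 𝕜 e := (linearIndependent_ev_basis bM 0).comp f f.injective
  refine ⟨Submodule.span 𝕜 (Set.range e), ?_, ?_, ?_⟩
  · rw [finrank_span_eq_card hind, Fintype.card_fin, Module.finrank_eq_card_basis bN, Fintype.card_fin]
  · intro v hv
    obtain ⟨lam, rfl⟩ := Submodule.mem_span_range_iff_exists_fun 𝕜 |>.mp hv
    -- u := Σ (lam i / g i 0) • g i • bM (f i), and X^{Cmax} u ∈ N
    let Cmax : ℕ := ∑ i, c i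
    have hcle : ∀ i, c i ≤ Cmax := fun i => Finset.single_le_sum (fun j _ => Nat.zero_le (c j)) (Finset.mem_univ i)
    refine ⟨∑ i, (lam i / (g i).eval 0) • (g i • bM (f i)), ?_, Cmax, ?_⟩
    · rw [ev_sum]
      refine Finset.sum_congr rfl fun i _ => ?_
      rw [ev_smul, ev_smul_poly, smul_smul, div_mul_cancel₀ _ (hg i).2]
    · rw [Finset.smul_sum]
      refine Submodule.sum_mem _ fun i _ => ?_
      have hterm : ((Polynomial.X : 𝕜[X]) ^ Cmax) • ((lam i / (g i).eval 0) • (g i • bM (f i)))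
          = (lam i / (g i).eval 0) • ((Polynomial.X : 𝕜[X]) ^ (Cmax - c i) • (bN i : ι → 𝕜[X])) := by
        rw [hsnf i, (hg i).1, smul_comm, smul_smul, smul_smul, ← mul_assoc, pow_sub_mul_pow _ (hcle i)]
      rw [hterm]
      exact Submodule.smul_of_tower_mem _ _ (N.smul_mem _ (bN i).2)
  · intro v hv F hF
    -- reuse the previous bullet through `eval_ev_zero_of_initial`
    obtain ⟨lam, rfl⟩ := Submodule.mem_span_range_iff_exists_fun 𝕜 |>.mp hv
    let Cmax : ℕ := ∑ i, c i
    have hcle : ∀ i, c i ≤ Cmax := fun i => Finset.single_le_sum (fun j _ => Nat.zero_le (c j)) (Finset.mem_univ i)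
    set u : ι → 𝕜[X] := ∑ i, (lam i / (g i).eval 0) • (g i • bM (f i)) with hu_def
    have hu0 : ev 0 u = ∑ i, lam i • e i := by
      rw [hu_def, ev_sum]
      refine Finset.sum_congr rfl fun i _ => ?_
      rw [ev_smul, ev_smul_poly, smul_smul, div_mul_cancel₀ _ (hg i).2]
    have huN : ((Polynomial.X : 𝕜[X]) ^ Cmax) • u ∈ N := by
      rw [hu_def, Finset.smul_sum]
      refine Submodule.sum_mem _ fun i _ => ?_
      have hterm : ((Polynomial.X : 𝕜[X]) ^ Cmax) • ((lam i / (g i).eval 0) • (g i • bM (f i)))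
          = (lam i / (g i).eval 0) • ((Polynomial.X : 𝕜[X]) ^ (Cmax - c i) • (bN i : ι → 𝕜[X])) := by
        rw [hsnf i, (hg i).1, smul_comm, smul_smul, smul_smul, ← mul_assoc, pow_sub_mul_pow _ (hcle i)]
      rw [hterm]
      exact Submodule.smul_of_tower_mem _ _ (N.smul_mem _ (bN i).2)
    rw [← hu0]
    exact eval_ev_zero_of_initial N 𝓕 T hT hT0 hS huN hF

/-- **CURVE CLOSURE, canonical form (Part III′).**  As `exists_limit_of_algebraic_family`, with the limit subspace characterised
SEMANTICALLY: every polynomial vector `w` whose evaluations lie in the evaluated family for infinitely many parameters has its initial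
vector `ev 0 w` in `K₀` (so `K₀` is the space of ALL initial vectors — the canonical limit). -/
theorem exists_limit_of_algebraic_family' [Fintype ι] [DecidableEq ι] (N : Submodule 𝕜[X] (ι → 𝕜[X]))
    (𝓕 : Set (MvPolynomial ι 𝕜[X])) (T : Set 𝕜) (hT : T.Infinite) (hT0 : (0 : 𝕜) ∉ T)
    (hS : ∀ t ∈ T, ∀ p ∈ N, ∀ F ∈ 𝓕, MvPolynomial.eval (ev t p) (MvPolynomial.map (Polynomial.evalRingHom t) F) = 0) :
    ∃ K₀ : Submodule 𝕜 (ι → 𝕜), Module.finrank 𝕜 K₀ = Module.finrank 𝕜[X] N ∧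
      (∀ v ∈ K₀, ∃ u : ι → 𝕜[X], ev 0 u = v ∧ ∃ C : ℕ, ((Polynomial.X : 𝕜[X]) ^ C) • u ∈ N) ∧
      (∀ w : ι → 𝕜[X], Set.Infinite {t : 𝕜 | ∃ p ∈ N, ev t p = ev t w} → ev 0 w ∈ K₀) ∧
      ∀ v ∈ K₀, ∀ F ∈ 𝓕, MvPolynomial.eval v (MvPolynomial.map (Polynomial.evalRingHom 0) F) = 0 := by
  obtain ⟨n, bM, bN, f, a, hsnf⟩ := Submodule.smithNormalForm (Pi.basisFun 𝕜[X] ι) N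
  have ha : ∀ i, a i ≠ 0 := by
    intro i h
    have h1 : (bN i : ι → 𝕜[X]) = 0 := by rw [hsnf i, h, zero_smul]
    exact bN.ne_zero i (Subtype.coe_injective.eq_iff.mp (h1.trans (Submodule.coe_zero).symm))
  have hdec : ∀ i, ∃ q : 𝕜[X], a i = (Polynomial.X) ^ (a i).rootMultiplicity 0 * q ∧ q.eval 0 ≠ 0 := by
    intro i
    obtain ⟨q, hq, hndvd⟩ := Polynomial.exists_eq_pow_rootMultiplicity_mul_and_not_dvd (a i) (ha i) 0
    rw [map_zero, sub_zero] at hq hndvd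
    refine ⟨q, hq, fun h0 => hndvd ?_⟩
    rw [Polynomial.X_dvd_iff, Polynomial.coeff_zero_eq_eval_zero]
    exact h0
  choose g hg using hdec
  set c : Fin n → ℕ := fun i => (a i).rootMultiplicity 0 with hc
  set e : Fin n → ι → 𝕜 := fun i => ev 0 (bM (f i)) with he
  have hind : LinearIndependent 𝕜 e := (linearIndependent_ev_basis bM 0).comp f f.injective
  -- expansion of evaluations in the evaluated basis
  have hexp : ∀ (t : 𝕜) (w : ι → 𝕜[X]), ev t w = ∑ j, (bM.repr w j).eval t • ev t (bM j) := by
    intro t w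
    conv_lhs => rw [← bM.sum_repr w]
    rw [ev_sum]
    exact Finset.sum_congr rfl fun j _ => ev_smul_poly t _ _
  -- coordinates of members of `N` off `range f` vanish
  have hcoordN : ∀ p ∈ N, ∀ j, j ∉ Set.range f → bM.repr p j = 0 := by
    intro p hp j hj
    have h1 : p = ∑ i, bN.repr ⟨p, hp⟩ i • (bN i : ι → 𝕜[X]) := by
      have := congrArg Subtype.val (bN.sum_repr ⟨p, hp⟩)
      simp only [AddSubmonoidClass.coe_finsetSum, SetLike.val_smul] at this
      exact this.symm
    rw [h1, map_sum, Finsupp.finsetSum_apply]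
    refine Finset.sum_eq_zero fun i _ => ?_
    rw [map_smul, hsnf i, map_smul, bM.repr_self, Finsupp.smul_apply, Finsupp.smul_apply, Finsupp.single_apply,
      if_neg (fun h => hj ⟨i, h⟩), smul_zero, smul_zero]
  refine ⟨Submodule.span 𝕜 (Set.range e), ?_, ?_, ?_, ?_⟩
  · rw [finrank_span_eq_card hind, Fintype.card_fin, Module.finrank_eq_card_basis bN, Fintype.card_fin]
  · intro v hv
    obtain ⟨lam, rfl⟩ := Submodule.mem_span_range_iff_exists_fun 𝕜 |>.mp hv
    let Cmax : ℕ := ∑ i, c i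
    have hcle : ∀ i, c i ≤ Cmax := fun i => Finset.single_le_sum (fun j _ => Nat.zero_le (c j)) (Finset.mem_univ i)
    refine ⟨∑ i, (lam i / (g i).eval 0) • (g i • bM (f i)), ?_, Cmax, ?_⟩
    · rw [ev_sum]
      refine Finset.sum_congr rfl fun i _ => ?_
      rw [ev_smul, ev_smul_poly, smul_smul, div_mul_cancel₀ _ (hg i).2]
    · rw [Finset.smul_sum]
      refine Submodule.sum_mem _ fun i _ => ?_
      have hterm : ((Polynomial.X : 𝕜[X]) ^ Cmax) • ((lam i / (g i).eval 0) • (g i • bM (f i)))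
          = (lam i / (g i).eval 0) • ((Polynomial.X : 𝕜[X]) ^ (Cmax - c i) • (bN i : ι → 𝕜[X])) := by
        rw [hsnf i, (hg i).1, smul_comm, smul_smul, smul_smul, ← mul_assoc, pow_sub_mul_pow _ (hcle i)]
      rw [hterm]
      exact Submodule.smul_of_tower_mem _ _ (N.smul_mem _ (bN i).2)
  · -- the canonical-limit property
    intro w hw
    have hvan : ∀ j, j ∉ Set.range f → bM.repr w j = 0 := by
      intro j hj
      apply Polynomial.eq_zero_of_infinite_isRoot
      refine hw.mono ?_
      rintro t ⟨p, hp, hpt⟩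
      have h1 := hexp t p
      have h2 := hexp t w
      rw [hpt] at h1
      have h3 : ∑ j, ((bM.repr p j).eval t - (bM.repr w j).eval t) • ev t (bM j) = 0 := by
        simp only [sub_smul, Finset.sum_sub_distrib, ← h1, ← h2, sub_self]
      have h4 := Fintype.linearIndependent_iff.mp (linearIndependent_ev_basis bM t) _ h3 j
      rw [hcoordN p hp j hj, Polynomial.eval_zero, zero_sub, neg_eq_zero] at h4
      exact h4
    have hw0 : ev 0 w = ∑ i, (bM.repr w (f i)).eval 0 • e i := by
      rw [hexp 0 w]
      rw [← Finset.sum_subset (Finset.subset_univ (Finset.univ.map f))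
        (fun j _ hj => by
          rw [hvan j (fun ⟨i, hi⟩ => hj (Finset.mem_map.mpr ⟨i, Finset.mem_univ _, hi⟩)), Polynomial.eval_zero, zero_smul])]
      rw [Finset.sum_map]
    rw [hw0]
    exact Submodule.sum_mem _ fun i _ => Submodule.smul_mem _ _ (Submodule.subset_span ⟨i, rfl⟩)
  · intro v hv F hF
    obtain ⟨lam, rfl⟩ := Submodule.mem_span_range_iff_exists_fun 𝕜 |>.mp hv
    let Cmax : ℕ := ∑ i, c i
    have hcle : ∀ i, c i ≤ Cmax := fun i => Finset.single_le_sum (fun j _ => Nat.zero_le (c j)) (Finset.mem_univ i)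
    set u : ι → 𝕜[X] := ∑ i, (lam i / (g i).eval 0) • (g i • bM (f i)) with hu_def
    have hu0 : ev 0 u = ∑ i, lam i • e i := by
      rw [hu_def, ev_sum]
      refine Finset.sum_congr rfl fun i _ => ?_
      rw [ev_smul, ev_smul_poly, smul_smul, div_mul_cancel₀ _ (hg i).2]
    have huN : ((Polynomial.X : 𝕜[X]) ^ Cmax) • u ∈ N := by
      rw [hu_def, Finset.smul_sum]
      refine Submodule.sum_mem _ fun i _ => ?_
      have hterm : ((Polynomial.X : 𝕜[X]) ^ Cmax) • ((lam i / (g i).eval 0) • (g i • bM (f i)))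
          = (lam i / (g i).eval 0) • ((Polynomial.X : 𝕜[X]) ^ (Cmax - c i) • (bN i : ι → 𝕜[X])) := by
        rw [hsnf i, (hg i).1, smul_comm, smul_smul, smul_smul, ← mul_assoc, pow_sub_mul_pow _ (hcle i)]
      rw [hterm]
      exact Submodule.smul_of_tower_mem _ _ (N.smul_mem _ (bN i).2)
    rw [← hu0]
    exact eval_ev_zero_of_initial N 𝓕 T hT hT0 hS huN hF

end Summit.ValiantsHypothesis.ValiantsHypothesis.Cruxes.DualUnipotentThreeHalves.InitialForm.CurveClosure

end CurveClosure

/-! # PART IV — THE MONOMIAL COUNT: with singleton weight classes a graded certificate is a COORDINATE subspace, so the graded kill is a COUNT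

crit-7 V29-1: for ONE Sidon cocharacter every weight class off an exceptional coordinate set `Z` is a singleton; then a weight-graded `K`
contains the basis vector of every coordinate it uses off `Z`, hence `finrank K ≤ #Z + #{coordinates off Z whose basis vector is tame}`.
So `hkill` of `not_flagCheap_of_graded` follows from the pure COUNT `#{e ∉ Z | tame e} + #Z ≤ (k+1)·n` (`not_flagCheap_of_count`);
the remaining debt for an unconditional `¬HeavyTopLaw` via `E(n)` is (α) typing `E(n)` as a `linPencil` with the support condition and a Sidon
cocharacter, and (β)(γ) the per-coordinate wildness (rigid words, Band Lemma′) that bounds the tame count — V29-4. -/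

section MonomialCount

namespace Summit.ValiantsHypothesis.ValiantsHypothesis.Cruxes.DualUnipotentThreeHalves.InitialForm

variable {ι : Type*} [DecidableEq ι]

/-- With singleton weight classes off `Z`, the weight projection of a coordinate `e ∉ Z` is the coordinate projection. -/
theorem wtProj_eq_single (w : ι → ℕ) (Z : Finset ι) (hZ : ∀ e, e ∉ Z → ∀ e', w e' = w e → e' = e)
    {e : ι} (he : e ∉ Z) (s : ι → ℂ) : wtProj w (w e) s = s e • (Pi.single e (1 : ℂ) : ι → ℂ) := by
  funext e'
  by_cases h : e' = e
  · subst h; simp [wtProj]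
  · have hw : w e' ≠ w e := fun hwe => h (hZ e he e' hwe)
    simp [wtProj, hw, h]

/-- **MONOMIAL COUNT.**  Let the weight classes off `Z` be singletons and let `Tame` be any predicate on coordinates.  If a weight-graded
subspace `K` has `finrank K > #{e ∉ Z | Tame e} + #Z`, then `K` contains the basis vector of a NON-tame coordinate off `Z`. -/
theorem exists_wild_coordinate [Fintype ι] (w : ι → ℕ) (Z : Finset ι) (hZ : ∀ e, e ∉ Z → ∀ e', w e' = w e → e' = e)
    (Tame : ι → Prop) [DecidablePred Tame] (K : Submodule ℂ (ι → ℂ))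
    (hgr : ∀ s ∈ K, ∀ c, wtProj w c s ∈ K)
    (hdim : (Finset.univ.filter fun e => e ∉ Z ∧ Tame e).card + Z.card < Module.finrank ℂ K) :
    ∃ e, e ∉ Z ∧ ¬ Tame e ∧ (Pi.single e (1 : ℂ) : ι → ℂ) ∈ K := by
  by_contra hno
  push Not at hno
  -- every element of `K` vanishes at the wild coordinates off `Z`
  have hvan : ∀ s ∈ K, ∀ e, e ∉ Z → ¬ Tame e → s e = 0 := by
    intro s hs e he ht
    by_contra hse
    have hmem : wtProj w (w e) s ∈ K := hgr s hs (w e)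
    rw [wtProj_eq_single w Z hZ he s] at hmem
    have : (Pi.single e (1 : ℂ) : ι → ℂ) ∈ K := by
      have h2 := K.smul_mem (s e)⁻¹ hmem
      rwa [smul_smul, inv_mul_cancel₀ hse, one_smul] at h2
    exact hno e he ht this
  -- restriction to the allowed coordinates is injective on `K`
  let A := {e : ι // e ∈ Z ∨ Tame e}
  let r : K →ₗ[ℂ] (A → ℂ) :=
    { toFun := fun s a => (s : ι → ℂ) a.1
      map_add' := fun s t => by funext a; simp
      map_smul' := fun c s => by funext a; simp }
  have hr : Function.Injective r := by
    intro s t hst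
    apply Subtype.ext
    funext e
    by_cases hA : e ∈ Z ∨ Tame e
    · exact congrFun hst ⟨e, hA⟩
    · push Not at hA
      rw [hvan s s.2 e hA.1 hA.2, hvan t t.2 e hA.1 hA.2]
  have hle : Module.finrank ℂ K ≤ Fintype.card A := by
    have := LinearMap.finrank_le_finrank_of_injective hr
    rwa [Module.finrank_fintype_fun_eq_card] at this
  have hcard : Fintype.card A ≤ (Finset.univ.filter fun e => e ∉ Z ∧ Tame e).card + Z.card := by
    rw [Fintype.card_subtype]
    calc (Finset.univ.filter fun e => e ∈ Z ∨ Tame e).card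
        ≤ ((Finset.univ.filter fun e => e ∉ Z ∧ Tame e) ∪ Z).card := by
          apply Finset.card_le_card
          intro e he
          simp only [Finset.mem_filter, Finset.mem_univ, true_and, Finset.mem_union] at he ⊢
          by_cases hz : e ∈ Z
          · exact Or.inr hz
          · rcases he with h | h
            · exact absurd h hz
            · exact Or.inl ⟨hz, h⟩
      _ ≤ (Finset.univ.filter fun e => e ∉ Z ∧ Tame e).card + Z.card := Finset.card_union_le _ _
  omega

end Summit.ValiantsHypothesis.ValiantsHypothesis.Cruxes.DualUnipotentThreeHalves.InitialForm

namespace Summit.ValiantsHypothesis.ValiantsHypothesis.Cruxes.DualUnipotentThreeHalves.InitialForm.TorusClosure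

open Summit.ValiantsHypothesis.ValiantsHypothesis.Cruxes.TwoDimCoefficients.DimTwoCases (AffMat IsAffine)
open Summit.ValiantsHypothesis.ValiantsHypothesis.Cruxes.DualUnipotentThreeHalves.RadicalSplit

variable {m n : ℕ}

/-- **`H_coord` + MONOMIAL COUNT.**  For an affine pencil equivariant under a cocharacter whose weight classes off `Z` are singletons,
FLAG-cheapness is refuted by the COUNT: for every budget `k`, the coordinates off `Z` whose basis direction is word-tame along every line,
plus `#Z`, number at most `(k+1)·n`.  (The pencil-specific work is to bound the tame count — rigid words / Band Lemma′.) -/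
theorem not_flagCheap_of_count (N : AffMat n m) (hN : IsAffine N) (w : Fin n × Fin n → ℕ) (hT : TorusEquivariant N w)
    (Z : Finset (Fin n × Fin n)) (hZ : ∀ e, e ∉ Z → ∀ e', w e' = w e → e' = e)
    (hcount : ∀ k : ℕ, k + 2 ≤ n →
      (open Classical in
        (Finset.univ.filter fun e => e ∉ Z ∧
          ∀ x, WordTame n k (N.map (MvPolynomial.eval x)) (linPart N (Pi.single e (1 : ℂ)))).card) + Z.card ≤ (k + 1) * n) :
    ¬ FlagCheap n m N := by
  classical
  refine not_flagCheap_of_graded N hN w hT fun K k hdim hgr => ?_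
  have hkn : k + 2 ≤ n := budget_le K hdim
  have hlt := lt_of_le_of_lt (hcount k hkn) hdim
  obtain ⟨e, -, hnot, hmem⟩ := exists_wild_coordinate w Z hZ
    (fun e => ∀ x, WordTame n k (N.map (MvPolynomial.eval x)) (linPart N (Pi.single e (1 : ℂ)))) K hgr (by convert hlt)
  push Not at hnot
  obtain ⟨x, hx⟩ := hnot
  exact ⟨x, _, hmem, hx⟩

end Summit.ValiantsHypothesis.ValiantsHypothesis.Cruxes.DualUnipotentThreeHalves.InitialForm.TorusClosure

end MonomialCount

/-! # PART V — SLOW IS CLOSED ALONG POLYNOMIAL CURVES FOR ALGEBRAIC CERTIFICATE FAMILIES (power currency)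

Part III instantiated to the `Slow` certificate of `Lines/slow_core.lean` (`deg_s (N(x+sv)^{n-1})_{ab} ≤ k`): the `s^e`-coefficients
are specialisations of UNIVERSAL polynomials `G d F x e a b ∈ MvPolynomial ι ℂ[X]` (LEMMA U `eval_G`: a universal line substitution
`Λ x` into `𝔸 = MvPolynomial (Fin 1) (MvPolynomial ι ℂ[X])`, specialised by `φ t v`; `Matrix.map_pow`, `MvPolynomial.coeff_map`), so
`slow_curve_zero_of_algebraic_family`: along a polynomial curve `curve d F` (same text as `MassCut.curve`), an ALGEBRAIC family `N` of
directions that is `k`-slow for all `t` off a finite set and has generic dimension `> (k+1)·n` makes the member `t = 0` `Slow` with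
budget `k` (conclusion = body of `SlowCoreLine.Slow` verbatim).  Honest: NOT the pointwise `MassCut.SlowClosedAlongCurves`. -/

noncomputable section

namespace Summit.ValiantsHypothesis.ValiantsHypothesis.Cruxes.DualUnipotentThreeHalves.InitialForm.SlowCurve

open scoped Polynomial
open Summit.ValiantsHypothesis.ValiantsHypothesis.Cruxes.TwoDimCoefficients.DimTwoCases (AffMat IsAffine)
open Summit.ValiantsHypothesis.ValiantsHypothesis.Cruxes.DualUnipotentThreeHalves.RadicalSplit (lineSubst)
open Summit.ValiantsHypothesis.ValiantsHypothesis.Cruxes.DualUnipotentThreeHalves.InitialForm.CurveClosure (ev ev_apply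
  exists_limit_of_algebraic_family)

variable {n m : ℕ}

/-- The member `t` of the polynomial curve of pencils `F 0 + t F 1 + … + t^d F d` (= idea-26 `MassCut.curve`, same text). -/
def curve (d : ℕ) (F : ℕ → AffMat n m) (t : ℂ) : AffMat n m :=
  ∑ i ∈ Finset.range (d + 1), (t ^ i) • F i

/-- The universal coefficient ring: outer variable `s = X 0`, middle variables `V_e` (the direction), inner `t` (the curve parameter). -/
abbrev 𝔸 (n : ℕ) : Type := MvPolynomial (Fin 1) (MvPolynomial (Fin n × Fin n) ℂ[X])

/-- `ℂ[X] → 𝔸`: the curve parameter as a constant. -/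
def ψ₁ : ℂ[X] →+* 𝔸 n := (MvPolynomial.C).comp MvPolynomial.C

/-- `ℂ → 𝔸`. -/
def ψ₀ : ℂ →+* 𝔸 n := (ψ₁ (n := n)).comp Polynomial.C

/-- The UNIVERSAL line substitution `X_e ↦ x_e + V_e · s`. -/
def Λ (x : Fin n × Fin n → ℂ) : MvPolynomial (Fin n × Fin n) ℂ →+* 𝔸 n :=
  MvPolynomial.eval₂Hom ψ₀ fun e => ψ₀ (x e) + ∑ t : Fin 1, MvPolynomial.C (MvPolynomial.X e) * MvPolynomial.X t

/-- Specialisation of the middle/inner variables: `V ↦ v`, `t ↦ t`. -/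
def φ (t : ℂ) (v : Fin n × Fin n → ℂ) : MvPolynomial (Fin n × Fin n) ℂ[X] →+* ℂ :=
  MvPolynomial.eval₂Hom (Polynomial.evalRingHom t) v

theorem φ_apply (t : ℂ) (v : Fin n × Fin n → ℂ) (G : MvPolynomial (Fin n × Fin n) ℂ[X]) :
    φ t v G = MvPolynomial.eval v (MvPolynomial.map (Polynomial.evalRingHom t) G) := by
  rw [MvPolynomial.eval_map]; rfl

theorem map_φ_ψ₁ (t : ℂ) (v : Fin n × Fin n → ℂ) (g : ℂ[X]) :
    MvPolynomial.map (φ t v) (ψ₁ g) = MvPolynomial.C (g.eval t) := by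
  simp [ψ₁, φ, MvPolynomial.map_C]

theorem map_φ_ψ₀ (t : ℂ) (v : Fin n × Fin n → ℂ) (c : ℂ) :
    MvPolynomial.map (φ t v) (ψ₀ c) = MvPolynomial.C c := by
  simp [ψ₀, map_φ_ψ₁]

theorem φ_X (t : ℂ) (v : Fin n × Fin n → ℂ) (e : Fin n × Fin n) : φ t v (MvPolynomial.X e) = v e := by
  simp [φ]

/-- Specialising the universal substitution gives `lineSubst`. -/
theorem map_φ_comp_Λ (t : ℂ) (v x : Fin n × Fin n → ℂ) :
    (MvPolynomial.map (φ t v)).comp (Λ x) = (lineSubst x v : MvPolynomial (Fin n × Fin n) ℂ →+* MvPolynomial (Fin 1) ℂ) := by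
  apply MvPolynomial.ringHom_ext
  · intro c
    simp [Λ, map_φ_ψ₀, lineSubst]
  · intro e
    simp [Λ, map_φ_ψ₀, lineSubst, MvPolynomial.map_X, MvPolynomial.map_C, φ_X]

theorem map_φ_Λ (t : ℂ) (v x : Fin n × Fin n → ℂ) (P : MvPolynomial (Fin n × Fin n) ℂ) :
    MvPolynomial.map (φ t v) (Λ x P) = lineSubst x v P := by
  have := congrArg (fun h : MvPolynomial (Fin n × Fin n) ℂ →+* MvPolynomial (Fin 1) ℂ => h P) (map_φ_comp_Λ t v x)
  simpa using this

/-- The universal curve along the universal line: entries in `𝔸`. -/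
def univCurve (d : ℕ) (F : ℕ → AffMat n m) (x : Fin n × Fin n → ℂ) : Matrix (Fin m) (Fin m) (𝔸 n) :=
  ∑ i ∈ Finset.range (d + 1), (ψ₁ (n := n) (Polynomial.X ^ i)) • (F i).map (Λ x)

/-- Specialising the universal curve gives the curve member along the line. -/
theorem univCurve_map (d : ℕ) (F : ℕ → AffMat n m) (x : Fin n × Fin n → ℂ) (t : ℂ) (v : Fin n × Fin n → ℂ) :
    (univCurve d F x).map (MvPolynomial.map (φ t v)) = (curve d F t).map (lineSubst x v) := by
  refine Matrix.ext fun a b => ?_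
  simp only [univCurve, curve, Matrix.map_apply, Matrix.sum_apply, Matrix.smul_apply, smul_eq_mul, map_sum, map_mul,
    map_φ_ψ₁, map_φ_Λ, Polynomial.eval_pow, Polynomial.eval_X, MvPolynomial.smul_eq_C_mul, MvPolynomial.algHom_C,
    MvPolynomial.algebraMap_eq]

/-- The universal `s^e`-coefficient of an entry of the `(n-1)`-st power. -/
def G (d : ℕ) (F : ℕ → AffMat n m) (x : Fin n × Fin n → ℂ) (e : ℕ) (a b : Fin m) : MvPolynomial (Fin n × Fin n) ℂ[X] :=
  MvPolynomial.coeff (Finsupp.single 0 e) (((univCurve d F x) ^ (n - 1)) a b)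

/-- LEMMA U: specialising `G` computes the `s^e`-coefficient of the curve member along the line `x + s v`. -/
theorem eval_G (d : ℕ) (F : ℕ → AffMat n m) (x : Fin n × Fin n → ℂ) (e : ℕ) (a b : Fin m) (t : ℂ)
    (v : Fin n × Fin n → ℂ) :
    MvPolynomial.eval v (MvPolynomial.map (Polynomial.evalRingHom t) (G d F x e a b))
      = MvPolynomial.coeff (Finsupp.single 0 e) ((((curve d F t).map (lineSubst x v)) ^ (n - 1)) a b) := by
  rw [← φ_apply, G, ← MvPolynomial.coeff_map, ← univCurve_map, ← Matrix.map_pow, Matrix.map_apply]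

/-- Degree `≤ k` in `s` means the coefficients above `k` vanish (one variable). -/
theorem totalDegree_le_iff_coeff (P : MvPolynomial (Fin 1) ℂ) (k : ℕ) :
    P.totalDegree ≤ k ↔ ∀ e, k < e → MvPolynomial.coeff (Finsupp.single 0 e) P = 0 := by
  constructor
  · intro h e he
    by_contra hne
    have hmem : Finsupp.single (0 : Fin 1) e ∈ P.support := by simpa [MvPolynomial.mem_support_iff] using hne
    have := MvPolynomial.le_totalDegree hmem
    simp at this
    omega
  · intro h
    rw [MvPolynomial.totalDegree]
    apply Finset.sup_le
    intro s hs
    have hs' : s = Finsupp.single 0 (s 0) := Finsupp.unique_single s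
    have hle : s 0 ≤ k := by
      by_contra hlt
      push Not at hlt
      have := h (s 0) hlt
      rw [← hs'] at this
      exact (MvPolynomial.mem_support_iff.mp hs) this
    rw [hs']
    simpa using hle

/-- ★ **SLOW IS CLOSED ALONG POLYNOMIAL CURVES — ALGEBRAIC CERTIFICATE FAMILIES.**  Let `t ↦ curve d F t` be a polynomial curve of
pencils and `N ≤ (ι → ℂ[X])` an ALGEBRAIC family of directions (`ι = Fin n × Fin n`) of generic dimension `finrank ℂ[X] N > (k+1)·n`
such that, for all `t` outside a finite set, every evaluated direction `ev t p` (`p ∈ N`) is `k`-slow for `curve d F t` along every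
line.  Then the member `t = 0` is `Slow` (body of `SlowCoreLine.Slow` verbatim) with the same budget `k`.  (Part III + LEMMA U.)
NOT the pointwise `MassCut.SlowClosedAlongCurves`: that needs curve selection first (tier L). -/
theorem slow_curve_zero_of_algebraic_family (d : ℕ) (F : ℕ → AffMat n m) (k : ℕ)
    (N : Submodule ℂ[X] (Fin n × Fin n → ℂ[X])) (S : Finset ℂ)
    (hcert : ∀ t : ℂ, t ∉ S → ∀ p ∈ N, ∀ x : Fin n × Fin n → ℂ, ∀ a b : Fin m,
      ((((curve d F t).map (lineSubst x (ev t p))) ^ (n - 1)) a b).totalDegree ≤ k)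
    (hdim : (k + 1) * n < Module.finrank ℂ[X] N) :
    ∃ (K : Submodule ℂ (Fin n × Fin n → ℂ)) (k' : ℕ),
      (∀ x v : Fin n × Fin n → ℂ, v ∈ K → ∀ a b : Fin m, ((((curve d F 0).map (lineSubst x v)) ^ (n - 1)) a b).totalDegree ≤ k') ∧
      (k' + 1) * n < Module.finrank ℂ K := by
  classical
  -- the parameter set: everything off `S ∪ {0}`
  set T : Set ℂ := (↑(insert (0 : ℂ) S) : Set ℂ)ᶜ with hT
  have hTinf : T.Infinite := (Finset.finite_toSet _).infinite_compl
  have hT0 : (0 : ℂ) ∉ T := by simp [hT]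
  -- the family of universal coefficients above `k`
  set 𝓕 : Set (MvPolynomial (Fin n × Fin n) ℂ[X]) :=
    {H | ∃ x e a b, k < e ∧ H = G d F x e a b} with h𝓕
  have hS : ∀ t ∈ T, ∀ p ∈ N, ∀ H ∈ 𝓕,
      MvPolynomial.eval (ev t p) (MvPolynomial.map (Polynomial.evalRingHom t) H) = 0 := by
    intro t ht p hp H hH
    obtain ⟨x, e, a, b, he, rfl⟩ := hH
    have htS : t ∉ S := fun h => ht (by simp [h])
    rw [eval_G]
    exact (totalDegree_le_iff_coeff _ k).mp (hcert t htS p hp x a b) e he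
  obtain ⟨K₀, hK₀dim, -, hK₀⟩ := exists_limit_of_algebraic_family N 𝓕 T hTinf hT0 hS
  refine ⟨K₀, k, fun x v hv a b => ?_, by rw [hK₀dim]; exact hdim⟩
  rw [totalDegree_le_iff_coeff]
  intro e he
  rw [← eval_G d F x e a b 0 v]
  exact hK₀ v hv _ ⟨x, e, a, b, he, rfl⟩

end Summit.ValiantsHypothesis.ValiantsHypothesis.Cruxes.DualUnipotentThreeHalves.InitialForm.SlowCurve


/-! # PART VI — H_coord IN THE POWER CURRENCY: `Slow` certificates of torus-equivariant pencils may be taken weight-graded (rev 8)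

The currency of record is now `Slow` (`Theorems…SlowCoreDefs`, R2ᵖ `HeavyTopSlowLaw`).  The torus-closure argument of Part II is
currency-free: the `Slow` cone `{v | ∀ x a b, deg_s (N(x+sv)^{n-1})_{ab} ≤ k}` is cut out by the polynomial family of Part V
(`G 0 (fun _ => N) x e a b` at `t = 0`, LEMMA U) and is TORUS-STABLE for a torus-equivariant pencil, because the torus acts on the
coordinate ring by `θ : X_e ↦ τ^{w e} X_e`, `lineSubst x v ∘ θ = lineSubst (λx) (λv)`, and equivariance on points lifts to the
POLYNOMIAL identity `N.map θ = (a•D) N D'` (`MvPolynomial.funext`); conjugation by constant matrices and a nonzero scalar do not raise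
`s`-degrees of powers.  Hence `slow_graded_of_torusEquivariant` (graded certificate, same `k`, same dimension) and the monomial
count `not_slow_of_count : … → ¬ SlowCore.Slow n m N` BY NAME (Part IV's `exists_wild_coordinate`). -/

namespace Summit.ValiantsHypothesis.ValiantsHypothesis.Cruxes.DualUnipotentThreeHalves.InitialForm.SlowTorus

open Summit.ValiantsHypothesis.ValiantsHypothesis.Cruxes.TwoDimCoefficients.DimTwoCases (AffMat IsAffine)
open Summit.ValiantsHypothesis.ValiantsHypothesis.Cruxes.DualUnipotentThreeHalves.RadicalSplit (lineSubst)
open Summit.ValiantsHypothesis.ValiantsHypothesis.Cruxes.DualUnipotentThreeHalves.InitialForm.TorusClosure (TorusEquivariant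
  torusAct_inv_cancel map_eval_map_C)
open Summit.ValiantsHypothesis.ValiantsHypothesis.Cruxes.DualUnipotentThreeHalves.InitialForm.SlowCurve (curve G eval_G
  totalDegree_le_iff_coeff)

variable {n m : ℕ}

/-- The torus automorphism of the coordinate ring: `X_e ↦ τ^{w e} · X_e`. -/
def θ (w : Fin n × Fin n → ℕ) (τ : ℂ) : MvPolynomial (Fin n × Fin n) ℂ →+* MvPolynomial (Fin n × Fin n) ℂ :=
  MvPolynomial.eval₂Hom MvPolynomial.C fun e => MvPolynomial.C (τ ^ w e) * MvPolynomial.X e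

theorem eval_comp_θ (w : Fin n × Fin n → ℕ) (τ : ℂ) (y : Fin n × Fin n → ℂ) :
    (MvPolynomial.eval y).comp (θ w τ) = MvPolynomial.eval (torusAct w τ y) := by
  apply MvPolynomial.ringHom_ext
  · intro c; simp [θ]
  · intro e; simp [θ, torusAct]

theorem lineSubst_comp_θ (w : Fin n × Fin n → ℕ) (τ : ℂ) (x v : Fin n × Fin n → ℂ) :
    (lineSubst x v : MvPolynomial (Fin n × Fin n) ℂ →+* MvPolynomial (Fin 1) ℂ).comp (θ w τ)
      = (lineSubst (torusAct w τ x) (torusAct w τ v) : MvPolynomial (Fin n × Fin n) ℂ →+* MvPolynomial (Fin 1) ℂ) := by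
  apply MvPolynomial.ringHom_ext
  · intro c; simp [θ, lineSubst]
  · intro e
    simp only [θ, lineSubst, torusAct, RingHom.coe_comp, RingHom.coe_coe, Function.comp_apply, MvPolynomial.eval₂Hom_X',
      map_mul, MvPolynomial.algHom_C, MvPolynomial.aeval_X, mul_add, Finset.mul_sum, mul_assoc, MvPolynomial.algebraMap_eq]

/-- Point equivariance lifts to the POLYNOMIAL identity `N.map θ = (a • D) · N · D'` (constants embedded by `C`). -/
theorem map_θ_eq (N : AffMat n m) {w : Fin n × Fin n → ℕ} {τ : ℂ} {a : ℂ} {D D' : Matrix (Fin m) (Fin m) ℂ}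
    (hconj : ∀ x, N.map (MvPolynomial.eval (torusAct w τ x)) = a • (D * N.map (MvPolynomial.eval x) * D')) :
    N.map (θ w τ) = (a • D).map MvPolynomial.C * N * D'.map MvPolynomial.C := by
  have key : ∀ y : Fin n × Fin n → ℂ, (N.map (θ w τ)).map (MvPolynomial.eval y)
      = ((a • D).map MvPolynomial.C * N * D'.map MvPolynomial.C).map (MvPolynomial.eval y) := by
    intro y
    have hc : (⇑(MvPolynomial.eval y) ∘ ⇑(θ w τ) : MvPolynomial (Fin n × Fin n) ℂ → ℂ)
        = ⇑(MvPolynomial.eval (torusAct w τ y)) := by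
      have := congrArg DFunLike.coe (eval_comp_θ w τ y)
      simpa using this
    rw [Matrix.map_map, hc, hconj y, Matrix.map_mul, Matrix.map_mul, map_eval_map_C, map_eval_map_C, Matrix.smul_mul,
      Matrix.smul_mul]
  refine Matrix.ext fun i j => MvPolynomial.funext fun y => ?_
  have := congrFun (congrFun (key y) i) j
  simpa only [Matrix.map_apply] using this

/-- `C`-embedded constants pass through `lineSubst`. -/
theorem map_C_map_lineSubst (X : Matrix (Fin m) (Fin m) ℂ) (x v : Fin n × Fin n → ℂ) :
    (X.map (MvPolynomial.C : ℂ → MvPolynomial (Fin n × Fin n) ℂ)).map (lineSubst x v)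
      = X.map (MvPolynomial.C : ℂ → MvPolynomial (Fin 1) ℂ) := by
  ext i j : 1
  · simp [Matrix.map_apply, MvPolynomial.algHom_C]

/-- ★ The line polynomial at a torus-moved direction is a constant conjugate (times a nonzero scalar) of the line polynomial at the
original direction over the torus-moved base point. -/
theorem map_lineSubst_torusAct (N : AffMat n m) {w : Fin n × Fin n → ℕ} {τ : ℂ} {a : ℂ} {D D' : Matrix (Fin m) (Fin m) ℂ}
    (hconj : ∀ x, N.map (MvPolynomial.eval (torusAct w τ x)) = a • (D * N.map (MvPolynomial.eval x) * D'))
    (x v : Fin n × Fin n → ℂ) :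
    N.map (lineSubst (torusAct w τ x) (torusAct w τ v))
      = a • (D.map MvPolynomial.C * N.map (lineSubst x v) * D'.map MvPolynomial.C) := by
  have hc : (⇑(lineSubst x v) ∘ ⇑(θ w τ) : MvPolynomial (Fin n × Fin n) ℂ → MvPolynomial (Fin 1) ℂ)
      = ⇑(lineSubst (torusAct w τ x) (torusAct w τ v)) := by
    have := congrArg DFunLike.coe (lineSubst_comp_θ w τ x v)
    simpa using this
  have h1 : N.map (lineSubst (torusAct w τ x) (torusAct w τ v)) = (N.map (θ w τ)).map (lineSubst x v) := by
    rw [Matrix.map_map, hc]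
  have h2 : ((a • D).map MvPolynomial.C * N * D'.map MvPolynomial.C).map (lineSubst x v)
      = (a • D).map (MvPolynomial.C : ℂ → MvPolynomial (Fin 1) ℂ) * N.map (lineSubst x v)
          * D'.map (MvPolynomial.C : ℂ → MvPolynomial (Fin 1) ℂ) := by
    have e1 := map_mul (lineSubst x v).toRingHom.mapMatrix ((a • D).map MvPolynomial.C * N) (D'.map MvPolynomial.C)
    have e2 := map_mul (lineSubst x v).toRingHom.mapMatrix ((a • D).map MvPolynomial.C) N
    rw [e2] at e1
    simp only [RingHom.mapMatrix_apply] at e1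
    have e1' : ((a • D).map MvPolynomial.C * N * D'.map MvPolynomial.C).map (lineSubst x v)
        = ((a • D).map MvPolynomial.C).map (lineSubst x v) * N.map (lineSubst x v)
            * (D'.map MvPolynomial.C).map (lineSubst x v) := e1
    rw [e1', map_C_map_lineSubst, map_C_map_lineSubst]
  have h3 : (a • D).map (MvPolynomial.C : ℂ → MvPolynomial (Fin 1) ℂ) = a • D.map (MvPolynomial.C : ℂ → MvPolynomial (Fin 1) ℂ) := by
    ext i j : 1
    · simp [Matrix.map_apply, MvPolynomial.smul_eq_C_mul]
  rw [h1, map_θ_eq N hconj, h2, h3, Matrix.smul_mul, Matrix.smul_mul]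

/-- Powers of a constant conjugate. -/
theorem conj_pow {R : Type*} [CommRing R] (E E' Q : Matrix (Fin m) (Fin m) R) (hE'E : E' * E = 1) (b : ℕ) :
    (E * Q * E') ^ b = E * Q ^ b * E' ∨ b = 0 := by
  induction b with
  | zero => exact Or.inr rfl
  | succ b ih =>
    left
    rcases ih with ih | ih
    · rw [pow_succ, ih, pow_succ]
      simp only [Matrix.mul_assoc]
      rw [← Matrix.mul_assoc E' E, hE'E, Matrix.one_mul]
    · subst ih; simp

/-- Constant conjugation and scalars do not raise `s`-degrees. -/
theorem totalDegree_conj_le (D D' : Matrix (Fin m) (Fin m) ℂ) (a : ℂ) (M : Matrix (Fin m) (Fin m) (MvPolynomial (Fin 1) ℂ))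
    {k : ℕ} (hM : ∀ c d, (M c d).totalDegree ≤ k) (i j : Fin m) :
    ((a • (D.map MvPolynomial.C * M * D'.map MvPolynomial.C) : Matrix (Fin m) (Fin m) (MvPolynomial (Fin 1) ℂ)) i j).totalDegree
      ≤ k := by
  rw [Matrix.smul_apply]
  refine (MvPolynomial.totalDegree_smul_le _ _).trans ?_
  rw [Matrix.mul_apply]
  refine (MvPolynomial.totalDegree_finsetSum _ _).trans (Finset.sup_le fun d _ => ?_)
  refine (MvPolynomial.totalDegree_mul _ _).trans ?_
  rw [Matrix.map_apply, MvPolynomial.totalDegree_C, add_zero, Matrix.mul_apply]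
  refine (MvPolynomial.totalDegree_finsetSum _ _).trans (Finset.sup_le fun c _ => ?_)
  refine (MvPolynomial.totalDegree_mul _ _).trans ?_
  rw [Matrix.map_apply, MvPolynomial.totalDegree_C, zero_add]
  exact hM c d

/-- ★ **The `Slow` cone of a torus-equivariant pencil is torus-stable.** -/
theorem slowCone_torusAct (N : AffMat n m) {w : Fin n × Fin n → ℕ} (hT : TorusEquivariant N w) {k : ℕ}
    {v : Fin n × Fin n → ℂ} (hv : ∀ x : Fin n × Fin n → ℂ, ∀ a b : Fin m, ((((N.map (lineSubst x v)) ^ (n - 1)) a b)).totalDegree ≤ k)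
    {τ : ℂ} (hτ : τ ≠ 0) (x : Fin n × Fin n → ℂ) (a b : Fin m) :
    ((((N.map (lineSubst x (torusAct w τ v))) ^ (n - 1)) a b)).totalDegree ≤ k := by
  obtain ⟨c, D, D', hc, -, hD'D, hconj⟩ := hT τ hτ
  set x' := torusAct w τ⁻¹ x with hx'
  have hx : x = torusAct w τ x' := (torusAct_inv_cancel w hτ x).symm
  rw [hx, map_lineSubst_torusAct N hconj x' v, smul_pow]
  have hE'E : D'.map (MvPolynomial.C : ℂ → MvPolynomial (Fin 1) ℂ) * D.map MvPolynomial.C = 1 := by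
    rw [← Matrix.map_mul, hD'D, Matrix.map_one MvPolynomial.C (map_zero _) (map_one _)]
  rcases conj_pow (D.map MvPolynomial.C) (D'.map MvPolynomial.C) (N.map (lineSubst x' v)) hE'E (n - 1) with h | h
  · rw [h]
    exact totalDegree_conj_le D D' (c ^ (n - 1)) _ (fun i j => hv x' i j) a b
  · rw [h, pow_zero, pow_zero, one_smul, Matrix.one_apply]
    split_ifs <;> simp

/-- `curve 0 (fun _ => N) 0 = N`. -/
theorem curve_const_zero (N : AffMat n m) : curve 0 (fun _ => N) 0 = N := by
  simp [curve]

/-- The `Slow` cone is cut out by the polynomial family `{(G 0 (fun _ => N) x e a b)|_{t=0} : k < e}`. -/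
def slowFamily (N : AffMat n m) (k : ℕ) : Set (MvPolynomial (Fin n × Fin n) ℂ) :=
  {H | ∃ (x : Fin n × Fin n → ℂ) (e : ℕ) (a b : Fin m), k < e ∧
    H = MvPolynomial.map (Polynomial.evalRingHom 0) (G 0 (fun _ => N) x e a b)}

theorem slowCone_iff_family (N : AffMat n m) (k : ℕ) (v : Fin n × Fin n → ℂ) :
    (∀ x : Fin n × Fin n → ℂ, ∀ a b : Fin m, ((((N.map (lineSubst x v)) ^ (n - 1)) a b)).totalDegree ≤ k)
      ↔ ∀ H ∈ slowFamily N k, MvPolynomial.eval v H = 0 := by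
  constructor
  · rintro h H ⟨x, e, a, b, he, rfl⟩
    rw [eval_G, curve_const_zero]
    exact (totalDegree_le_iff_coeff _ k).mp (h x a b) e he
  · intro h x a b
    rw [totalDegree_le_iff_coeff]
    intro e he
    have := h _ ⟨x, e, a, b, he, rfl⟩
    rwa [eval_G, curve_const_zero] at this

/-- ★ **H_coord IN THE POWER CURRENCY.**  A `Slow` certificate `(K, k)` of a torus-equivariant affine pencil can be replaced by a
WEIGHT-GRADED one of the same dimension and the same `k`. -/
theorem slow_graded_of_torusEquivariant (N : AffMat n m) (w : Fin n × Fin n → ℕ) (hT : TorusEquivariant N w)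
    (K : Submodule ℂ (Fin n × Fin n → ℂ)) (k : ℕ)
    (hK : ∀ x v : Fin n × Fin n → ℂ, v ∈ K → ∀ a b : Fin m, ((((N.map (lineSubst x v)) ^ (n - 1)) a b)).totalDegree ≤ k) :
    ∃ K₀ : Submodule ℂ (Fin n × Fin n → ℂ), Module.finrank ℂ K₀ = Module.finrank ℂ K ∧
      (∀ s ∈ K₀, ∀ c, wtProj w c s ∈ K₀) ∧
      ∀ x v : Fin n × Fin n → ℂ, v ∈ K₀ → ∀ a b : Fin m, ((((N.map (lineSubst x v)) ^ (n - 1)) a b)).totalDegree ≤ k := by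
  have hstab : ∀ τ : ℂ, τ ≠ 0 → ∀ v ∈ K, ∀ H ∈ slowFamily N k, MvPolynomial.eval (torusAct w τ v) H = 0 := by
    intro τ hτ v hv
    rw [← slowCone_iff_family]
    exact fun x a b => slowCone_torusAct N hT (fun x a b => hK x v hv a b) hτ x a b
  obtain ⟨K₀, hdim, hgr, hZ⟩ := exists_graded_of_torusStable w K (slowFamily N k) hstab
  exact ⟨K₀, hdim, hgr, fun x v hv a b => ((slowCone_iff_family N k v).mpr (hZ v hv)) x a b⟩

/-- ★ **MONOMIAL COUNT, POWER CURRENCY — `¬ Slow` BY NAME.**  For a torus-equivariant affine pencil whose coordinates off `Z` have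
singleton weight classes: if for every budget `k` (`k + 2 ≤ n`) the number of coordinates `e ∉ Z` whose coordinate direction `δ_e` is
`k`-slow along every line, plus `#Z`, is at most `(k+1)·n`, then `N` is NOT `Slow` (`Theorems…SlowCore.Slow`, the body of S3/R2ᵖ). -/
theorem not_slow_of_count (N : AffMat n m) (w : Fin n × Fin n → ℕ) (hT : TorusEquivariant N w)
    (Z : Finset (Fin n × Fin n)) (hZ : ∀ e, e ∉ Z → ∀ e', w e' = w e → e' = e)
    (hcount : ∀ k : ℕ, k + 2 ≤ n →
      (open Classical in (Finset.univ.filter fun e => e ∉ Z ∧ ∀ x : Fin n × Fin n → ℂ, ∀ a b : Fin m,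
        ((((N.map (lineSubst x (Pi.single e (1 : ℂ)))) ^ (n - 1)) a b)).totalDegree ≤ k).card) + Z.card ≤ (k + 1) * n) :
    ¬ Summit.ValiantsHypothesis.ValiantsHypothesis.Theorems.GrenetZeon.SlowCore.Slow n m N := by
  classical
  rintro ⟨K, k, hK, hdim⟩
  have hkn : k + 2 ≤ n := by
    have h1 : Module.finrank ℂ K ≤ n * n := by
      have := Submodule.finrank_le K
      simpa [Module.finrank_fintype_fun_eq_card, Fintype.card_prod, Fintype.card_fin] using this
    have h2 : (k + 1) * n < n * n := lt_of_lt_of_le hdim h1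
    have := Nat.lt_of_mul_lt_mul_right h2
    omega
  obtain ⟨K₀, hdim₀, hgr, hK₀⟩ := slow_graded_of_torusEquivariant N w hT K k hK
  obtain ⟨e, -, hTame, hmem⟩ := exists_wild_coordinate w Z hZ
    (fun e => ∀ x : Fin n × Fin n → ℂ, ∀ a b : Fin m,
      ((((N.map (lineSubst x (Pi.single e (1 : ℂ)))) ^ (n - 1)) a b)).totalDegree ≤ k)
    K₀ hgr (by have := hcount k hkn; omega)
  exact hTame fun x a b => hK₀ x _ hmem a b

/-- Part V's conclusion BY NAME: along a polynomial curve, an algebraic `k`-slow family of generic dimension `> (k+1)·n` makes the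
member `t = 0` `Slow` in the sense of `Theorems…SlowCore.Slow`. -/
theorem slow_curve_zero_byName (d : ℕ) (F : ℕ → AffMat n m) (k : ℕ)
    (N : Submodule (Polynomial ℂ) (Fin n × Fin n → Polynomial ℂ)) (S : Finset ℂ)
    (hcert : ∀ t : ℂ, t ∉ S → ∀ p ∈ N, ∀ x : Fin n × Fin n → ℂ, ∀ a b : Fin m,
      ((((curve d F t).map (lineSubst x (CurveClosure.ev t p))) ^ (n - 1)) a b).totalDegree ≤ k)
    (hdim : (k + 1) * n < Module.finrank (Polynomial ℂ) N) :
    Summit.ValiantsHypothesis.ValiantsHypothesis.Theorems.GrenetZeon.SlowCore.Slow n m (curve d F 0) :=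
  SlowCurve.slow_curve_zero_of_algebraic_family d F k N S hcert hdim

/-- Coordinate vectors indexed by a finset are linearly independent, so their span has dimension `#T`. -/
theorem finrank_span_single (T : Finset (Fin n × Fin n)) :
    Module.finrank ℂ (Submodule.span ℂ (Set.range fun e : T => (Pi.single (e : Fin n × Fin n) (1 : ℂ) : Fin n × Fin n → ℂ)))
      = T.card := by
  have hli : LinearIndependent ℂ (fun e : T => (Pi.single (e : Fin n × Fin n) (1 : ℂ) : Fin n × Fin n → ℂ)) := by
    have := (Pi.basisFun ℂ (Fin n × Fin n)).linearIndependent.comp (fun e : T => (e : Fin n × Fin n)) Subtype.coe_injective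
    convert this using 1
    funext e; simp
  rw [finrank_span_eq_card hli, Fintype.card_coe]

/-- ★ **EXACT CHARACTERISATION (by name).**  For a torus-equivariant affine pencil all of whose coordinates have DISTINCT weights,
`Slow` holds iff some coordinate SET `T` with `#T > (k+1)·n` spans a subspace inside the `k`-slow cone.  (Only ⟹ is non-trivial: the
graded certificate of `slow_graded_of_torusEquivariant` is the span of the coordinate vectors it contains.  The per-coordinate census
`not_slow_of_count` is the contrapositive of the weaker consequence `#{e | δ_e is k-slow} ≥ #T`; tameness of each `δ_e` separately does NOT
give `Slow` — the cone is not a subspace.) -/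
theorem slow_iff_coordinate_span (N : AffMat n m) (w : Fin n × Fin n → ℕ) (hT : TorusEquivariant N w) (hw : Function.Injective w) :
    Summit.ValiantsHypothesis.ValiantsHypothesis.Theorems.GrenetZeon.SlowCore.Slow n m N ↔
      ∃ (k : ℕ) (T : Finset (Fin n × Fin n)), (k + 1) * n < T.card ∧
        ∀ x v : Fin n × Fin n → ℂ,
          v ∈ Submodule.span ℂ (Set.range fun e : T => (Pi.single (e : Fin n × Fin n) (1 : ℂ) : Fin n × Fin n → ℂ)) →
          ∀ a b : Fin m, ((((N.map (lineSubst x v)) ^ (n - 1)) a b)).totalDegree ≤ k := by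
  classical
  constructor
  · rintro ⟨K, k, hK, hdim⟩
    obtain ⟨K₀, hdim₀, hgr, hK₀⟩ := slow_graded_of_torusEquivariant N w hT K k hK
    set T : Finset (Fin n × Fin n) := Finset.univ.filter fun e => (Pi.single e (1 : ℂ) : Fin n × Fin n → ℂ) ∈ K₀ with hTdef
    set Sp := Submodule.span ℂ (Set.range fun e : T => (Pi.single (e : Fin n × Fin n) (1 : ℂ) : Fin n × Fin n → ℂ)) with hSp
    have hZ : ∀ e, e ∉ (∅ : Finset (Fin n × Fin n)) → ∀ e', w e' = w e → e' = e := fun e _ e' h => hw h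
    -- the graded certificate is spanned by the coordinate vectors it contains
    have hle : K₀ ≤ Sp := by
      intro s hs
      have hsum : s = ∑ e, s e • (Pi.single e (1 : ℂ) : Fin n × Fin n → ℂ) := by
        conv_lhs => rw [← Finset.univ_sum_single s]
        refine Finset.sum_congr rfl fun e _ => ?_
        funext e'
        by_cases h : e' = e
        · subst h; simp
        · simp [h]
      rw [hsum]
      refine Submodule.sum_mem _ fun e _ => ?_
      by_cases hse : s e = 0
      · rw [hse, zero_smul]; exact Submodule.zero_mem _
      · have hmem : (Pi.single e (1 : ℂ) : Fin n × Fin n → ℂ) ∈ K₀ := by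
          have h1 := hgr s hs (w e)
          rw [wtProj_eq_single w ∅ hZ (Finset.notMem_empty e) s] at h1
          have h2 := K₀.smul_mem (s e)⁻¹ h1
          rwa [smul_smul, inv_mul_cancel₀ hse, one_smul] at h2
        have heT : e ∈ T := by rw [hTdef, Finset.mem_filter]; exact ⟨Finset.mem_univ _, hmem⟩
        exact Submodule.smul_mem _ _ (Submodule.subset_span ⟨⟨e, heT⟩, rfl⟩)
    have hge : Sp ≤ K₀ := by
      rw [hSp, Submodule.span_le]
      rintro _ ⟨⟨e, he⟩, rfl⟩
      rw [hTdef, Finset.mem_filter] at he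
      exact he.2
    refine ⟨k, T, ?_, fun x v hv a b => hK₀ x v (hge hv) a b⟩
    have h1 : Module.finrank ℂ K₀ ≤ Module.finrank ℂ Sp := Submodule.finrank_mono hle
    rw [hSp, finrank_span_single] at h1
    omega
  · rintro ⟨k, T, hcard, hcone⟩
    exact ⟨_, k, fun x v hv a b => hcone x v hv a b, by rw [finrank_span_single]; exact hcard⟩

end Summit.ValiantsHypothesis.ValiantsHypothesis.Cruxes.DualUnipotentThreeHalves.InitialForm.SlowTorus

/-! # PART VII — THE LEDGER / `RelCert` CURRENCY OF (c) `LongMassSlowLawInv` (rev 10)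

The ONE research stub of the line of record (`Lines/slow_core.lean` rev 3) is (c-Inv) `SlowCore.LongMassSlowLawInv`: every `IrreducibleInv`
nilpotent affine pencil has a `RelCert` of price `≤ c·√n·b`, where `RelCert n m N P := ∃ K k, Ledger n m N ⊤ K k ∧ n·k + (n² − finrank K) ≤ P`
and `Ledger` bounds the `s`-degree of EVERY power `b ≤ n − 1` (window currency).  Same shape as `Slow`, so Parts I/IV/VI transfer verbatim with a
power parameter: `Gp` / `eval_Gp` (universal coefficients of the `p`-th power), `ledgerCone_torusAct`, `ledger_graded_of_torusEquivariant`,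
★ `relCert_iff_coordinate_span` (distinct weights: `RelCert N P` iff some coordinate set `T` with `n·k + (n² − #T) ≤ P` spans a subspace inside the
window cone) and the census ★ `not_relCert_of_count` — BY NAME against `Theorems…SlowCoreLedger`.  USE (closure lever (C1)–(C3) in (c)'s
currency): a torus-equivariant candidate enemy of (c) is priced by a per-coordinate window-degree census.  Nothing here bears on the truth of (c). -/

namespace Summit.ValiantsHypothesis.ValiantsHypothesis.Cruxes.DualUnipotentThreeHalves.InitialForm.LedgerTorus

open scoped Polynomial
open Summit.ValiantsHypothesis.ValiantsHypothesis.Cruxes.TwoDimCoefficients.DimTwoCases (AffMat IsAffine)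
open Summit.ValiantsHypothesis.ValiantsHypothesis.Cruxes.DualUnipotentThreeHalves.RadicalSplit (lineSubst)
open Summit.ValiantsHypothesis.ValiantsHypothesis.Cruxes.DualUnipotentThreeHalves.InitialForm.TorusClosure (TorusEquivariant
  torusAct_inv_cancel)
open Summit.ValiantsHypothesis.ValiantsHypothesis.Cruxes.DualUnipotentThreeHalves.InitialForm.SlowCurve (curve univCurve univCurve_map φ φ_apply
  totalDegree_le_iff_coeff)
open Summit.ValiantsHypothesis.ValiantsHypothesis.Cruxes.DualUnipotentThreeHalves.InitialForm.SlowTorus (map_lineSubst_torusAct conj_pow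
  totalDegree_conj_le curve_const_zero finrank_span_single)
open Summit.ValiantsHypothesis.ValiantsHypothesis.Theorems.GrenetZeon.SlowCore (Ledger RelCert)

variable {n m : ℕ}

/-- Universal `s^e`-coefficient of an entry of the `p`-th power along the universal line (Part V's `G` is `p = n − 1`). -/
def Gp (d : ℕ) (F : ℕ → AffMat n m) (x : Fin n × Fin n → ℂ) (p e : ℕ) (a b : Fin m) : MvPolynomial (Fin n × Fin n) ℂ[X] :=
  MvPolynomial.coeff (Finsupp.single 0 e) (((univCurve d F x) ^ p) a b)

theorem eval_Gp (d : ℕ) (F : ℕ → AffMat n m) (x : Fin n × Fin n → ℂ) (p e : ℕ) (a b : Fin m) (t : ℂ) (v : Fin n × Fin n → ℂ) :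
    MvPolynomial.eval v (MvPolynomial.map (Polynomial.evalRingHom t) (Gp d F x p e a b))
      = MvPolynomial.coeff (Finsupp.single 0 e) ((((curve d F t).map (lineSubst x v)) ^ p) a b) := by
  rw [← φ_apply, Gp, ← MvPolynomial.coeff_map, ← univCurve_map, ← Matrix.map_pow, Matrix.map_apply]

/-- The WINDOW cone: every power `b ≤ n − 1` along every line has `s`-degree `≤ k` (the body of `Ledger ⊤ · k` for one direction). -/
def WindowCone (N : AffMat n m) (k : ℕ) (v : Fin n × Fin n → ℂ) : Prop :=
  ∀ x : Fin n × Fin n → ℂ, ∀ b : ℕ, b ≤ n - 1 → ∀ i j : Fin m, ((((N.map (lineSubst x v)) ^ b) i j)).totalDegree ≤ k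

theorem ledger_top_iff_windowCone (N : AffMat n m) (K : Submodule ℂ (Fin n × Fin n → ℂ)) (k : ℕ) :
    Ledger n m N (fun _ => True) K k ↔ ∀ v ∈ K, WindowCone N k v :=
  ⟨fun h v hv x b hb i j => h x v hv b hb i j trivial trivial, fun h x v hv b hb i j _ _ => h v hv x b hb i j⟩

/-- ★ The window cone of a torus-equivariant pencil is torus-stable. -/
theorem windowCone_torusAct (N : AffMat n m) {w : Fin n × Fin n → ℕ} (hT : TorusEquivariant N w) {k : ℕ}
    {v : Fin n × Fin n → ℂ} (hv : WindowCone N k v) {τ : ℂ} (hτ : τ ≠ 0) : WindowCone N k (torusAct w τ v) := by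
  intro x b hb i j
  obtain ⟨c, D, D', hc, -, hD'D, hconj⟩ := hT τ hτ
  set x' := torusAct w τ⁻¹ x with hx'
  have hx : x = torusAct w τ x' := (torusAct_inv_cancel w hτ x).symm
  rw [hx, map_lineSubst_torusAct N hconj x' v, smul_pow]
  have hE'E : D'.map (MvPolynomial.C : ℂ → MvPolynomial (Fin 1) ℂ) * D.map MvPolynomial.C = 1 := by
    rw [← Matrix.map_mul, hD'D, Matrix.map_one MvPolynomial.C (map_zero _) (map_one _)]
  rcases conj_pow (D.map MvPolynomial.C) (D'.map MvPolynomial.C) (N.map (lineSubst x' v)) hE'E b with h | h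
  · rw [h]
    exact totalDegree_conj_le D D' (c ^ b) _ (fun i j => hv x' b hb i j) i j
  · rw [h, pow_zero, pow_zero, one_smul, Matrix.one_apply]
    split_ifs <;> simp

/-- The polynomial family cutting out the window cone. -/
def windowFamily (N : AffMat n m) (k : ℕ) : Set (MvPolynomial (Fin n × Fin n) ℂ) :=
  {H | ∃ (x : Fin n × Fin n → ℂ) (p e : ℕ) (a b : Fin m), p ≤ n - 1 ∧ k < e ∧
    H = MvPolynomial.map (Polynomial.evalRingHom 0) (Gp 0 (fun _ => N) x p e a b)}

theorem windowCone_iff_family (N : AffMat n m) (k : ℕ) (v : Fin n × Fin n → ℂ) :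
    WindowCone N k v ↔ ∀ H ∈ windowFamily N k, MvPolynomial.eval v H = 0 := by
  constructor
  · rintro h H ⟨x, p, e, a, b, hp, he, rfl⟩
    rw [eval_Gp, curve_const_zero]
    exact (totalDegree_le_iff_coeff _ k).mp (h x p hp a b) e he
  · intro h x p hp a b
    rw [totalDegree_le_iff_coeff]
    intro e he
    have := h _ ⟨x, p, e, a, b, hp, he, rfl⟩
    rwa [eval_Gp, curve_const_zero] at this

/-- ★ **H_coord IN THE LEDGER CURRENCY.**  A whole-pencil ledger `(K, k)` of a torus-equivariant affine pencil may be taken WEIGHT-GRADED, same `k`,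
same finrank (hence same PRICE). -/
theorem ledger_graded_of_torusEquivariant (N : AffMat n m) (w : Fin n × Fin n → ℕ) (hT : TorusEquivariant N w)
    (K : Submodule ℂ (Fin n × Fin n → ℂ)) (k : ℕ) (hK : Ledger n m N (fun _ => True) K k) :
    ∃ K₀ : Submodule ℂ (Fin n × Fin n → ℂ), Module.finrank ℂ K₀ = Module.finrank ℂ K ∧
      (∀ s ∈ K₀, ∀ c, wtProj w c s ∈ K₀) ∧ Ledger n m N (fun _ => True) K₀ k := by
  rw [ledger_top_iff_windowCone] at hK
  have hstab : ∀ τ : ℂ, τ ≠ 0 → ∀ v ∈ K, ∀ H ∈ windowFamily N k, MvPolynomial.eval (torusAct w τ v) H = 0 := by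
    intro τ hτ v hv
    rw [← windowCone_iff_family]
    exact windowCone_torusAct N hT (hK v hv) hτ
  obtain ⟨K₀, hdim, hgr, hZ⟩ := exists_graded_of_torusStable w K (windowFamily N k) hstab
  refine ⟨K₀, hdim, hgr, ?_⟩
  rw [ledger_top_iff_windowCone]
  exact fun v hv => (windowCone_iff_family N k v).mpr (hZ v hv)

/-- ★ **EXACT CHARACTERISATION OF `RelCert` (by name), distinct coordinate weights.**  `RelCert n m N P` iff some coordinate SET `T` with
`n·k + (n² − #T) ≤ P` spans a subspace on which the whole-pencil ledger of order `k` holds. -/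
theorem relCert_iff_coordinate_span (N : AffMat n m) (w : Fin n × Fin n → ℕ) (hT : TorusEquivariant N w) (hw : Function.Injective w)
    (P : ℕ) :
    RelCert n m N P ↔ ∃ (k : ℕ) (T : Finset (Fin n × Fin n)), n * k + (n * n - T.card) ≤ P ∧
      Ledger n m N (fun _ => True)
        (Submodule.span ℂ (Set.range fun e : T => (Pi.single (e : Fin n × Fin n) (1 : ℂ) : Fin n × Fin n → ℂ))) k := by
  classical
  constructor
  · rintro ⟨K, k, hK, hprice⟩
    obtain ⟨K₀, hdim₀, hgr, hK₀⟩ := ledger_graded_of_torusEquivariant N w hT K k hK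
    set T : Finset (Fin n × Fin n) := Finset.univ.filter fun e => (Pi.single e (1 : ℂ) : Fin n × Fin n → ℂ) ∈ K₀ with hTdef
    set Sp := Submodule.span ℂ (Set.range fun e : T => (Pi.single (e : Fin n × Fin n) (1 : ℂ) : Fin n × Fin n → ℂ)) with hSp
    have hZ : ∀ e, e ∉ (∅ : Finset (Fin n × Fin n)) → ∀ e', w e' = w e → e' = e := fun e _ e' h => hw h
    have hle : K₀ ≤ Sp := by
      intro s hs
      have hsum : s = ∑ e, s e • (Pi.single e (1 : ℂ) : Fin n × Fin n → ℂ) := by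
        conv_lhs => rw [← Finset.univ_sum_single s]
        refine Finset.sum_congr rfl fun e _ => ?_
        funext e'
        by_cases h : e' = e
        · subst h; simp
        · simp [h]
      rw [hsum]
      refine Submodule.sum_mem _ fun e _ => ?_
      by_cases hse : s e = 0
      · rw [hse, zero_smul]; exact Submodule.zero_mem _
      · have hmem : (Pi.single e (1 : ℂ) : Fin n × Fin n → ℂ) ∈ K₀ := by
          have h1 := hgr s hs (w e)
          rw [wtProj_eq_single w ∅ hZ (Finset.notMem_empty e) s] at h1
          have h2 := K₀.smul_mem (s e)⁻¹ h1
          rwa [smul_smul, inv_mul_cancel₀ hse, one_smul] at h2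
        have heT : e ∈ T := by rw [hTdef, Finset.mem_filter]; exact ⟨Finset.mem_univ _, hmem⟩
        exact Submodule.smul_mem _ _ (Submodule.subset_span ⟨⟨e, heT⟩, rfl⟩)
    have hge : Sp ≤ K₀ := by
      rw [hSp, Submodule.span_le]
      rintro _ ⟨⟨e, he⟩, rfl⟩
      rw [hTdef, Finset.mem_filter] at he
      exact he.2
    have heq : Sp = K₀ := le_antisymm hge hle
    refine ⟨k, T, ?_, ?_⟩
    · have h1 : Module.finrank ℂ Sp = T.card := by rw [hSp, finrank_span_single]
      rw [heq, hdim₀] at h1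
      rw [← h1]; exact hprice
    · exact (ledger_top_iff_windowCone _ _ _).mpr fun v hv => (ledger_top_iff_windowCone _ _ _).mp hK₀ v (hge hv)
  · rintro ⟨k, T, hprice, hL⟩
    exact ⟨_, k, hL, by rw [finrank_span_single]; exact hprice⟩

/-- ★ **CENSUS KILL IN (c)'s CURRENCY.**  For a torus-equivariant affine pencil with distinct coordinate weights: if for every order `k` the price
computed from the NUMBER of coordinates `e` whose coordinate direction `δ_e` lies in the window cone of order `k` already exceeds `P`, then
`¬ RelCert n m N P`.  (The coordinate set `T` of `relCert_iff_coordinate_span` consists of such `e`.) -/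
theorem not_relCert_of_count (N : AffMat n m) (w : Fin n × Fin n → ℕ) (hT : TorusEquivariant N w) (hw : Function.Injective w) (P : ℕ)
    (hcount : ∀ k : ℕ,
      P < n * k + (n * n - (open Classical in (Finset.univ.filter fun e : Fin n × Fin n =>
        WindowCone N k (Pi.single e (1 : ℂ))).card))) :
    ¬ RelCert n m N P := by
  classical
  rw [relCert_iff_coordinate_span N w hT hw P]
  rintro ⟨k, T, hprice, hL⟩
  rw [ledger_top_iff_windowCone] at hL
  have hsub : T ⊆ Finset.univ.filter fun e : Fin n × Fin n => WindowCone N k (Pi.single e (1 : ℂ)) := by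
    intro e he
    rw [Finset.mem_filter]
    exact ⟨Finset.mem_univ _, hL _ (Submodule.subset_span ⟨⟨e, he⟩, rfl⟩)⟩
  have hcard := Finset.card_le_card hsub
  have := hcount k
  omega


/-- ★ **`RelCert` ALONG POLYNOMIAL CURVES — ALGEBRAIC LEDGER FAMILIES** (Part V in (c)'s currency).  Along `curve d F`, an ALGEBRAIC family
`N ≤ (ι → ℂ[X])` of directions whose evaluations satisfy the whole-pencil window condition of order `k` for all `t` off a finite set passes to
`t = 0` with the same `k` and the generic rank, hence with the same PRICE: `RelCert n m (curve d F 0) P` whenever `n·k + (n² − rank N) ≤ P`.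
(Kernel half of «RelCert-holders are closed» through ONE canonical move; the pointwise statement needs curve selection.) -/
theorem relCert_curve_zero_of_algebraic_family (d : ℕ) (F : ℕ → AffMat n m) (k P : ℕ)
    (N : Submodule ℂ[X] (Fin n × Fin n → ℂ[X])) (S : Finset ℂ)
    (hcert : ∀ t : ℂ, t ∉ S → ∀ p ∈ N, WindowCone (curve d F t) k (CurveClosure.ev t p))
    (hprice : n * k + (n * n - Module.finrank ℂ[X] N) ≤ P) :
    RelCert n m (curve d F 0) P := by
  classical
  set T : Set ℂ := (↑(insert (0 : ℂ) S) : Set ℂ)ᶜ with hT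
  have hTinf : T.Infinite := (Finset.finite_toSet _).infinite_compl
  have hT0 : (0 : ℂ) ∉ T := by simp [hT]
  set 𝓕 : Set (MvPolynomial (Fin n × Fin n) ℂ[X]) :=
    {H | ∃ x p e a b, p ≤ n - 1 ∧ k < e ∧ H = Gp d F x p e a b} with h𝓕
  have hS : ∀ t ∈ T, ∀ q ∈ N, ∀ H ∈ 𝓕,
      MvPolynomial.eval (CurveClosure.ev t q) (MvPolynomial.map (Polynomial.evalRingHom t) H) = 0 := by
    intro t ht q hq H hH
    obtain ⟨x, p, e, a, b, hp, he, rfl⟩ := hH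
    have htS : t ∉ S := fun h => ht (by simp [h])
    rw [eval_Gp]
    exact (totalDegree_le_iff_coeff _ k).mp (hcert t htS q hq x p hp a b) e he
  obtain ⟨K₀, hK₀dim, -, hK₀⟩ := CurveClosure.exists_limit_of_algebraic_family N 𝓕 T hTinf hT0 hS
  refine ⟨K₀, k, ?_, by rw [hK₀dim]; exact hprice⟩
  rw [ledger_top_iff_windowCone]
  intro v hv x p hp a b
  rw [totalDegree_le_iff_coeff]
  intro e he
  rw [← eval_Gp d F x p e a b 0 v]
  exact hK₀ v hv _ ⟨x, p, e, a, b, hp, he, rfl⟩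

end Summit.ValiantsHypothesis.ValiantsHypothesis.Cruxes.DualUnipotentThreeHalves.InitialForm.LedgerTorus


/-! # PART VIII — UNIPOTENT CLOSURE: certificates may be taken stable under a unipotent symmetry -/

namespace Summit.ValiantsHypothesis.ValiantsHypothesis.Cruxes.DualUnipotentThreeHalves.InitialForm.UnipotentClosure

open Summit.ValiantsHypothesis.ValiantsHypothesis.Cruxes.DualUnipotentThreeHalves.InitialForm.CurveClosure Matrix
open scoped Nat Polynomial

variable {ι : Type*} [Fintype ι] [DecidableEq ι]

/-! ### The polynomial Möbius operator `p ↦ (1 + u s)^E · p (s / (1 + u s))` -/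

/-- `mob u E p = ∑ᵢ pᵢ sⁱ (1 + u s)^{E-i}` (= `(1 + u s)^E · p(s/(1+us))` when `natDegree p ≤ E`). -/
noncomputable def mob (u : ℂ) (E : ℕ) (p : ℂ[X]) : ℂ[X] :=
  ∑ i ∈ Finset.range (E + 1), Polynomial.C (p.coeff i) * Polynomial.X ^ i * (1 + Polynomial.C u * Polynomial.X) ^ (E - i)

theorem mob_eval_zero (u : ℂ) (E : ℕ) (p : ℂ[X]) : (mob u E p).eval 0 = p.eval 0 := by
  rw [mob, Polynomial.eval_finsetSum, Finset.sum_eq_single 0]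
  · simp [Polynomial.coeff_zero_eq_eval_zero]
  · intro i _ hi
    simp [zero_pow hi]
  · intro h; exact absurd (Finset.mem_range.mpr (Nat.succ_pos E)) h

theorem mob_eval (u : ℂ) {E : ℕ} {p : ℂ[X]} (hp : p.natDegree ≤ E) {t : ℂ} (ht : 1 + u * t ≠ 0) :
    (mob u E p).eval t = (1 + u * t) ^ E * p.eval (t / (1 + u * t)) := by
  rw [mob, Polynomial.eval_finsetSum, Polynomial.eval_eq_sum_range' (lt_of_le_of_lt hp (Nat.lt_succ_self E)) (t / (1 + u * t)),
    Finset.mul_sum]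
  refine Finset.sum_congr rfl fun i hi => ?_
  have hiE : i ≤ E := Nat.lt_succ_iff.mp (Finset.mem_range.mp hi)
  simp only [Polynomial.eval_mul, Polynomial.eval_C, Polynomial.eval_pow, Polynomial.eval_X, Polynomial.eval_add,
    Polynomial.eval_one]
  rw [div_pow, ← pow_sub_mul_pow (1 + u * t) hiE]
  field_simp

/-- Componentwise Möbius operator on polynomial vectors. -/
noncomputable def mobv (u : ℂ) (E : ℕ) (w : ι → ℂ[X]) : ι → ℂ[X] := fun e => mob u E (w e)

omit [Fintype ι] [DecidableEq ι] in
theorem ev_zero_mobv (u : ℂ) (E : ℕ) (w : ι → ℂ[X]) : ev 0 (mobv u E w) = ev 0 w := by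
  funext e; simp [mobv, mob_eval_zero]

omit [Fintype ι] [DecidableEq ι] in
theorem ev_mobv (u : ℂ) {E : ℕ} {w : ι → ℂ[X]} (hw : ∀ e, (w e).natDegree ≤ E) {t : ℂ} (ht : 1 + u * t ≠ 0) :
    ev t (mobv u E w) = (1 + u * t) ^ E • ev (t / (1 + u * t)) w := by
  funext e; simp [mobv, mob_eval u (hw e) ht]

/-! ### Finite exponentials of a nilpotent matrix -/

/-- `exp (x A) = ∑_{i<N} xⁱ Aⁱ / i!` once `A ^ N = 0` (as in `Literature.NumberTheory.Automorphic.NilpotentExpRootHom`). -/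
theorem exp_smul_eq_sum' {A : Matrix ι ι ℂ} {N : ℕ} (hN : A ^ N = 0) (x : ℂ) :
    IsNilpotent.exp (x • A) = ∑ i ∈ Finset.range N, x ^ i • (((i ! : ℂ))⁻¹ • A ^ i) := by
  rw [IsNilpotent.exp_eq_sum (k := N) (by rw [smul_pow, hN, smul_zero])]
  refine Finset.sum_congr rfl fun i _ => ?_
  rw [smul_pow, smul_comm, ← algebraMap_smul ℂ ((i ! : ℚ)⁻¹), map_inv₀, map_natCast]

theorem exp_smul_mul_exp_smul {A : Matrix ι ι ℂ} (hA : IsNilpotent A) (a b : ℂ) :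
    IsNilpotent.exp (a • A) * IsNilpotent.exp (b • A) = IsNilpotent.exp ((a + b) • A) := by
  rw [add_smul]
  exact (IsNilpotent.exp_add_of_commute (((Commute.refl A).smul_left _).smul_right _) (hA.smul _) (hA.smul _)).symm

/-! ### The polynomial family `Φ = s^D · exp (A / s)` -/

/-- `Φm A D = ∑_{j ≤ D} (s^{D-j} / j!) · A^j`, a matrix over `ℂ[s]`. -/
noncomputable def Φm (A : Matrix ι ι ℂ) (D : ℕ) : Matrix ι ι ℂ[X] :=
  ∑ j ∈ Finset.range (D + 1), (Polynomial.C (((j ! : ℂ))⁻¹) * Polynomial.X ^ (D - j)) • (A.map Polynomial.C) ^ j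

omit [DecidableEq ι] in
theorem ev_mulVec (t : ℂ) (M : Matrix ι ι ℂ[X]) (q : ι → ℂ[X]) : ev t (M *ᵥ q) = (M.map (Polynomial.eval t)) *ᵥ ev t q := by
  funext i
  exact (RingHom.map_mulVec (Polynomial.evalRingHom t) M q i :)

theorem map_pow_eval (A : Matrix ι ι ℂ) (t : ℂ) (j : ℕ) : ((A.map Polynomial.C) ^ j).map (Polynomial.eval t) = A ^ j := by
  have h := Matrix.map_pow (A.map Polynomial.C) (Polynomial.evalRingHom t) j
  rw [Polynomial.coe_evalRingHom] at h
  rw [h, Matrix.map_map]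
  have : (Polynomial.eval t ∘ Polynomial.C : ℂ → ℂ) = id := funext fun c => Polynomial.eval_C
  rw [this, Matrix.map_id]

omit [Fintype ι] [DecidableEq ι] in
theorem map_C_map_eval (B : Matrix ι ι ℂ) (t : ℂ) : (B.map (Polynomial.C : ℂ → ℂ[X])).map (Polynomial.eval t) = B := by
  rw [Matrix.map_map]
  have : (Polynomial.eval t ∘ Polynomial.C : ℂ → ℂ) = id := funext fun c => Polynomial.eval_C
  rw [this, Matrix.map_id]

theorem ev_Φm_mulVec {A : Matrix ι ι ℂ} {D : ℕ} (hA : A ^ (D + 1) = 0) {t : ℂ} (ht : t ≠ 0) (q : ι → ℂ[X]) :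
    ev t (Φm A D *ᵥ q) = t ^ D • (IsNilpotent.exp (t⁻¹ • A) *ᵥ ev t q) := by
  rw [ev_mulVec, ← Matrix.smul_mulVec]
  congr 1
  rw [exp_smul_eq_sum' hA, Finset.smul_sum]
  refine Matrix.ext fun i k => ?_
  rw [Matrix.map_apply, Φm, Matrix.sum_apply, Polynomial.eval_finsetSum, Matrix.sum_apply]
  refine Finset.sum_congr rfl fun j hj => ?_
  have hjD : j ≤ D := Nat.lt_succ_iff.mp (Finset.mem_range.mp hj)
  have hpow := congrFun (congrFun (map_pow_eval A t j) i) k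
  rw [Matrix.map_apply] at hpow
  rw [Matrix.smul_apply, smul_eq_mul, Polynomial.eval_mul, hpow, Matrix.smul_apply, Matrix.smul_apply, Matrix.smul_apply,
    smul_eq_mul, smul_eq_mul, smul_eq_mul, Polynomial.eval_mul, Polynomial.eval_C, Polynomial.eval_pow, Polynomial.eval_X,
    pow_sub₀ _ ht hjD, inv_pow]
  ring

/-- `Φ` is injective on polynomial vectors. -/
theorem Φm_mulVec_injective {A : Matrix ι ι ℂ} {D : ℕ} (hA : A ^ (D + 1) = 0) {q : ι → ℂ[X]} (hq : Φm A D *ᵥ q = 0) :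
    q = 0 := by
  classical
  by_contra hne
  set Ap : Matrix ι ι ℂ[X] := A.map Polynomial.C with hAp
  have hAp0 : Ap ^ (D + 1) = 0 := by
    rw [hAp, ← Matrix.map_pow, hA]
    ext i j; simp
  let S : Finset ℕ := (Finset.range (D + 1)).filter fun j => (Ap ^ j) *ᵥ q ≠ 0
  have h0S : 0 ∈ S := Finset.mem_filter.mpr ⟨Finset.mem_range.mpr (Nat.succ_pos D), by simpa using hne⟩
  have hS : S.Nonempty := ⟨0, h0S⟩
  set a := S.max' hS with ha_def
  have haS := Finset.max'_mem S hS
  have ha : (Ap ^ a) *ᵥ q ≠ 0 := (Finset.mem_filter.mp haS).2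
  have hgt : ∀ j, a < j → (Ap ^ j) *ᵥ q = 0 := by
    intro j hj
    by_cases hjD : j ≤ D
    · by_contra h
      have hjS : j ∈ S := Finset.mem_filter.mpr ⟨Finset.mem_range.mpr (Nat.lt_succ_of_le hjD), h⟩
      exact absurd (S.le_max' j hjS) (not_le.mpr hj)
    · push Not at hjD
      rw [← pow_sub_mul_pow Ap (Nat.succ_le_of_lt hjD), hAp0, mul_zero, Matrix.zero_mulVec]
  have h1 : (Ap ^ a) *ᵥ (Φm A D *ᵥ q) = 0 := by rw [hq, Matrix.mulVec_zero]
  rw [Matrix.mulVec_mulVec, Φm, Finset.mul_sum, Matrix.sum_mulVec, Finset.sum_eq_single 0] at h1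
  · rw [Matrix.mul_smul, pow_zero, mul_one, Matrix.smul_mulVec, smul_eq_zero] at h1
    rcases h1 with h1 | h1
    · simp at h1
    · exact ha h1
  · intro j _ hj0
    rw [Matrix.mul_smul, ← pow_add, Matrix.smul_mulVec, hgt (a + j) (Nat.lt_add_of_pos_right (Nat.pos_of_ne_zero hj0)),
      smul_zero]
  · intro h; exact absurd (Finset.mem_range.mpr (Nat.succ_pos D)) h

/-! ### The algebraic family `N = Φ (K[s])` -/

variable (K : Submodule ℂ (ι → ℂ))

/-- Constant polynomial vectors on a basis of `K`. -/
noncomputable def κ (i : Fin (Module.finrank ℂ K)) : ι → ℂ[X] := fun e => Polynomial.C (((Module.finBasis ℂ K) i : ι → ℂ) e)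

/-- `K[s]`: the `ℂ[s]`-span of `K`. -/
noncomputable def Kpoly : Submodule ℂ[X] (ι → ℂ[X]) := Submodule.span ℂ[X] (Set.range (κ K))

omit [DecidableEq ι] in
theorem ev_κ (t : ℂ) (i : Fin (Module.finrank ℂ K)) : ev t (κ K i) = ((Module.finBasis ℂ K) i : ι → ℂ) := by
  funext e; simp [κ]

omit [Fintype ι] [DecidableEq ι] in
theorem ev_zero' (t : ℂ) : ev t (0 : ι → ℂ[X]) = 0 := by
  funext e; simp

omit [DecidableEq ι] in
theorem linearIndependent_κ : LinearIndependent ℂ[X] (κ K) := by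
  rw [Fintype.linearIndependent_iff]
  intro g hg i
  apply Polynomial.funext
  intro t
  have h := congrArg (ev t) hg
  rw [ev_sum, ev_zero'] at h
  simp only [ev_smul_poly, ev_κ] at h
  have hb : LinearIndependent ℂ (fun i => ((Module.finBasis ℂ K) i : ι → ℂ)) :=
    (Module.finBasis ℂ K).linearIndependent.map' K.subtype (Submodule.ker_subtype K)
  have := Fintype.linearIndependent_iff.mp hb (fun i => (g i).eval t) h i
  simpa using this

omit [DecidableEq ι] in
theorem finrank_Kpoly : Module.finrank ℂ[X] (Kpoly K) = Module.finrank ℂ K := by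
  rw [Kpoly, finrank_span_eq_card (linearIndependent_κ K), Fintype.card_fin]

omit [DecidableEq ι] in
theorem ev_mem_of_mem_Kpoly {q : ι → ℂ[X]} (hq : q ∈ Kpoly K) (t : ℂ) : ev t q ∈ K := by
  induction hq using Submodule.span_induction with
  | mem x hx =>
    obtain ⟨i, rfl⟩ := hx
    rw [ev_κ]; exact ((Module.finBasis ℂ K) i).2
  | zero => rw [ev_zero']; exact K.zero_mem
  | add x y _ _ hx hy => rw [ev_add]; exact K.add_mem hx hy
  | smul g x _ hx => rw [ev_smul_poly]; exact K.smul_mem _ hx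

omit [DecidableEq ι] in
theorem const_mem_Kpoly {k : ι → ℂ} (hk : k ∈ K) : (fun e => Polynomial.C (k e)) ∈ Kpoly K := by
  set b := Module.finBasis ℂ K with hb
  set r := b.repr ⟨k, hk⟩ with hr
  have hk' : k = ∑ i, r i • (b i : ι → ℂ) := by
    have := congrArg Subtype.val (b.sum_repr ⟨k, hk⟩)
    simp only [AddSubmonoidClass.coe_finsetSum, SetLike.val_smul] at this
    exact this.symm
  have hke : ∀ e, k e = ∑ i, r i * (b i : ι → ℂ) e := by
    intro e
    have := congrFun hk' e
    simpa [Finset.sum_apply] using this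
  have hfun : (fun e => Polynomial.C (k e)) = ∑ i, Polynomial.C (r i) • κ K i := by
    funext e
    rw [hke e, map_sum, Finset.sum_apply]
    refine Finset.sum_congr rfl fun i _ => ?_
    rw [Pi.smul_apply, smul_eq_mul, map_mul, κ]
  rw [hfun]
  exact Submodule.sum_mem _ fun i _ => Submodule.smul_mem _ _ (Submodule.subset_span ⟨i, rfl⟩)

/-- The algebraic family `N = Φ (K[s])`, `N_t = exp (A/t) K` for `t ≠ 0`. -/
noncomputable def Nfam (A : Matrix ι ι ℂ) (D : ℕ) : Submodule ℂ[X] (ι → ℂ[X]) := (Kpoly K).map (Matrix.toLin' (Φm A D))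

variable {K}

theorem mem_Nfam_iff {A : Matrix ι ι ℂ} {D : ℕ} {p : ι → ℂ[X]} : p ∈ Nfam K A D ↔ ∃ q ∈ Kpoly K, Φm A D *ᵥ q = p := by
  simp [Nfam, Submodule.mem_map, Matrix.toLin'_apply]

theorem finrank_Nfam {A : Matrix ι ι ℂ} {D : ℕ} (hA : A ^ (D + 1) = 0) :
    Module.finrank ℂ[X] (Nfam K A D) = Module.finrank ℂ K := by
  have hinj : Function.Injective (Matrix.toLin' (Φm A D)) := by
    intro q q' h
    have h' : Φm A D *ᵥ (q - q') = 0 := by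
      rw [Matrix.mulVec_sub, ← Matrix.toLin'_apply, ← Matrix.toLin'_apply, h, sub_self]
    exact sub_eq_zero.mp (Φm_mulVec_injective hA h')
  rw [Nfam, LinearEquiv.finrank_eq (Submodule.equivMapOfInjective _ hinj (Kpoly K)).symm, finrank_Kpoly]

theorem ev_Nfam {A : Matrix ι ι ℂ} {D : ℕ} (hA : A ^ (D + 1) = 0) {p : ι → ℂ[X]} (hp : p ∈ Nfam K A D) {t : ℂ} (ht : t ≠ 0) :
    ∃ k ∈ K, ev t p = IsNilpotent.exp (t⁻¹ • A) *ᵥ k := by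
  obtain ⟨q, hq, rfl⟩ := mem_Nfam_iff.mp hp
  refine ⟨t ^ D • ev t q, K.smul_mem _ (ev_mem_of_mem_Kpoly K hq t), ?_⟩
  rw [ev_Φm_mulVec hA ht, Matrix.mulVec_smul]

theorem exp_mulVec_mem_ev_Nfam {A : Matrix ι ι ℂ} {D : ℕ} (hA : A ^ (D + 1) = 0) {t : ℂ} (ht : t ≠ 0) {k : ι → ℂ} (hk : k ∈ K) :
    ∃ p ∈ Nfam K A D, ev t p = IsNilpotent.exp (t⁻¹ • A) *ᵥ k := by
  refine ⟨Φm A D *ᵥ (fun e => Polynomial.C (((t ^ D)⁻¹ • k) e)),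
    mem_Nfam_iff.mpr ⟨_, const_mem_Kpoly K (K.smul_mem _ hk), rfl⟩, ?_⟩
  rw [ev_Φm_mulVec hA ht]
  have : ev t (fun e => Polynomial.C (((t ^ D)⁻¹ • k) e)) = (t ^ D)⁻¹ • k := by funext e; simp
  rw [this, Matrix.mulVec_smul, smul_smul, mul_inv_cancel₀ (pow_ne_zero _ ht), one_smul]

/-- Initial vectors of `N`: if `s^C · w ∈ N` then `ev_t w ∈ exp(A/t) K` for every `t ≠ 0`. -/
theorem ev_sat_mem {A : Matrix ι ι ℂ} {D : ℕ} (hA : A ^ (D + 1) = 0) {w : ι → ℂ[X]} {C : ℕ}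
    (hwN : ((Polynomial.X : ℂ[X]) ^ C) • w ∈ Nfam K A D) {t : ℂ} (ht : t ≠ 0) :
    ∃ k ∈ K, ev t w = IsNilpotent.exp (t⁻¹ • A) *ᵥ k := by
  obtain ⟨k, hk, hk'⟩ := ev_Nfam hA hwN ht
  refine ⟨(t ^ C)⁻¹ • k, K.smul_mem _ hk, ?_⟩
  have h1 : ev t (((Polynomial.X : ℂ[X]) ^ C) • w) = t ^ C • ev t w := by
    rw [ev_smul_poly, Polynomial.eval_pow, Polynomial.eval_X]
  rw [Matrix.mulVec_smul, ← hk', h1, smul_smul, inv_mul_cancel₀ (pow_ne_zero _ ht), one_smul]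

/-- A linear map `G` with `G A = c · A G` intertwines the exponentials: `G · exp(xA) = exp(xc·A) · G`. -/
theorem mul_exp_smul_of_rel {A G : Matrix ι ι ℂ} {c : ℂ} (h : G * A = c • (A * G)) {N : ℕ} (hA : A ^ N = 0) (x : ℂ) :
    G * IsNilpotent.exp (x • A) = IsNilpotent.exp ((x * c) • A) * G := by
  have hpow : ∀ i : ℕ, G * A ^ i = c ^ i • (A ^ i * G) := by
    intro i
    induction i with
    | zero => simp
    | succ i ih =>
      rw [pow_succ, ← Matrix.mul_assoc, ih, Matrix.smul_mul, Matrix.mul_assoc, h, Matrix.mul_smul, smul_smul, ← Matrix.mul_assoc,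
        ← pow_succ, pow_succ, mul_comm (c ^ i) c]
  rw [exp_smul_eq_sum' hA x, exp_smul_eq_sum' hA (x * c), Finset.mul_sum, Finset.sum_mul]
  refine Finset.sum_congr rfl fun i _ => ?_
  rw [Matrix.mul_smul, Matrix.mul_smul, hpow i, Matrix.smul_mul, Matrix.smul_mul, smul_smul, smul_smul, smul_smul, mul_pow]
  ring_nf

/-- Scaling reparametrisation `s ↦ c·s` of a polynomial vector. -/
noncomputable def scl (c : ℂ) (w : ι → ℂ[X]) : ι → ℂ[X] := fun e => (w e).comp (Polynomial.C c * Polynomial.X)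

omit [Fintype ι] [DecidableEq ι] in
theorem ev_scl (c t : ℂ) (w : ι → ℂ[X]) : ev t (scl c w) = ev (c * t) w := by
  funext e; simp [scl, Polynomial.eval_comp]

/-! ### The theorem -/

/-- ★ **UNIPOTENT CLOSURE.**  Let `A` be a nilpotent matrix acting on the coordinate space and `𝓕` a family of polynomial conditions.
If the whole orbit `exp(u A) · K` (`u ∈ ℂ`) of a subspace `K` lies in the zero locus of `𝓕`, then there is a subspace `K₀` of the SAME
dimension, contained in the zero locus, and `A`-STABLE (`K₀ = lim_{u → ∞} exp(u A) K`, computed as the canonical curve-closure limit of the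
algebraic family `s^D exp(A/s) K[s]` at `s = 0`; stability because the family is invariant under the polynomial Möbius reparametrisation
`s ↦ s/(1+us)` composed with `exp(u A)`).  The kernel form of «a certificate may be taken fixed by a unipotent symmetry» (Borel). -/
theorem exists_stable_of_expStable_core (A : Matrix ι ι ℂ) (hA : IsNilpotent A) (K : Submodule ℂ (ι → ℂ))
    (𝓕 : Set (MvPolynomial ι ℂ)) (hK : ∀ u : ℂ, ∀ k ∈ K, ∀ F ∈ 𝓕, MvPolynomial.eval (IsNilpotent.exp (u • A) *ᵥ k) F = 0) :
    ∃ K₀ : Submodule ℂ (ι → ℂ), Module.finrank ℂ K₀ = Module.finrank ℂ K ∧ (∀ v ∈ K₀, A *ᵥ v ∈ K₀) ∧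
      (∀ v ∈ K₀, ∀ F ∈ 𝓕, MvPolynomial.eval v F = 0) ∧
      ∀ (G : Matrix ι ι ℂ) (c : ℂ), c ≠ 0 → (∀ k ∈ K, G *ᵥ k ∈ K) → G * A = c • (A * G) → ∀ v ∈ K₀, G *ᵥ v ∈ K₀ := by
  classical
  obtain ⟨D, hD⟩ := hA
  have hA1 : A ^ (D + 1) = 0 := by rw [pow_succ, hD, zero_mul]
  have hAnil : IsNilpotent A := ⟨D, hD⟩
  set N := Nfam K A D with hN
  set 𝓕' : Set (MvPolynomial ι ℂ[X]) := (MvPolynomial.map Polynomial.C) '' 𝓕 with h𝓕'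
  set T : Set ℂ := {t | t ≠ 0} with hT
  have hTinf : T.Infinite := by
    have : T = Set.univ \ {0} := by ext t; simp [hT]
    rw [this]; exact Set.infinite_univ.sdiff (Set.finite_singleton 0)
  have hT0 : (0 : ℂ) ∉ T := fun h => h rfl
  have hmapC : ∀ (t : ℂ) (F : MvPolynomial ι ℂ),
      MvPolynomial.map (Polynomial.evalRingHom t) (MvPolynomial.map Polynomial.C F) = F := by
    intro t F
    rw [MvPolynomial.map_map]
    have : (Polynomial.evalRingHom t).comp Polynomial.C = RingHom.id ℂ := RingHom.ext fun c => Polynomial.eval_C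
    rw [this, MvPolynomial.map_id]
  have hS : ∀ t ∈ T, ∀ p ∈ N, ∀ F ∈ 𝓕', MvPolynomial.eval (ev t p) (MvPolynomial.map (Polynomial.evalRingHom t) F) = 0 := by
    rintro t ht p hp _ ⟨F, hF, rfl⟩
    rw [hmapC]
    obtain ⟨k, hk, hev⟩ := ev_Nfam hA1 hp ht
    rw [hev]; exact hK _ k hk F hF
  obtain ⟨K₀, hdim, hinit, hcanon, hzero⟩ := exists_limit_of_algebraic_family' N 𝓕' T hTinf hT0 hS
  -- exp-stability of the canonical limit
  have hexp : ∀ u : ℂ, ∀ v ∈ K₀, IsNilpotent.exp (u • A) *ᵥ v ∈ K₀ := by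
    intro u v hv
    obtain ⟨w, hw0, C, hwN⟩ := hinit v hv
    set E := Finset.univ.sup fun e => (w e).natDegree with hE
    have hwE : ∀ e, (w e).natDegree ≤ E := fun e => Finset.le_sup (f := fun e => (w e).natDegree) (Finset.mem_univ e)
    -- the moved polynomial vector
    set w' : ι → ℂ[X] := (IsNilpotent.exp (u • A)).map Polynomial.C *ᵥ mobv (-u) E w with hw'
    have hev' : ∀ t : ℂ, t ≠ 0 → 1 + (-u) * t ≠ 0 → ∃ p ∈ N, ev t p = ev t w' := by
      intro t ht hut
      set t' := t / (1 + (-u) * t) with ht'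
      have ht'0 : t' ≠ 0 := div_ne_zero ht hut
      -- `ev t' w ∈ exp(A/t') K`
      obtain ⟨k, hk, hk'⟩ := ev_Nfam hA1 hwN ht'0
      have hevw : ev t' w = IsNilpotent.exp (t'⁻¹ • A) *ᵥ ((t' ^ C)⁻¹ • k) := by
        have h1 : ev t' (((Polynomial.X : ℂ[X]) ^ C) • w) = t' ^ C • ev t' w := by
          rw [ev_smul_poly, Polynomial.eval_pow, Polynomial.eval_X]
        rw [Matrix.mulVec_smul, ← hk', h1, smul_smul, inv_mul_cancel₀ (pow_ne_zero _ ht'0), one_smul]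
      have hinv : t'⁻¹ = t⁻¹ + -u := by
        rw [ht', inv_div]; field_simp
      obtain ⟨p, hp, hpev⟩ := exp_mulVec_mem_ev_Nfam (K := K) hA1 ht
        (K.smul_mem ((1 + (-u) * t) ^ E) (K.smul_mem ((t' ^ C)⁻¹) hk))
      refine ⟨p, hp, ?_⟩
      rw [hpev, hw', ev_mulVec, map_C_map_eval, ev_mobv (-u) hwE hut, ← ht', hevw]
      simp only [Matrix.mulVec_smul, Matrix.mulVec_mulVec]
      rw [exp_smul_mul_exp_smul hAnil, hinv, show u + (t⁻¹ + -u) = t⁻¹ by ring]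
    have hinf : Set.Infinite {t : ℂ | ∃ p ∈ N, ev t p = ev t w'} := by
      have hfin : Set.Finite ({0} ∪ {t : ℂ | 1 + (-u) * t = 0}) := by
        refine (Set.finite_singleton 0).union (Set.Finite.subset (Set.finite_singleton (u⁻¹)) ?_)
        intro t ht
        have ht' : 1 + (-u) * t = 0 := ht
        have hu : u ≠ 0 := by rintro rfl; simp at ht'
        rw [Set.mem_singleton_iff]
        field_simp
        linear_combination -ht'
      refine (Set.infinite_univ.sdiff hfin).mono ?_
      intro t ht
      simp only [Set.mem_sdiff, Set.mem_univ, Set.mem_union, Set.mem_singleton_iff, Set.mem_setOf_eq, true_and, not_or] at ht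
      exact hev' t ht.1 ht.2
    have hmem := hcanon w' hinf
    rw [hw', ev_mulVec, map_C_map_eval, ev_zero_mobv, hw0] at hmem
    exact hmem
  refine ⟨K₀, by rw [hdim, hN, finrank_Nfam hA1], ?_, ?_, ?_⟩
  · intro v hv
    by_contra hAv
    obtain ⟨ℓ, hφv, hφK⟩ := Submodule.exists_dual_map_eq_bot_of_notMem hAv inferInstance
    have hφ0 : ∀ x ∈ K₀, ℓ x = 0 := fun x hx => (Submodule.eq_bot_iff _).mp hφK (ℓ x) (Submodule.mem_map_of_mem hx)
    rcases Nat.eq_zero_or_pos D with hD0 | hDpos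
    · -- degenerate: `A ^ 0 = 1 = 0`
      subst hD0
      apply hAv
      have h1 : (1 : Matrix ι ι ℂ) = 0 := by simpa using hD
      have : A *ᵥ v = 0 := by rw [← Matrix.one_mulVec (A *ᵥ v), h1, Matrix.zero_mulVec]
      rw [this]; exact K₀.zero_mem
    set P : ℂ[X] := ∑ i ∈ Finset.range (D + 1), Polynomial.C (((i ! : ℂ))⁻¹ * ℓ (A ^ i *ᵥ v)) * Polynomial.X ^ i with hP
    have hPeval : ∀ u : ℂ, P.eval u = ℓ (IsNilpotent.exp (u • A) *ᵥ v) := by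
      intro u
      rw [exp_smul_eq_sum' hA1, Matrix.sum_mulVec, map_sum, hP, Polynomial.eval_finsetSum]
      refine Finset.sum_congr rfl fun i _ => ?_
      rw [Matrix.smul_mulVec, Matrix.smul_mulVec, map_smul, map_smul, smul_eq_mul, smul_eq_mul,
        Polynomial.eval_mul, Polynomial.eval_C, Polynomial.eval_pow, Polynomial.eval_X]
      ring
    have hP0 : P = 0 := by
      apply Polynomial.funext
      intro u
      rw [hPeval, Polynomial.eval_zero]
      exact hφ0 _ (hexp u v hv)
    have hcoeff := congrArg (fun p : ℂ[X] => p.coeff 1) hP0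
    simp only [hP, Polynomial.finsetSum_coeff, Polynomial.coeff_C_mul_X_pow, Polynomial.coeff_zero] at hcoeff
    rw [Finset.sum_eq_single 1] at hcoeff
    · simp only [if_true, Nat.factorial_one, Nat.cast_one, inv_one, one_mul, pow_one] at hcoeff
      exact hφv hcoeff
    · intro i _ hi; rw [if_neg (Ne.symm hi)]
    · intro h; exact absurd (Finset.mem_range.mpr (Nat.succ_lt_succ hDpos)) h
  · intro v hv F hF
    have := hzero v hv (MvPolynomial.map Polynomial.C F) ⟨F, hF, rfl⟩
    rwa [hmapC] at this
  · -- stability of the canonical limit under linear symmetries `G` of `K` normalising the one-parameter group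
    intro G c hc hGK hGA v hv
    obtain ⟨w, hw0, C, hwN⟩ := hinit v hv
    set w'' : ι → ℂ[X] := G.map Polynomial.C *ᵥ scl c w with hw''
    have hev'' : ∀ t : ℂ, t ≠ 0 → ∃ p ∈ N, ev t p = ev t w'' := by
      intro t ht
      obtain ⟨k, hk, hkev⟩ := ev_sat_mem (K := K) hA1 hwN (mul_ne_zero hc ht)
      obtain ⟨p, hp, hpev⟩ := exp_mulVec_mem_ev_Nfam (K := K) hA1 ht (hGK k hk)
      refine ⟨p, hp, ?_⟩
      rw [hpev, hw'', ev_mulVec, map_C_map_eval, ev_scl, hkev, Matrix.mulVec_mulVec, Matrix.mulVec_mulVec,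
        mul_exp_smul_of_rel hGA hA1, show (c * t)⁻¹ * c = t⁻¹ by field_simp]
    have hinf : Set.Infinite {t : ℂ | ∃ p ∈ N, ev t p = ev t w''} :=
      hTinf.mono fun t ht => hev'' t ht
    have hmem := hcanon w'' hinf
    rw [hw'', ev_mulVec, map_C_map_eval, ev_scl, mul_zero, hw0] at hmem
    exact hmem

/-- ★ **UNIPOTENT CLOSURE** (the statement of record; `_core` carries in addition the stability of `K₀` under the linear symmetries of `K`
normalising the one-parameter group). -/
theorem exists_stable_of_expStable (A : Matrix ι ι ℂ) (hA : IsNilpotent A) (K : Submodule ℂ (ι → ℂ)) (𝓕 : Set (MvPolynomial ι ℂ))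
    (hK : ∀ u : ℂ, ∀ k ∈ K, ∀ F ∈ 𝓕, MvPolynomial.eval (IsNilpotent.exp (u • A) *ᵥ k) F = 0) :
    ∃ K₀ : Submodule ℂ (ι → ℂ), Module.finrank ℂ K₀ = Module.finrank ℂ K ∧ (∀ v ∈ K₀, A *ᵥ v ∈ K₀) ∧
      ∀ v ∈ K₀, ∀ F ∈ 𝓕, MvPolynomial.eval v F = 0 := by
  obtain ⟨K₀, h1, h2, h3, -⟩ := exists_stable_of_expStable_core A hA K 𝓕 hK
  exact ⟨K₀, h1, h2, h3⟩


/-! ### The joint (Borel) normal form: torus-graded AND `A`-stable -/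

theorem torusAct_eq_diagonal_mulVec (w : ι → ℕ) (τ : ℂ) (v : ι → ℂ) :
    torusAct w τ v = (Matrix.diagonal fun e => τ ^ w e) *ᵥ v := by
  funext e; simp [torusAct, Matrix.mulVec_diagonal]

omit [DecidableEq ι] in
/-- A weight-graded subspace is torus-stable. -/
theorem torusAct_mem_of_graded (w : ι → ℕ) {K : Submodule ℂ (ι → ℂ)} (hgr : ∀ s ∈ K, ∀ c, wtProj w c s ∈ K) (τ : ℂ)
    {v : ι → ℂ} (hv : v ∈ K) : torusAct w τ v ∈ K := by
  classical
  have : torusAct w τ v = ∑ c ∈ Finset.univ.image w, τ ^ c • wtProj w c v := by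
    funext e
    simp only [torusAct, Finset.sum_apply, Pi.smul_apply, wtProj, smul_eq_mul, mul_ite, mul_zero]
    rw [Finset.sum_ite_eq (Finset.univ.image w) (w e) (fun c => τ ^ c * v e), if_pos (Finset.mem_image_of_mem w (Finset.mem_univ e))]
  rw [this]
  exact K.sum_mem fun c _ => K.smul_mem _ (hgr v hv c)

omit [DecidableEq ι] in
/-- ★ A torus-STABLE subspace is weight-GRADED (Part I applied to the subspace's own linear equations). -/
theorem graded_of_torusStable (w : ι → ℕ) (K : Submodule ℂ (ι → ℂ)) (hK : ∀ τ : ℂ, τ ≠ 0 → ∀ v ∈ K, torusAct w τ v ∈ K) :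
    ∀ s ∈ K, ∀ c, wtProj w c s ∈ K := by
  classical
  set 𝓛 : Set (MvPolynomial ι ℂ) := {F | ∃ ℓ : Module.Dual ℂ (ι → ℂ), (∀ x ∈ K, ℓ x = 0) ∧
    F = ∑ e, MvPolynomial.C (ℓ (Pi.single e 1)) * MvPolynomial.X e} with h𝓛
  have hevalL : ∀ (ℓ : Module.Dual ℂ (ι → ℂ)) (v : ι → ℂ),
      MvPolynomial.eval v (∑ e, MvPolynomial.C (ℓ (Pi.single e 1)) * MvPolynomial.X e) = ℓ v := by
    intro ℓ v
    have hv : v = ∑ e, v e • (Pi.single e (1 : ℂ) : ι → ℂ) := by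
      funext j
      simp only [Finset.sum_apply, Pi.smul_apply, Pi.single_apply, smul_eq_mul, mul_ite, mul_one, mul_zero]
      rw [Finset.sum_ite_eq Finset.univ j (fun e => v e), if_pos (Finset.mem_univ j)]
    conv_rhs => rw [hv, map_sum]
    simp only [map_sum, map_mul, MvPolynomial.eval_C, MvPolynomial.eval_X, map_smul, smul_eq_mul]
    exact Finset.sum_congr rfl fun e _ => mul_comm _ _
  have hZ : ∀ τ : ℂ, τ ≠ 0 → ∀ v ∈ K, ∀ F ∈ 𝓛, MvPolynomial.eval (torusAct w τ v) F = 0 := by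
    rintro τ hτ v hv _ ⟨ℓ, hℓ, rfl⟩
    rw [hevalL]; exact hℓ _ (hK τ hτ v hv)
  obtain ⟨K₀, hdim, hgr, hzero⟩ := exists_graded_of_torusStable w K 𝓛 hZ
  have hle : K₀ ≤ K := by
    intro s hs
    by_contra hsK
    obtain ⟨ℓ, hℓs, hℓK⟩ := Submodule.exists_dual_map_eq_bot_of_notMem hsK inferInstance
    have h0 : ∀ x ∈ K, ℓ x = 0 := fun x hx => (Submodule.eq_bot_iff _).mp hℓK (ℓ x) (Submodule.mem_map_of_mem hx)
    have := hzero s hs _ ⟨ℓ, h0, rfl⟩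
    rw [hevalL] at this
    exact hℓs this
  have heq : K₀ = K := Submodule.eq_of_le_of_finrank_eq hle hdim
  rw [← heq]
  exact hgr

/-- ★★ **JOINT (BOREL) NORMAL FORM — torus-graded AND `A`-stable.**  Let the torus `λ_w` and the unipotent group `exp(u·A)` (`A` nilpotent, a torus
weight vector up to scalars: `λ_w(τ) A = c_τ · A λ_w(τ)`) both preserve the zero locus of `𝓕`.  Then any subspace in the zero locus may be replaced by one of
the SAME dimension that is WEIGHT-GRADED and `A`-STABLE (torus closure (Part I), then the canonical unipotent closure of the graded space, which stays
torus-stable because the torus normalises the one-parameter group and the canonical limit is reparametrisation-invariant, and torus-stable ⇒ graded). -/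
theorem exists_graded_stable (w : ι → ℕ) (A : Matrix ι ι ℂ) (hA : IsNilpotent A)
    (hcomp : ∀ τ : ℂ, τ ≠ 0 → ∃ c : ℂ, c ≠ 0 ∧
      (Matrix.diagonal fun e => τ ^ w e) * A = c • (A * Matrix.diagonal fun e => τ ^ w e))
    (𝓕 : Set (MvPolynomial ι ℂ))
    (hZT : ∀ τ : ℂ, τ ≠ 0 → ∀ v : ι → ℂ, (∀ F ∈ 𝓕, MvPolynomial.eval v F = 0) → ∀ F ∈ 𝓕, MvPolynomial.eval (torusAct w τ v) F = 0)
    (hZU : ∀ (u : ℂ) (v : ι → ℂ), (∀ F ∈ 𝓕, MvPolynomial.eval v F = 0) →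
      ∀ F ∈ 𝓕, MvPolynomial.eval (IsNilpotent.exp (u • A) *ᵥ v) F = 0)
    (K : Submodule ℂ (ι → ℂ)) (hK : ∀ v ∈ K, ∀ F ∈ 𝓕, MvPolynomial.eval v F = 0) :
    ∃ K₀ : Submodule ℂ (ι → ℂ), Module.finrank ℂ K₀ = Module.finrank ℂ K ∧ (∀ s ∈ K₀, ∀ c, wtProj w c s ∈ K₀) ∧
      (∀ v ∈ K₀, A *ᵥ v ∈ K₀) ∧ ∀ v ∈ K₀, ∀ F ∈ 𝓕, MvPolynomial.eval v F = 0 := by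
  obtain ⟨K₁, hdim₁, hgr₁, hZ₁⟩ := exists_graded_of_torusStable w K 𝓕 (fun τ hτ v hv => hZT τ hτ v (hK v hv))
  have hT₁ : ∀ τ : ℂ, τ ≠ 0 → ∀ v ∈ K₁, torusAct w τ v ∈ K₁ := fun τ _ v hv => torusAct_mem_of_graded w hgr₁ τ hv
  obtain ⟨K₀, hdim₀, hA₀, hZ₀, hstab⟩ := exists_stable_of_expStable_core A hA K₁ 𝓕 (fun u k hk => hZU u k (hZ₁ k hk))
  have hT₀ : ∀ τ : ℂ, τ ≠ 0 → ∀ v ∈ K₀, torusAct w τ v ∈ K₀ := by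
    intro τ hτ v hv
    obtain ⟨c, hc, hGA⟩ := hcomp τ hτ
    rw [torusAct_eq_diagonal_mulVec]
    exact hstab _ c hc (fun k hk => by rw [← torusAct_eq_diagonal_mulVec]; exact hT₁ τ hτ k hk) hGA v hv
  exact ⟨K₀, hdim₀.trans hdim₁, graded_of_torusStable w K₀ hT₀, hA₀, hZ₀⟩

end Summit.ValiantsHypothesis.ValiantsHypothesis.Cruxes.DualUnipotentThreeHalves.InitialForm.UnipotentClosure

/-! ## PART VIII (by name) — a `RelCert` / whole-pencil `Ledger` certificate of a pencil with a unipotent one-parameter symmetry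
`exp(u·A)` may be taken `A`-STABLE (same order `k`, same finrank, same price). -/

namespace Summit.ValiantsHypothesis.ValiantsHypothesis.Cruxes.DualUnipotentThreeHalves.InitialForm.LedgerUnipotent

open Matrix
open Summit.ValiantsHypothesis.ValiantsHypothesis.Cruxes.TwoDimCoefficients.DimTwoCases (AffMat IsAffine)
open Summit.ValiantsHypothesis.ValiantsHypothesis.Cruxes.DualUnipotentThreeHalves.RadicalSplit (lineSubst)
open Summit.ValiantsHypothesis.ValiantsHypothesis.Cruxes.DualUnipotentThreeHalves.InitialForm.TorusClosure (TorusEquivariant map_eval_map_C)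
open Summit.ValiantsHypothesis.ValiantsHypothesis.Cruxes.DualUnipotentThreeHalves.InitialForm.SlowTorus (map_C_map_lineSubst conj_pow totalDegree_conj_le)
open Summit.ValiantsHypothesis.ValiantsHypothesis.Cruxes.DualUnipotentThreeHalves.InitialForm.LedgerTorus (WindowCone ledger_top_iff_windowCone windowCone_torusAct windowFamily windowCone_iff_family)
open Summit.ValiantsHypothesis.ValiantsHypothesis.Cruxes.DualUnipotentThreeHalves.InitialForm.UnipotentClosure (exists_stable_of_expStable exists_graded_stable exp_smul_mul_exp_smul)
open Summit.ValiantsHypothesis.ValiantsHypothesis.Theorems.GrenetZeon.SlowCore (Ledger RelCert)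

variable {n m : ℕ}

/-- The linear substitution `X_e ↦ ∑_{e'} G e e' · X_{e'}` of the coordinate ring. -/
def σ (G : Matrix (Fin n × Fin n) (Fin n × Fin n) ℂ) : MvPolynomial (Fin n × Fin n) ℂ →+* MvPolynomial (Fin n × Fin n) ℂ :=
  MvPolynomial.eval₂Hom MvPolynomial.C fun e => ∑ e', MvPolynomial.C (G e e') * MvPolynomial.X e'

theorem eval_comp_σ (G : Matrix (Fin n × Fin n) (Fin n × Fin n) ℂ) (y : Fin n × Fin n → ℂ) :
    (MvPolynomial.eval y).comp (σ G) = MvPolynomial.eval (G *ᵥ y) := by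
  apply MvPolynomial.ringHom_ext
  · intro c; simp [σ]
  · intro e; simp [σ, Matrix.mulVec, dotProduct]

theorem lineSubst_comp_σ (G : Matrix (Fin n × Fin n) (Fin n × Fin n) ℂ) (x v : Fin n × Fin n → ℂ) :
    (lineSubst x v : MvPolynomial (Fin n × Fin n) ℂ →+* MvPolynomial (Fin 1) ℂ).comp (σ G)
      = (lineSubst (G *ᵥ x) (G *ᵥ v) : MvPolynomial (Fin n × Fin n) ℂ →+* MvPolynomial (Fin 1) ℂ) := by
  apply MvPolynomial.ringHom_ext
  · intro c; simp [σ, lineSubst]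
  · intro e
    simp only [σ, lineSubst, Matrix.mulVec, dotProduct, RingHom.coe_comp, RingHom.coe_coe, Function.comp_apply,
      MvPolynomial.eval₂Hom_X', map_sum, map_mul, MvPolynomial.algHom_C, MvPolynomial.aeval_X, MvPolynomial.algebraMap_eq,
      Fin.sum_univ_one, mul_add, Finset.sum_add_distrib, Finset.sum_mul, mul_assoc]

/-- Point equivariance under `G` lifts to the polynomial identity `N.map (σ G) = (a • D) · N · D'`. -/
theorem map_σ_eq (N : AffMat n m) {G : Matrix (Fin n × Fin n) (Fin n × Fin n) ℂ} {a : ℂ} {D D' : Matrix (Fin m) (Fin m) ℂ}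
    (hconj : ∀ x, N.map (MvPolynomial.eval (G *ᵥ x)) = a • (D * N.map (MvPolynomial.eval x) * D')) :
    N.map (σ G) = (a • D).map MvPolynomial.C * N * D'.map MvPolynomial.C := by
  have key : ∀ y : Fin n × Fin n → ℂ, (N.map (σ G)).map (MvPolynomial.eval y)
      = ((a • D).map MvPolynomial.C * N * D'.map MvPolynomial.C).map (MvPolynomial.eval y) := by
    intro y
    have hc : (⇑(MvPolynomial.eval y) ∘ ⇑(σ G) : MvPolynomial (Fin n × Fin n) ℂ → ℂ)
        = ⇑(MvPolynomial.eval (G *ᵥ y)) := by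
      have := congrArg DFunLike.coe (eval_comp_σ G y)
      simpa using this
    rw [Matrix.map_map, hc, hconj y, Matrix.map_mul, Matrix.map_mul, map_eval_map_C, map_eval_map_C, Matrix.smul_mul,
      Matrix.smul_mul]
  refine Matrix.ext fun i j => MvPolynomial.funext fun y => ?_
  have := congrFun (congrFun (key y) i) j
  simpa only [Matrix.map_apply] using this

/-- The line polynomial at a `G`-moved direction is a constant conjugate (times a nonzero scalar) of the line polynomial at the
original direction over the `G`-moved base point. -/
theorem map_lineSubst_linAct (N : AffMat n m) {G : Matrix (Fin n × Fin n) (Fin n × Fin n) ℂ} {a : ℂ} {D D' : Matrix (Fin m) (Fin m) ℂ}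
    (hconj : ∀ x, N.map (MvPolynomial.eval (G *ᵥ x)) = a • (D * N.map (MvPolynomial.eval x) * D'))
    (x v : Fin n × Fin n → ℂ) :
    N.map (lineSubst (G *ᵥ x) (G *ᵥ v))
      = a • (D.map MvPolynomial.C * N.map (lineSubst x v) * D'.map MvPolynomial.C) := by
  have hc : (⇑(lineSubst x v) ∘ ⇑(σ G) : MvPolynomial (Fin n × Fin n) ℂ → MvPolynomial (Fin 1) ℂ)
      = ⇑(lineSubst (G *ᵥ x) (G *ᵥ v)) := by
    have := congrArg DFunLike.coe (lineSubst_comp_σ G x v)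
    simpa using this
  have h1 : N.map (lineSubst (G *ᵥ x) (G *ᵥ v)) = (N.map (σ G)).map (lineSubst x v) := by
    rw [Matrix.map_map, hc]
  have h2 : ((a • D).map MvPolynomial.C * N * D'.map MvPolynomial.C).map (lineSubst x v)
      = (a • D).map (MvPolynomial.C : ℂ → MvPolynomial (Fin 1) ℂ) * N.map (lineSubst x v)
          * D'.map (MvPolynomial.C : ℂ → MvPolynomial (Fin 1) ℂ) := by
    have e1 := map_mul (lineSubst x v).toRingHom.mapMatrix ((a • D).map MvPolynomial.C * N) (D'.map MvPolynomial.C)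
    have e2 := map_mul (lineSubst x v).toRingHom.mapMatrix ((a • D).map MvPolynomial.C) N
    rw [e2] at e1
    simp only [RingHom.mapMatrix_apply] at e1
    have e1' : ((a • D).map MvPolynomial.C * N * D'.map MvPolynomial.C).map (lineSubst x v)
        = ((a • D).map MvPolynomial.C).map (lineSubst x v) * N.map (lineSubst x v)
            * (D'.map MvPolynomial.C).map (lineSubst x v) := e1
    rw [e1', map_C_map_lineSubst, map_C_map_lineSubst]
  have h3 : (a • D).map (MvPolynomial.C : ℂ → MvPolynomial (Fin 1) ℂ) = a • D.map (MvPolynomial.C : ℂ → MvPolynomial (Fin 1) ℂ) := by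
    ext i j : 1
    · simp [Matrix.map_apply, MvPolynomial.smul_eq_C_mul]
  rw [h1, map_σ_eq N hconj, h2, h3, Matrix.smul_mul, Matrix.smul_mul]

/-- Equivariance of an affine pencil under the linear change of coordinates `G` (up to a constant conjugation and a nonzero scalar),
the linear analogue of `TorusEquivariant`. -/
def LinEquivariant (N : AffMat n m) (G : Matrix (Fin n × Fin n) (Fin n × Fin n) ℂ) : Prop :=
  ∃ (a : ℂ) (D D' : Matrix (Fin m) (Fin m) ℂ), a ≠ 0 ∧ D * D' = 1 ∧ D' * D = 1 ∧
    ∀ x, N.map (MvPolynomial.eval (G *ᵥ x)) = a • (D * N.map (MvPolynomial.eval x) * D')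

/-- ★ The window cone is stable under every invertible linear symmetry of the pencil. -/
theorem windowCone_linAct (N : AffMat n m) {G G' : Matrix (Fin n × Fin n) (Fin n × Fin n) ℂ} (hG : LinEquivariant N G)
    (hGG' : G * G' = 1) {k : ℕ} {v : Fin n × Fin n → ℂ} (hv : WindowCone N k v) : WindowCone N k (G *ᵥ v) := by
  intro x b hb i j
  obtain ⟨c, D, D', hc, -, hD'D, hconj⟩ := hG
  set x' := G' *ᵥ x with hx'
  have hx : x = G *ᵥ x' := by rw [hx', Matrix.mulVec_mulVec, hGG', Matrix.one_mulVec]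
  rw [hx, map_lineSubst_linAct N hconj x' v, smul_pow]
  have hE'E : D'.map (MvPolynomial.C : ℂ → MvPolynomial (Fin 1) ℂ) * D.map MvPolynomial.C = 1 := by
    rw [← Matrix.map_mul, hD'D, Matrix.map_one MvPolynomial.C (map_zero _) (map_one _)]
  rcases conj_pow (D.map MvPolynomial.C) (D'.map MvPolynomial.C) (N.map (lineSubst x' v)) hE'E b with h | h
  · rw [h]
    exact totalDegree_conj_le D D' (c ^ b) _ (fun i j => hv x' b hb i j) i j
  · rw [h, pow_zero, pow_zero, one_smul, Matrix.one_apply]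
    split_ifs <;> simp

/-- ★★ **UNIPOTENT H_coord IN THE LEDGER CURRENCY.**  A whole-pencil ledger `(K, k)` of an affine pencil with the unipotent one-parameter
symmetry `u ↦ exp (u·A)` (`A` nilpotent on the coordinate space) may be taken `A`-STABLE: same `k`, same finrank, hence same PRICE. -/
theorem ledger_stable_of_unipotentEquivariant (N : AffMat n m) (A : Matrix (Fin n × Fin n) (Fin n × Fin n) ℂ) (hA : IsNilpotent A)
    (hU : ∀ u : ℂ, LinEquivariant N (IsNilpotent.exp (u • A))) (K : Submodule ℂ (Fin n × Fin n → ℂ)) (k : ℕ)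
    (hK : Ledger n m N (fun _ => True) K k) :
    ∃ K₀ : Submodule ℂ (Fin n × Fin n → ℂ), Module.finrank ℂ K₀ = Module.finrank ℂ K ∧
      (∀ v ∈ K₀, A *ᵥ v ∈ K₀) ∧ Ledger n m N (fun _ => True) K₀ k := by
  rw [ledger_top_iff_windowCone] at hK
  have hstab : ∀ u : ℂ, ∀ v ∈ K, ∀ H ∈ windowFamily N k, MvPolynomial.eval (IsNilpotent.exp (u • A) *ᵥ v) H = 0 := by
    intro u v hv
    rw [← windowCone_iff_family]
    have h1 : IsNilpotent.exp (u • A) * IsNilpotent.exp ((-u) • A) = 1 := by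
      rw [exp_smul_mul_exp_smul hA, add_neg_cancel, zero_smul, IsNilpotent.exp_zero]
    exact windowCone_linAct N (hU u) h1 (hK v hv)
  obtain ⟨K₀, hdim, hst, hZ⟩ := exists_stable_of_expStable A hA K (windowFamily N k) hstab
  refine ⟨K₀, hdim, hst, ?_⟩
  rw [ledger_top_iff_windowCone]
  exact fun v hv => (windowCone_iff_family N k v).mpr (hZ v hv)

/-- ★★ **`RelCert` certificates may be taken stable under a unipotent symmetry of the pencil** (by name, vs `SlowCore.RelCert`). -/
theorem relCert_stable_of_unipotentEquivariant (N : AffMat n m) (A : Matrix (Fin n × Fin n) (Fin n × Fin n) ℂ) (hA : IsNilpotent A)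
    (hU : ∀ u : ℂ, LinEquivariant N (IsNilpotent.exp (u • A))) {P : ℕ} (h : RelCert n m N P) :
    ∃ (K : Submodule ℂ (Fin n × Fin n → ℂ)) (k : ℕ), (∀ v ∈ K, A *ᵥ v ∈ K) ∧ Ledger n m N (fun _ => True) K k ∧
      n * k + (n * n - Module.finrank ℂ K) ≤ P := by
  obtain ⟨K, k, hK, hprice⟩ := h
  obtain ⟨K₀, hdim, hst, hK₀⟩ := ledger_stable_of_unipotentEquivariant N A hA hU K k hK
  exact ⟨K₀, k, hst, hK₀, by rwa [hdim]⟩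


/-- ★★ **BOREL NORMAL FORM IN THE LEDGER CURRENCY.**  For an affine pencil equivariant under a torus `λ_w` AND under a unipotent one-parameter group
`exp(u·A)` normalised by the torus (`λ_w(τ) A = c_τ A λ_w(τ)`, `c_τ ≠ 0`), a whole-pencil ledger `(K, k)` may be taken WEIGHT-GRADED AND `A`-STABLE, same `k`,
same finrank (hence same price). -/
theorem ledger_borel_of_equivariant (N : AffMat n m) (w : Fin n × Fin n → ℕ) (hT : TorusEquivariant N w)
    (A : Matrix (Fin n × Fin n) (Fin n × Fin n) ℂ) (hA : IsNilpotent A) (hU : ∀ u : ℂ, LinEquivariant N (IsNilpotent.exp (u • A)))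
    (hcomp : ∀ τ : ℂ, τ ≠ 0 → ∃ c : ℂ, c ≠ 0 ∧
      (Matrix.diagonal fun e => τ ^ w e) * A = c • (A * Matrix.diagonal fun e => τ ^ w e))
    (K : Submodule ℂ (Fin n × Fin n → ℂ)) (k : ℕ) (hK : Ledger n m N (fun _ => True) K k) :
    ∃ K₀ : Submodule ℂ (Fin n × Fin n → ℂ), Module.finrank ℂ K₀ = Module.finrank ℂ K ∧ (∀ s ∈ K₀, ∀ c, wtProj w c s ∈ K₀) ∧
      (∀ v ∈ K₀, A *ᵥ v ∈ K₀) ∧ Ledger n m N (fun _ => True) K₀ k := by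
  rw [ledger_top_iff_windowCone] at hK
  have hZT : ∀ τ : ℂ, τ ≠ 0 → ∀ v : Fin n × Fin n → ℂ, (∀ H ∈ windowFamily N k, MvPolynomial.eval v H = 0) →
      ∀ H ∈ windowFamily N k, MvPolynomial.eval (torusAct w τ v) H = 0 := by
    intro τ hτ v hv
    rw [← windowCone_iff_family] at hv ⊢
    exact windowCone_torusAct N hT hv hτ
  have hZU : ∀ (u : ℂ) (v : Fin n × Fin n → ℂ), (∀ H ∈ windowFamily N k, MvPolynomial.eval v H = 0) →
      ∀ H ∈ windowFamily N k, MvPolynomial.eval (IsNilpotent.exp (u • A) *ᵥ v) H = 0 := by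
    intro u v hv
    rw [← windowCone_iff_family] at hv ⊢
    have h1 : IsNilpotent.exp (u • A) * IsNilpotent.exp ((-u) • A) = 1 := by
      rw [exp_smul_mul_exp_smul hA, add_neg_cancel, zero_smul, IsNilpotent.exp_zero]
    exact windowCone_linAct N (hU u) h1 hv
  obtain ⟨K₀, hdim, hgr, hst, hZ⟩ := exists_graded_stable w A hA hcomp (windowFamily N k) hZT hZU K
    (fun v hv => (windowCone_iff_family N k v).mp (hK v hv))
  refine ⟨K₀, hdim, hgr, hst, ?_⟩
  rw [ledger_top_iff_windowCone]
  exact fun v hv => (windowCone_iff_family N k v).mpr (hZ v hv)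

/-- ★★ **`RelCert` certificates in BOREL NORMAL FORM** (by name, vs `SlowCore.RelCert`): weight-graded and `A`-stable, same price. -/
theorem relCert_borel_of_equivariant (N : AffMat n m) (w : Fin n × Fin n → ℕ) (hT : TorusEquivariant N w)
    (A : Matrix (Fin n × Fin n) (Fin n × Fin n) ℂ) (hA : IsNilpotent A) (hU : ∀ u : ℂ, LinEquivariant N (IsNilpotent.exp (u • A)))
    (hcomp : ∀ τ : ℂ, τ ≠ 0 → ∃ c : ℂ, c ≠ 0 ∧
      (Matrix.diagonal fun e => τ ^ w e) * A = c • (A * Matrix.diagonal fun e => τ ^ w e))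
    {P : ℕ} (h : RelCert n m N P) :
    ∃ (K : Submodule ℂ (Fin n × Fin n → ℂ)) (k : ℕ), (∀ s ∈ K, ∀ c, wtProj w c s ∈ K) ∧ (∀ v ∈ K, A *ᵥ v ∈ K) ∧
      Ledger n m N (fun _ => True) K k ∧ n * k + (n * n - Module.finrank ℂ K) ≤ P := by
  obtain ⟨K, k, hK, hprice⟩ := h
  obtain ⟨K₀, hdim, hgr, hst, hK₀⟩ := ledger_borel_of_equivariant N w hT A hA hU hcomp K k hK
  exact ⟨K₀, k, hgr, hst, hK₀, by rwa [hdim]⟩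

end Summit.ValiantsHypothesis.ValiantsHypothesis.Cruxes.DualUnipotentThreeHalves.InitialForm.LedgerUnipotent

/-! # PART X — Torus closure on the MODULE side (rev 14): invariant subspaces of HOMOGENEOUS operator families; strongly connected ⇒ irreducible

(idea-27 g8 row r10 / crit-7 V38 (B), by name vs `SlowCore.IrreducibleInv`.)  The torus `diag(τ^{h_i})` on `ℂ^ι` conjugates a matrix `G` with
`G i j ≠ 0 → h i + a = h j + c` (HOMOGENEOUS of degree `c − a ∈ ℤ`) to a scalar multiple of itself, so the set of `G`-invariant subspaces is torus-stable
and the torus limit of an invariant subspace — its INITIAL SUBSPACE `initSub h V` (Part I) — is again invariant, weight-graded, of the same dimension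
(`exists_graded_invariant`; no topology: a direct check on initial forms, valid for degrees of either sign).  With SIMPLE weights a graded subspace is a
coordinate subspace, so a family with STRONGLY CONNECTED joint support digraph (`i → j` iff some `G j i ≠ 0`) has no common invariant subspace other than
`⊥`, `⊤` (`bot_or_top_of_stronglyConnected`), and BY NAME `GradedIrreducible.irreducibleInv_of_graded_stronglyConnected : … → IrreducibleInv B` for an
affine pencil and any homogeneous family `𝓜 ⊆ span{B(x)}` (e.g. `B(0)` and the linear coefficient matrices) with strongly connected support.
Honest scope: instruments; nothing here bears on the truth of (c); 24318 OPEN; VP ≠ VNP NOT proved.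
-/

namespace Summit.ValiantsHypothesis.ValiantsHypothesis.Cruxes.DualUnipotentThreeHalves.InitialForm.GradedModule

open Matrix

variable {ι : Type*} [Fintype ι] [DecidableEq ι]

/-- `G` is HOMOGENEOUS for the weights `h` (of degree `c − a ∈ ℤ`): `G i j ≠ 0 → h i + a = h j + c`; i.e. `diag(τ^h) G diag(τ^h)⁻¹ = τ^{c−a} G`.
[this file; predicate, not a research statement] -/
def Homogeneous (h : ι → ℕ) (G : Matrix ι ι ℂ) : Prop := ∃ a c : ℕ, ∀ i j, G i j ≠ 0 → h i + a = h j + c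

omit [DecidableEq ι] in
theorem mulVec_apply' (G : Matrix ι ι ℂ) (v : ι → ℂ) (i : ι) : (G *ᵥ v) i = ∑ j, G i j * v j := rfl

omit [DecidableEq ι] in
/-- The initial subspace of a `G`-invariant subspace is `G`-invariant, for `G` homogeneous (either sign of the degree). -/
theorem initSub_mulVec_mem (h : ι → ℕ) (K : Submodule ℂ (ι → ℂ)) (G : Matrix ι ι ℂ) (hG : Homogeneous h G)
    (hGK : ∀ v ∈ K, G *ᵥ v ∈ K) {s : ι → ℂ} (hs : s ∈ initSub h K) : G *ᵥ s ∈ initSub h K := by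
  classical
  obtain ⟨a, c, hac⟩ := hG
  obtain ⟨t, htK, hsupp, hse⟩ := hs
  refine ⟨fun d => if c ≤ d + a then G *ᵥ t (d + a - c) else 0, fun d => ?_, fun d i hi => ?_, fun i => ?_⟩
  · by_cases hd : c ≤ d + a
    · simp only [hd, if_true]; exact hGK _ (htK _)
    · simp only [hd, if_false]; exact K.zero_mem
  · by_cases hd : c ≤ d + a
    · simp only [hd, if_true, mulVec_apply']
      refine Finset.sum_eq_zero fun j _ => ?_
      by_cases hGij : G i j = 0
      · rw [hGij, zero_mul]
      · have hj : h j < d + a - c := by have := hac i j hGij; omega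
        rw [hsupp (d + a - c) j hj, mul_zero]
    · simp only [hd, if_false, Pi.zero_apply]
  · by_cases hd : c ≤ h i + a
    · simp only [hd, if_true, mulVec_apply']
      refine Finset.sum_congr rfl fun j _ => ?_
      by_cases hGij : G i j = 0
      · rw [hGij, zero_mul, zero_mul]
      · rw [hse j, show h j = h i + a - c by have := hac i j hGij; omega]
    · simp only [hd, if_false, Pi.zero_apply, mulVec_apply']
      refine Finset.sum_eq_zero fun j _ => ?_
      by_cases hGij : G i j = 0
      · rw [hGij, zero_mul]
      · exact absurd (hac i j hGij) (by omega)

omit [DecidableEq ι] in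
/-- ★ **MODULE-SIDE TORUS CLOSURE.**  An invariant subspace of a family of HOMOGENEOUS operators may be replaced by a WEIGHT-GRADED invariant subspace of the
same dimension (its initial subspace along the torus). -/
theorem exists_graded_invariant (h : ι → ℕ) (𝓜 : Set (Matrix ι ι ℂ)) (hhom : ∀ G ∈ 𝓜, Homogeneous h G)
    (V : Submodule ℂ (ι → ℂ)) (hV : ∀ G ∈ 𝓜, ∀ v ∈ V, G *ᵥ v ∈ V) :
    ∃ V₀ : Submodule ℂ (ι → ℂ), Module.finrank ℂ V₀ = Module.finrank ℂ V ∧ (∀ s ∈ V₀, ∀ c, wtProj h c s ∈ V₀) ∧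
      ∀ G ∈ 𝓜, ∀ v ∈ V₀, G *ᵥ v ∈ V₀ :=
  ⟨initSub h V, finrank_initSub h V, fun _ hs c => wtProj_mem_initSub hs c,
    fun G hG _ hv => initSub_mulVec_mem h V G (hhom G hG) (hV G hG) hv⟩

omit [Fintype ι] in
/-- With SIMPLE weights (`h` injective) a graded subspace contains the coordinate components of its vectors. -/
theorem single_mem_of_graded {h : ι → ℕ} (hh : Function.Injective h) {V : Submodule ℂ (ι → ℂ)}
    (hgr : ∀ s ∈ V, ∀ c, wtProj h c s ∈ V) {s : ι → ℂ} (hs : s ∈ V) (i : ι) : Pi.single i (s i) ∈ V := by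
  have : wtProj h (h i) s = Pi.single i (s i) := by
    funext j
    by_cases hji : j = i
    · subst hji; simp [wtProj]
    · have hne : h j ≠ h i := fun heq => hji (hh heq)
      simp [wtProj, hne, hji]
  rw [← this]; exact hgr s hs (h i)

omit [Fintype ι] in
theorem single_one_mem_of_single_mem {V : Submodule ℂ (ι → ℂ)} {i : ι} {x : ℂ} (hx : x ≠ 0) (h : Pi.single i x ∈ V) :
    (Pi.single i (1 : ℂ) : ι → ℂ) ∈ V := by
  have e : (Pi.single i (1 : ℂ) : ι → ℂ) = x⁻¹ • (Pi.single i x : ι → ℂ) := by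
    funext k
    by_cases hk : k = i
    · subst hk; simp [inv_mul_cancel₀ hx]
    · simp [hk]
  rw [e]; exact V.smul_mem _ h

/-- ★ **STRONGLY CONNECTED SUPPORT ⇒ IRREDUCIBLE.**  A family of operators homogeneous for SIMPLE weights whose joint support digraph (`i → j` iff some
`G j i ≠ 0`) is strongly connected — no nonempty proper vertex set is closed under out-edges — has no common invariant subspace other than `⊥` and `⊤`. -/
theorem bot_or_top_of_stronglyConnected {h : ι → ℕ} (hh : Function.Injective h) (𝓜 : Set (Matrix ι ι ℂ))
    (hhom : ∀ G ∈ 𝓜, Homogeneous h G)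
    (hconn : ∀ I : Set ι, I.Nonempty → I ≠ Set.univ → ∃ G ∈ 𝓜, ∃ i ∈ I, ∃ j ∉ I, G j i ≠ 0)
    (V : Submodule ℂ (ι → ℂ)) (hV : ∀ G ∈ 𝓜, ∀ v ∈ V, G *ᵥ v ∈ V) : V = ⊥ ∨ V = ⊤ := by
  classical
  obtain ⟨V₀, hdim, hgr, hinv⟩ := exists_graded_invariant h 𝓜 hhom V hV
  set I : Set ι := {i | (Pi.single i (1 : ℂ) : ι → ℂ) ∈ V₀} with hI
  have hclosed : ∀ G ∈ 𝓜, ∀ i ∈ I, ∀ j, G j i ≠ 0 → j ∈ I := by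
    intro G hG i hi j hji
    have h1 : G *ᵥ (Pi.single i (1 : ℂ)) ∈ V₀ := hinv G hG _ hi
    have h2 := single_mem_of_graded hh hgr h1 j
    have h3 : (G *ᵥ (Pi.single i (1 : ℂ) : ι → ℂ)) j = G j i := by
      simp [mulVec_apply', Pi.single_apply]
    rw [h3] at h2
    exact single_one_mem_of_single_mem hji h2
  rcases Set.eq_empty_or_nonempty I with hIe | hIne
  · left
    have hV0 : V₀ = ⊥ := by
      rw [Submodule.eq_bot_iff]
      intro s hs
      funext i
      by_contra hsi
      have hmem : i ∈ I := single_one_mem_of_single_mem hsi (single_mem_of_graded hh hgr hs i)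
      rw [hIe] at hmem
      exact hmem
    rw [hV0, finrank_bot] at hdim
    exact Submodule.finrank_eq_zero.mp hdim.symm
  · by_cases hIu : I = Set.univ
    · right
      have hV0 : V₀ = ⊤ := by
        rw [eq_top_iff, ← (Pi.basisFun ℂ ι).span_eq, Submodule.span_le]
        rintro _ ⟨i, rfl⟩
        have hi : i ∈ I := hIu ▸ Set.mem_univ i
        rw [Pi.basisFun_apply]
        exact hi
      rw [hV0, finrank_top] at hdim
      exact Submodule.eq_top_of_finrank_eq hdim.symm
    · exfalso
      obtain ⟨G, hG, i, hi, j, hj, hji⟩ := hconn I hIne hIu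
      exact hj (hclosed G hG i hi j hji)

end Summit.ValiantsHypothesis.ValiantsHypothesis.Cruxes.DualUnipotentThreeHalves.InitialForm.GradedModule

namespace Summit.ValiantsHypothesis.ValiantsHypothesis.Cruxes.DualUnipotentThreeHalves.InitialForm.GradedIrreducible

open Matrix
open Summit.ValiantsHypothesis.ValiantsHypothesis.Cruxes.TwoDimCoefficients.DimTwoCases (AffMat IsAffine)
open Summit.ValiantsHypothesis.ValiantsHypothesis.Theorems.GrenetZeon.SlowCore (IrreducibleInv)
open Summit.ValiantsHypothesis.ValiantsHypothesis.Cruxes.DualUnipotentThreeHalves.RadicalSplit (linPencil linPencil_map_eval)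
open Summit.ValiantsHypothesis.ValiantsHypothesis.Cruxes.DualUnipotentThreeHalves.InitialForm.GradedModule (Homogeneous bot_or_top_of_stronglyConnected)

variable {n b : ℕ}

/-- Invariance under every point `B(x)` of the pencil gives invariance under their span. -/
theorem mulVec_mem_of_mem_span (B : AffMat n b) (V : Submodule ℂ (Fin b → ℂ))
    (hV : ∀ x : Fin n × Fin n → ℂ, ∀ w ∈ V, (B.map (MvPolynomial.eval x)) *ᵥ w ∈ V)
    {G : Matrix (Fin b) (Fin b) ℂ} (hG : G ∈ Submodule.span ℂ (Set.range fun x : Fin n × Fin n → ℂ => B.map (MvPolynomial.eval x)))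
    {v : Fin b → ℂ} (hv : v ∈ V) : G *ᵥ v ∈ V := by
  induction hG using Submodule.span_induction with
  | mem G hG => obtain ⟨x, rfl⟩ := hG; exact hV x v hv
  | zero => rw [Matrix.zero_mulVec]; exact V.zero_mem
  | add G G' _ _ h1 h2 => rw [Matrix.add_mulVec]; exact V.add_mem h1 h2
  | smul a G _ h1 => rw [Matrix.smul_mulVec]; exact V.smul_mem a h1

/-- ★ **BY NAME (`SlowCore.IrreducibleInv`): GRADED + STRONGLY CONNECTED ⇒ `IrreducibleInv`.**  If some family `𝓜` of matrices in the span of the points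
`B(x)` of an affine pencil (e.g. `B(0)` and the linear coefficient matrices `B(E_e) − B(0)`) consists of operators HOMOGENEOUS for SIMPLE weights `h` on
`Fin b` and has STRONGLY CONNECTED joint support, then `B` has no common invariant subspace: `IrreducibleInv B`.  (idea-27 g8 r10 — module-side torus
closure, Part I `initSub`; no Burnside, no topology.) -/
theorem irreducibleInv_of_graded_stronglyConnected (B : AffMat n b) (h : Fin b → ℕ) (hh : Function.Injective h)
    (𝓜 : Set (Matrix (Fin b) (Fin b) ℂ))
    (h𝓜 : 𝓜 ⊆ Submodule.span ℂ (Set.range fun x : Fin n × Fin n → ℂ => B.map (MvPolynomial.eval x)))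
    (hhom : ∀ G ∈ 𝓜, Homogeneous h G)
    (hconn : ∀ I : Set (Fin b), I.Nonempty → I ≠ Set.univ → ∃ G ∈ 𝓜, ∃ i ∈ I, ∃ j ∉ I, G j i ≠ 0) :
    IrreducibleInv B := fun V hV =>
  bot_or_top_of_stronglyConnected hh 𝓜 hhom hconn V fun _ hG _ hv => mulVec_mem_of_mem_span B V hV (h𝓜 hG) hv


/-- ★ **LINEAR GRADED PENCILS** (the shape of idea-27 g8's «SCC pencils of a torus-fixed `P₀` with simple weights»): if every coefficient matrix `M e` of
the linear pencil `P₀(x) = Σ_e x_e · M e` is homogeneous for SIMPLE weights `h` and the joint support digraph of the `M e` is strongly connected, then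
`IrreducibleInv (linPencil M)`. -/
theorem irreducibleInv_linPencil_of_graded_stronglyConnected (M : Fin n × Fin n → Matrix (Fin b) (Fin b) ℂ) (h : Fin b → ℕ)
    (hh : Function.Injective h) (hhom : ∀ e, Homogeneous h (M e))
    (hconn : ∀ I : Set (Fin b), I.Nonempty → I ≠ Set.univ → ∃ e, ∃ i ∈ I, ∃ j ∉ I, M e j i ≠ 0) :
    IrreducibleInv (linPencil M) := by
  refine irreducibleInv_of_graded_stronglyConnected (linPencil M) h hh (Set.range M) ?_ ?_ ?_
  · rintro _ ⟨e, rfl⟩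
    refine Submodule.subset_span ⟨Pi.single e 1, ?_⟩
    simp only [linPencil_map_eval, Pi.single_apply, ite_smul, one_smul, zero_smul, Finset.sum_ite_eq', Finset.mem_univ, if_true]
  · rintro _ ⟨e, rfl⟩; exact hhom e
  · intro I hI hIu
    obtain ⟨e, i, hi, j, hj, hne⟩ := hconn I hI hIu
    exact ⟨M e, ⟨e, rfl⟩, i, hi, j, hj, hne⟩

/-! ### The converse (no grading needed) and the EXACT irreducibility test for graded linear pencils -/

/-- The coordinate subspace on a vertex set `I`. -/
def coordSub (I : Set (Fin b)) : Submodule ℂ (Fin b → ℂ) :=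
  Submodule.span ℂ ((fun i => (Pi.single i (1 : ℂ) : Fin b → ℂ)) '' I)

theorem apply_eq_zero_of_mem_coordSub {I : Set (Fin b)} {v : Fin b → ℂ} (hv : v ∈ coordSub I) {j : Fin b} (hj : j ∉ I) :
    v j = 0 := by
  induction hv using Submodule.span_induction with
  | mem v hv =>
    obtain ⟨i, hi, rfl⟩ := hv
    have hji : j ≠ i := fun h => hj (h ▸ hi)
    simp [hji]
  | zero => rfl
  | add v w _ _ h1 h2 => simp [h1, h2]
  | smul a v _ h1 => simp [h1]

/-- A matrix with no edge leaving `I` (`G j i = 0` for `i ∈ I`, `j ∉ I`) preserves the coordinate subspace on `I`. -/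
theorem mulVec_mem_coordSub {I : Set (Fin b)} (G : Matrix (Fin b) (Fin b) ℂ) (hG : ∀ i ∈ I, ∀ j ∉ I, G j i = 0)
    {v : Fin b → ℂ} (hv : v ∈ coordSub I) : G *ᵥ v ∈ coordSub I := by
  induction hv using Submodule.span_induction with
  | mem v hv =>
    obtain ⟨i, hi, rfl⟩ := hv
    have hcol : G *ᵥ (Pi.single i (1 : ℂ) : Fin b → ℂ) = ∑ j, G j i • (Pi.single j (1 : ℂ) : Fin b → ℂ) := by
      funext k
      simp [Matrix.mulVec, dotProduct, Pi.single_apply, Finset.sum_apply]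
    rw [hcol]
    refine Submodule.sum_mem _ fun j _ => ?_
    by_cases hj : j ∈ I
    · exact Submodule.smul_mem _ _ (Submodule.subset_span ⟨j, hj, rfl⟩)
    · rw [hG i hi j hj, zero_smul]; exact Submodule.zero_mem _
  | zero => rw [Matrix.mulVec_zero]; exact Submodule.zero_mem _
  | add v w _ _ h1 h2 => rw [Matrix.mulVec_add]; exact Submodule.add_mem _ h1 h2
  | smul a v _ h1 => rw [Matrix.mulVec_smul]; exact Submodule.smul_mem _ _ h1

/-- The converse direction needs NO grading: a nonempty proper vertex set closed under the joint support digraph of the coefficient matrices spans a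
common invariant coordinate subspace, so the linear pencil is NOT `IrreducibleInv`. -/
theorem not_irreducibleInv_linPencil_of_closed (M : Fin n × Fin n → Matrix (Fin b) (Fin b) ℂ) (I : Set (Fin b)) (hI : I.Nonempty)
    (hIu : I ≠ Set.univ) (hclosed : ∀ e, ∀ i ∈ I, ∀ j ∉ I, M e j i = 0) : ¬ IrreducibleInv (linPencil M) := by
  intro hirr
  have hinv : ∀ x : Fin n × Fin n → ℂ, ∀ w ∈ coordSub I, ((linPencil M).map (MvPolynomial.eval x)) *ᵥ w ∈ coordSub I := by
    intro x w hw
    rw [linPencil_map_eval, Matrix.sum_mulVec]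
    refine Submodule.sum_mem _ fun e _ => ?_
    rw [Matrix.smul_mulVec]
    exact Submodule.smul_mem _ _ (mulVec_mem_coordSub (M e) (hclosed e) hw)
  rcases hirr (coordSub I) hinv with h | h
  · obtain ⟨i, hi⟩ := hI
    have hmem : (Pi.single i (1 : ℂ) : Fin b → ℂ) ∈ coordSub I := Submodule.subset_span ⟨i, hi, rfl⟩
    rw [h, Submodule.mem_bot] at hmem
    have := congrFun hmem i
    simp at this
  · obtain ⟨j, hj⟩ : ∃ j, j ∉ I := by
      by_contra hall
      push Not at hall
      exact hIu (Set.eq_univ_of_forall hall)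
    have hmem : (Pi.single j (1 : ℂ) : Fin b → ℂ) ∈ coordSub I := by rw [h]; exact Submodule.mem_top
    have := apply_eq_zero_of_mem_coordSub hmem hj
    simp at this

/-- ★ **EXACT IRREDUCIBILITY TEST** for linear pencils graded by SIMPLE weights: `IrreducibleInv (linPencil M)` iff the joint support digraph of the
coefficient matrices is strongly connected (no nonempty proper vertex set closed under out-edges).  The census-side instrument: which graded candidate
pencils are irreducible species is a finite combinatorial check. -/
theorem irreducibleInv_linPencil_iff_stronglyConnected (M : Fin n × Fin n → Matrix (Fin b) (Fin b) ℂ) (h : Fin b → ℕ)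
    (hh : Function.Injective h) (hhom : ∀ e, Homogeneous h (M e)) :
    IrreducibleInv (linPencil M) ↔ ∀ I : Set (Fin b), I.Nonempty → I ≠ Set.univ → ∃ e, ∃ i ∈ I, ∃ j ∉ I, M e j i ≠ 0 := by
  refine ⟨fun hirr I hI hIu => ?_, irreducibleInv_linPencil_of_graded_stronglyConnected M h hh hhom⟩
  by_contra hno
  push Not at hno
  exact not_irreducibleInv_linPencil_of_closed M I hI hIu hno hirr

end Summit.ValiantsHypothesis.ValiantsHypothesis.Cruxes.DualUnipotentThreeHalves.InitialForm.GradedIrreducible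

end
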